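import Literature.MathematicalPhysics.QuantumFieldTheory.Balaban1983to89.T4BoundaryRate
import Literature.MathematicalPhysics.QuantumFieldTheory.Balaban1983to89.B14Radii

/-!
# T4BoundaryRateCollar — §12 of `T4BoundaryRate` as a SATELLITE LEAF: the displacement-over-margin factor of BOUNDARY parents
one level down — layer gauge, margin-Cauchy shape on the layered printed spaces, displayed gap shape, collar-decay shape, and
the walk arithmetic of [13] giving the explicit per-collar ratio `e^{−cW}` (cell `pub-balaban`, T4-DAG §5 row T4-U3.E, spine
estimate NE5, boundary-functional member — fan-out prover P3, lineage t4-ne5-p3 gen 6; typing + bookkeeping only; v1.0.1 = v1 + DOCFIX D1 of the cross-read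
C-pv19g7-2: the label of the linear minimizer H of [13] harmonised — ASSERTED via (3.126) + p. 421, not displayed; no code token
changed; v1.1 = v1.0.1 + §12d, THE POLYDISC WALK TOY: the five hypothesis shapes of §12 JOINTLY INHABITED on layered toy carriers,
with the genuine per-collar ratio `e^{−cw} < 1` obtained THROUGH `collarDecay_of_walks`, its exact value and sharpness, and a
`FluctDampedOne` profile decaying geometrically in the scale separation obtained THROUGH `fluctDampedOne_of_collar` — [folklore]
only, nothing about Bałaban's objects added or changed; v1.2 = v1.1 + DOCFIX (LOCATED): the PER-POINT exponential decay of the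
NON-LINEAR minimizer's field derivative IS DISPLAYED in [15] = [Balaban1985Variational] Sect. G, (190) p. 308 / Prop. 9 p. 309 —
derived there from the kernel bound (189), the formulated final result whose calculations print does not perform (label made
precise in v1.3) — so the v1–v1.1 label «by reference only for the
non-linear 𝐇_k» is sharpened in (D), THE CELL GAP, `CollarDecay`, `WalkBound`, `WalkShape`, `collarDecay_of_walks`; the PER-COLLAR
constant stays displayed nowhere; no code token changed); v1.3 = v1.2 + §12e, THE ANALYTIC FRAME [folklore + hypothesis shapes]:
the margin-Cauchy shape (B) with its modulus DERIVED — `c₀ = 4`, kernel-checked (Liouville's theorem + Cauchy's estimate on one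
complex line) — from five located HYPOTHESIS SHAPES over a posited encoding `CplxFrame` of the backgrounds in a complex normed space
(the chart a translation — print's affine `t_□`-device, [I] p. 273; the layer gauge dominating the layer seminorms of the
displacement; the closed gap-polydisc about every core point inside the parent's encoded domain — p. 277's margin; the admissible
tables real components of ONE complex-differentiable function there — (2.41)(ii) p. 261), so that an instantiation owes the five
shapes and no longer a modulus; the displayed radius factors of the tree's `B14Radii` (pv02; the one new import, a Mathlib-only
leaf) give `GapShape` with `ρ = 2` for layer-constant coefficients; the §12c toy is a frame; every v1.2 code token is byte-identical,
with four docstring touches riding (the cross-read C-pv11g15-14's INFO I2, I3, I5, and — at seven loci — the label of [15] (190)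
p. 308 made precise after C-B11-G27a (P4), render p032 re-read as image: (190) is DERIVED in print — *"This inequality, the formula
(188) and Lemma 2.1, and finally Proposition 2 and (181), yield"* (190) — from the kernel bound (189), which is the formulated final
result whose calculations print does not perform); v1.3.1 = v1.3 + DOCFIX (cross-read C-adv8-81, every code token byte-identical):
D1 — p. 262's *"newly created expressions 𝐄^{(k)}, 𝐑^{(k)}, 𝐁^{(k)} are defined on slightly larger spaces"* is, on the page, the
transient WITHIN-STEP enlargement of the newly created index-`k` terms after the operation `T` (*"Such improved bounds are needed
for the 𝐑-operation"*), not the parent-over-child margin, so it is relabelled CONTEXT and dropped as a support of (F-M), whose loci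
are the antitone radius factors of (2.34)–(2.39) and p. 277; D2 — the (3.15) gloss restored to print's *"(1/2πi)∫_{|t_□|=r} dt_□
(1/t_□²)𝐄^{(j)}(X, …, …)"*; INFO I1 (print bounds the `t_□`-derivative at `0`, the typed step the difference at `1`) and I2 (the
shape (F-An) reads the table as already extended) recorded as clauses; v1.4 = v1.3.1 + §12f, THE PATH FRAME [folklore + one
hypothesis shape]: print's OUTER device of [I] pp. 270–273 typed — the real interpolation path `B(t)` of (3.4) (the shape (F-P)
`FramePath`: a differentiable path of MARGIN POINTS from the encoded core point to the displaced point, its velocity dominated by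
the layer gauge — print's `δ𝐇_j` of (3.8)–(3.9), the path kept in the space by p. 273's *"𝐇_j(B(t)) satisfies (3.14) with 1/3α₂"*),
over which Cauchy's estimate for the DIRECTIONAL DERIVATIVE at every path point ((3.15)–(3.17) at `t_□ = 0`, modulus exactly
print's `1/r` — INFO I1 of C-adv8-81 answered) and the mean value inequality on `[0,1]` give `MarginCauchy` with `c₀ = 2` (the
Re/Im reading alone; no affine chart, no regime split, the half-gap precondition unused): `marginCauchy_of_pathFrame`,
`ne5B_of_pathFrame`; the affine frame is the straight-path case (`framePath_of_segment`) and the §12c toy a path frame with print's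
margin split (path room `s`, circle room `r`); + §12g, GAUGE NORMALIZATION [folklore]: `MarginCauchy` is covariant under rescaling
the gauge and the gaps by positive layer weights (`LayerGauge.rescale`, `marginCauchy_rescale`), so the printed radii with their
LAYER-DEPENDENT coefficients `α_{·,n}` ((2.28) p. 259), read in each layer's own coefficient unit, give `GapShape` with `ρ = 2`
EXACTLY (`gapShape_of_shrink_normalized`, `fluctDampedOne_of_collar_normalized`) — the coefficient variation is part of the
normalized collar-decay binder, not of `ρ`; every v1.3.1 code token byte-identical; v1.4.1 = v1.4 + DOCFIX (cross-reads
C-pv19g11-1 D-1/D-2 and C-t4r2-114 / G-t4r2-93; every code token byte-identical): the two quotations of (3.9) now carry print's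
governing case clause (p. 271 *"In the case when dist^{(ξ)}(X, □) ≥ M(Lʲη)^{−1}"*; second case without the exponential factors,
p. 273) with the display's left side `|δ𝐇_j|` alone, and the decaying object behind (3.9) is named as print names it — the functional
derivative `(δ/δB)𝐇_j` (p. 271, *"see Proposition 9, (190) [15]"*), `𝐇_k(B′)` entering only through the source factor; v1.5 =
v1.4.1 + §12h CONVEX ENCODINGS [folklore] (every v1.4.1 code token byte-identical): margin points form a CONVEX set when the
parents' encoded domains are convex (`convex_marginPts`), so for a convex encoding with (F-G) and nonempty admissible amplitudes
the path hypothesis (F-P) is EQUIVALENT to two STATIC inclusions — (F-M) for the start point and the endpoint-margin shape (F-E)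
`FrameEndMargin` for the
displaced point (`framePath_of_convex`, `framePath_iff_margins_of_convex`; the chord is the path); the §12c toy re-derived that way
(`shift_framePath_convex`).  Convexity is a property of an ENCODING, chosen by an instantiation — nothing about print's spaces is
claimed; v1.5.1 = v1.5 + DOCFIX (cross-read C-pv01-104 D-1: the nonempty-amplitude qualifier of the two (F-P) ⟺ (F-M) ∧ (F-E)
sentences, here and in §12h's section text — (F-P) ⇒ (F-M) reads the path at `t = 0` for SOME admissible amplitude; every code token
byte-identical).  The
parent module `T4BoundaryRate` v1.6.2 (189 571 bytes) sits within 6 % of the gate's module-size cap (200 000 bytes), so its §12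
is housed here; NOTHING of the parent is modified, it is imported and used BY NAME (`FluctChart`, `fluct`, `FluctDampedOne`,
`fluctDamped_of_one`, `LayeredDamped`, `ne5B_of_layered`, the Cauchy carriers and the shift chart of §8/§10b).

HONEST FRAMING (T4-DAG PAGE 1; identical to the parent's).  The cell's T4 target is rung (B)+1: existence AND uniqueness of the
ε → 0 limit of Bałaban's unit-scale averaged loop expectations on a FIXED finite torus — strictly beyond ultraviolet stability,
NOT infinite volume, NOT a mass gap, NOT the Clay problem.  The boundary-functional member `T4BoundaryCarrier.NE5B` of the spine
estimate NE5 is a TWO-RUN statement and NOTHING OF IT IS PRINTED: the manuscripts under audit construct ONE run.  This module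
ASSERTS NOTHING about Bałaban's objects: every `def … : Prop` below is a HYPOTHESIS SHAPE over the ABSTRACT carriers of
`T4BoundaryCarrier` (labelled NOT PRINTED / DISPLAYED-one-run / PRINTED-MECHANISM), `LayerGauge` is a posited bookkeeping
interface with no existence smuggled, and every `theorem` is kernel-checked real-analysis bookkeeping about the shapes.  The
audited manuscripts are quoted for CONTEXT only, by page, from the ×2 renders read as images; no disputed step of theirs is used.
Value = §11's located-but-undisplayed profile of the boundary-parent factor DERIVED from three separately sourced shapes, with
the per-collar ratio made an explicit function of displayed constants GIVEN the by-reference walk expansion — i.e. the exact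
list of what remains unprinted, typed; NOT summit progress.  Cell record: `t4/T4-EST-U3-NE5B-P3.md` §10.

CONTENT = `T4BoundaryRate` §12: `FluctDampedOne` WITH THE LAYERED PROFILE ONE LEVEL DOWN — THE THREE SHAPES AND THE WALK ARITHMETIC
OF [13] [folklore + hypothesis shapes; §-numbers 7–11 refer to the parent module; renders read as IMAGES by this cell: ref1 `1985-cmp99-background-propagators` p021–p023, p027–p029,
p032–p033 = journal pp. 409–411, 415–417, 420–421; `1988-cmp119-convergent-renormalization` p014, p019, p034–p035 = pp. 256, 261,
276–277; `1987-cmp109-rg-I-small-field` p025 = p. 273; v1.2: `1985-cmp102-variational-background` p031–p033 = pp. 307–309,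
`1987-cmp109-rg-I-small-field` p034 = p. 282 and p051 = p. 299 (bibliography of [I]: [13] = CMP 99:389, [15] = CMP 102:277),
`1988-cmp119-convergent-renormalization` p043 = p. 285 (references of [III] = I, II *"and references therein"*); v1.3 (re-read):
`1988-cmp119-convergent-renormalization` p019–p020, p034–p035 = pp. 261–262, 276–277, `1987-cmp109-rg-I-small-field` p025 = p. 273,
`1985-cmp102-variational-background` p032 = p. 308; v1.4 (read as images): `1987-cmp109-rg-I-small-field` p022–p025 =
pp. 270–273, `1988-cmp119-convergent-renormalization` p017 = p. 259].  (A) `LayerGauge` — POSITED INTERFACE (bookkeeping, no existence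
smuggled: an instance is a datum of every theorem, §12c builds one): the size, IN THE UNIT OF THE LAYER of scale `n`, of the
difference of two backgrounds on that layer — the typed reading of the layer-wise radii of [III] p. 261, each stated in the
layer's own unit `Lⁿξ`: (2.34) *"|∂U − 1|, |∂𝐔 − 1| < (1 − β(1 − 2^{−(j−n)}))α_{0,n}ξ²(Lⁿξ)^{−2}"*, (2.39) *"Lⁿξ|A′|, (Lⁿξ)²|∇^ξ_U A′| <
(1 − β(1 − 2^{−(j−n)}))α_{1,n}"*, *"on X∩(Ωₙ∖Ω_{n+1}) for n = 1,....,j−1, or on X∩Ω_j for n = j"*.  (B) `MarginCauchy G ch W κ AdmT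
lg gap c₀` — PRINTED-MECHANISM SHAPE (ONE run, ONE table, typed abstractly, asserted for nothing of Bałaban's): [I] p. 273's
Cauchy step — (3.15) with *"the radius r given by the equality r max{|δ𝐇_j|_X, |P₁δ𝐇_j|_X, |∇^ξ_𝐔δ𝐇_j|_X, |Δ^ξ_𝐔δ𝐇_j|_X} = ⅓α₂"*,
(3.17) *"|(3.15)| ≤ (1/r)E₀exp(−κd_j(X))"*, *"Let us stress that it follows only from the fact that 𝐇_j(B(t)) satisfies (3.14) with
1/3α₂, and δ𝐇_j satisfies (3.9)."* — READ ON THE LAYERED SPACES: print's `1/r` = (displacement)/(margin) maximised over the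
finitely many constrained seminorms is at most the SUM, over the parent's constrained layers `n = scale Y − i`, `i ≤ scale Y`,
of `dist_n(displaced, undisplaced)/gap_n`, PROVIDED every displacement is at most half the gap (p. 277: *"The localization of
the fluctuation field, and the exponential decay of the minimizing function 𝐇_k imply that this difference is still much greater
than bounds on this function."*).  (C) `GapShape G gap g₀ ρ` — DISPLAYED PROFILE, undisplayed constants: by (2.34)–(2.39) the
index-`j` and index-(k+1) radius factors on the layer `n ≤ j` differ by `β(2^{−(j−n)} − 2^{−(k+1−n)}) ≥ ½β·2^{−(j−n)}` — UNIFORM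
in `k`, HALVING per older layer of the parent (p. 277: *"This is the reason for putting the powers of 1/2 in the conditions
(2.36)–(2.39). The analyticity domains become smaller after each step, but the difference is very small and exponentially
decreasing in the number of steps."*); typed `0 < gap X Y i`, `g₀ ≤ gap X Y i·ρ^i`, where `ρ` absorbs the halving AND the
variation of the constants `α_{·,n}` between layers, polynomial in the scale difference by (2.8)–(2.9) p. 256 (*"ε_m ≤
(1 + β₀)(1 + g_n²β′(n − m))^{β₀}ε_n ≤ (1 + β₀)²(n − m)^{β₀}ε_n"*, *"R_m ≤ L(1 + g_n²β′(n − m))^{β₀}R_n ≤ (L + 1)(n − m)^{β₀}R_n"*,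
*"Similar inequalities hold for other constants, which will be introduced later."*) — no value of `ρ` is printed.  UNITS
(certification, not a located gap): numerator and denominator of each layer's ratio are in the SAME unit `Lⁿξ`, and the
displayed kernel bounds of [13] are scale-free between layer units (p. 410: *"The first factor O(1)(L^jη)² is unessential and is
connected with the supremum norm, if we take another norm we get another factor with a different power of L^jη."*), so no
unit-conversion constant enters beyond `ρ`.  (D) `CollarDecay ch lg ε δ` — HYPOTHESIS SHAPE: the displacement seen on the layer of
scale `n < scale X` under an admissible fluctuation configuration of the step creating `X` is `≤ ε·δ^{scale X − n}` in the layer's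
unit — ONE FACTOR `δ` PER COLLAR between the fluctuation region `Ω_{scale X}` and the layer.  DISPLAYED, one run, for the
PROPAGATORS of the sequence {Ω_j}: `G′` ((3.94) p. 410, quoted in §11 above) and `G` — [13] Theorem 3.10 pp. 415–416: *"For M
sufficiently large, and a configuration U satisfying (3.95), the operator G has the expansion G = Σ_ω R₀(X₀)R_{α₁}(X₁)·····
R_{αₙ}(Xₙ), (3.107) the sum is over walks ω = ((0, X₀), (α₁, X₁), …, (αₙ, Xₙ)) satisfying X_{i−1}∩Xᵢ ≠ ∅, i = 1,…, n. A term in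
this expansion, corresponding to a walk ω, depends on configuration U restricted to X̃₀⁵∪X̃₁⁵∪…∪X̃ₙ⁵, satisfies the inequality
|(R₀(X₀)R_{α₁}(X₁)·····R_{αₙ}(Xₙ)J)(x)| ≤ O(1)(L^jη)²O(M^{−1/2})^{|ω|}·M^{−1/2|ω|}e^{−(1/2)δ₀d(ω,y,y′)}|J|, x∈Δ(y), y∈Λ_j, supp J ⊂
Δ(y′), (3.108)"*, *"The constant O(1) depends on d and L only."*, *"From (3.108) it follows that the expansion (3.107) is
convergent in all norms in the inequalities (3.42)–(3.47)."*; the scale-free factor per separation, p. 411: the kernels are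
restricted *"to points separated at least by a distance ML^jη (if □∈𝒟_j). Hence the part of the exponential factor can be
estimated by e^{−(1/4)δ₀M}"*.  ASSERTED (composed, NO per-walk formula displayed), one run, for the LINEAR minimizer `H` of
(3.109)–(3.110) p. 417, through the displayed REPRESENTATION (3.126) p. 420 *"HB = GQ*(QGQ*)^{−1}B"* with p. 421 *"Now we will prove
that Theorems 3.3, 3.10, 3.11 hold for the propagators G, G₁. This will be an immediate consequence of perturbative expansions we
will construct."* and, for the remaining factor, p. 421 *"3.11. We have to investigate also the operator (QGQ*)^{−1}, but the
analysis is very similar to this for the operator (Q′G′²Q′*)^{−1}."* — *"we define H(U)B,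
or simply HB, as a minimal configuration of the functional A → ½⟨A, Δ(U)A⟩, (3.109)"*, *"This minimum is denoted by HB. It
define a linear operator H."*, and *"this variational problem is a linear approximation to a general non-linear variational
problem for group-valued configurations we will consider in forthcoming papers."*  For the NON-LINEAR minimizing
function 𝐇_k — the `ℋ(B)` of the announced *"forthcoming"* paper, [15] = [Balaban1985Variational] Sect. G (numbering of [I]'s
bibliography p. 299, like [13]; Prop. 9 p. 309: *"The function U_k(V′V₀)U_k(V₀)⁻¹ transformed to the Landau gauge is, by the
definition, equal to exp iηℋ(B), where B = 1/i log V′."* […] *"and its functional derivative (182) satisfies the inequalities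
(190)."*) — the PER-POINT exponential decay of the field derivative IS DISPLAYED, one run, in the multi-scale geometry, (190)
p. 308: *"|(δ/δB_ν(y′))ℋ_μ(B, x)|, […] ≤ O(1)[(Lʲη)^{−1}, […]]·(L^{j′}η)^{−d}exp(−⅛δ₀d(y, y′)) (190) for x∈Δ(y), or supp ζ ⊂ Δ̃(y),
y∈Λ_j, y′∈Λ_{j′}."* — DERIVED IN PRINT (p. 308: *"This inequality, the formula (188) and Lemma 2.1, and finally Proposition 2 and
(181), yield"* (190)) FROM THE KERNEL BOUND (189), THE FORMULATED FINAL RESULT WHOSE CALCULATIONS PRINT DOES NOT PERFORM (p. 308: *"To prove an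
exponential decay we have to investigate more closely the kernel ((δ²/δA′²)V)(A′). This is, unfortunately, a very awkward and
complicated problem, although quite straightforward. […] We do not perform these calculations here, we have obtained all necessary
results to do the calculations and estimates, let us formulate a final result only."*; announced p. 307: *"In the future we will
have to use decay properties of the functional derivative (δ/δB)ℋ(B). We will prove that this derivative has regularity and decay
properties identical to the propagator H, or H₀."*; typed in the tree, never asserted, as `B11.Prop9Printed`; cell GAPS G-B11-G2),
ASSERTED per step in [I] p. 282 (*"The functional derivative (δ^{n(p)})/(δB^{n(p)})𝐇_j(□₀, 0) is given by a sum of several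
perturbative expressions discussed in Sect. G [15]. Each expression corresponds to a tree graph with n(p) initial points and one
final point, and it has an exponential decay in a length of this graph."*, *"if one of the functions B_i is localized outside the
domain X, then we have the additional exponential factor exp(−δ₀dist^{(ξ)}(X, supp B_i))"*), and BY REFERENCE in [III] p. 276
(*"In fact we have better bounds, because the fluctuation field is localized in Ω_{k+1}, and the exponential decay of propagators
and minimizing functions yields additional small factors."*, *"so we apply Theorems 3.7–3.10 [13] in their full generality"*).
DISPLAYED NOWHERE: the PER-COLLAR constant — `CollarDecay`'s ratio for 𝐇_k across the cover {Ω_j} is (190) summed over the source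
points y′ of the fluctuation region with half of its rate and [15]'s Lemma 2.1 (p. 308: *"This inequality, the formula (188) and
Lemma 2.1, and finally Proposition 2 and (181), yield"* (190)) GIVEN the collar geometry — THIS CELL'S READING (`W`); in the typed
form that is `collarDecay_of_walks` with `ι` := the source points, no walks.  BY REFERENCE ONLY for the arguments of the boundary
terms ([III] p. 276).  THEOREMS: `layeredSigma`,
`layeredDamped_layeredSigma` (the factor `s₀Σ_{i ≤ scale Y}δ^{(scale X − scale Y)+i}ρ^i` IS §11's `LayeredDamped`, unit weights);
`fluctDampedOne_of_collar` — (B)+(C)+(D) with `0 ≤ δ ≤ 1`, `δρ ≤ 1` and the smallness `2ε ≤ g₀` (every displacement below half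
the gap, p. 277's sentence as a hypothesis-free consequence) give §10's `FluctDampedOne` with `σ = layeredSigma (c₀ε/g₀) δ ρ`:
§11's profile DERIVED, `s₀ = c₀ε/g₀`; `fluctDamped_of_collar`; `ne5B_of_collar` — END-TO-END through `ne5B_of_layered` BY NAME.
(12b) THE WALK ARITHMETIC of [13] (p. 410: *"We will use the factor O(M^{−1/2}) to control the sum over random walks ω, and the
last two factors in (3.94) will be important for other purposes."*): `walkSum_le` — terms bounded by an entropy weight times
`e^{−c·(scaled length)}`, entropy sums bounded by `A`, and scaled length `≥ N·W` for every contributing walk give `|Σ| ≤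
A·(e^{−cW})^N`: ONE EXPLICIT FACTOR `e^{−cW}` PER COLLAR; `WalkBound` (HYPOTHESIS SHAPE — [III] p. 276's by-reference step typed:
the layer-`n` displacement is controlled by the partial sums, at every base point, of a walk expansion, as print displays for
`G′` (3.90), `G` (3.107), `H` (3.126)); `WalkShape` (the displayed per-walk shape (3.94)/(3.108) typed abstractly, PLUS this
cell's reading — NOT displayed — that a walk contributing on the layer `n` joins it to `Ω_{scale X}` across the `scale X − n`
collars in between, each adding `≥ W` to the scaled length (3.93), the boundaries being separated by [III] p. 256's *"at least
equal to 2MR_j"*; the value of `W` in (3.93)'s scaled length is not displayed); `collarDecay_of_walks` — `CollarDecay` with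
`ε = ε₀A` and `δ = e^{−cW}`; `perCollar_ratio_lt_one`, `perCollar_ratio_le_half` (`e^{−cW} ≤ ½ ⇐ cW ≥ log 2`: the ratio hypothesis
of §11's `displacement_le_domainDifference`, whose other hypothesis is the first-gap smallness `ε ≤ ½βα`).  (12c) THE TOY:
`shiftGauge`, `cauchy_marginCauchy` — on §8's Cauchy carriers the shift chart of §10b REALISES `MarginCauchy` with `c₀ = 4` and
the constant gap `r` (Cauchy's estimate on circles of radius `r/2` and the mean value inequality on the disc of radius `ρ + r/2`;
the half-gap precondition is `‖𝒜‖ ≤ r/2`), `cauchy_gapShape` (`g₀ = r`, `ρ = 1`), `cauchy_collarDecay` (`δ = 1`: the toy has no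
collar geometry — it witnesses the mechanism (B), not the decay (D), whose content is `WalkBound`), and
`cauchy_fluctDampedOne_of_collar` (consistency with §10b).  (12d) THE POLYDISC WALK TOY [folklore] — the five shapes JOINTLY
INHABITED, non-degenerately, on the layered toy carriers `polyCarriers` (a background = one complex value per layer, every older
piece a parent): the walk arithmetic `stepWeight` (`q = e^{−c}/2`: entropy `½` per step times decay `e^{−c}` per unit of scaled
length), `walkTerm` (a walk of `ℓ` steps carries `A·q^ℓ` iff it is long enough to cross the `scale X − n` collars of `w` steps each —
the short walks' terms VANISH, which is the reindexing an instantiating model owes, cf. `WalkShape`), `walkDisp` (the geometric tail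
`q^{(X−n)w}/(1 − q)`), `walkTerm_hasSum`, `walkDisp_le_of_partialSums`, `walkTerm_abs_le`, `walkTerm_sep`, `walk_entropy` (`≤ 2s`,
`sum_geometric_two_le`); the chart `polyChart ρ c w s` (core = the open polydisc of radius `ρ`, amplitudes `‖𝒜‖ ≤ s`, the layer `n`
displaced by `𝒜·walkDisp`), the gauge `polyGauge` (modulus per layer), `poly_dist_chart`; `poly_walkBound` (`ε₀ = 1`),
`poly_walkShape` (`a ℓ = s(½)^ℓ`, `dω ℓ = ℓ`, `W = w`), hence `poly_collarDecay` = `CollarDecay` with `ε = 2s` and THE GENUINE RATIO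
`δ = e^{−cw}` THROUGH `collarDecay_of_walks`; `poly_displacement_pos` (the chart moves every layer, the crossing walks' terms are
non-zero); `poly_collarDecay_exact` (directly: ratio `q^w = e^{−cw}2^{−w}`, the entropy gain `2^{−w}` being what `walkSum_le` spends on
counting) and `poly_not_collarDecay_below` (NO ratio `δ′ < q^w` works, for any constant, given `0 < s` and a non-empty core `0 < ρ` — for `ρ ≤ 0`
every shape of §12 holds vacuously on the toy: the per-collar ratio is a property of the
chart read exactly by the layer gauge); the admissible class `PolyAdmT ρ r` (layer-local tables — the piece `m` reads the layers
`n ≤ m` only — separately holomorphic with margin `r` beyond the core radius in EVERY layer: the layered printed-space convention of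
[III] p. 261 in the toy), `pcplx`/`cpart_pcplx`, `oneVar_cauchy` (§10b's one-variable Cauchy step abstracted: `‖φ(z+δ) − φ(z)‖ ≤
(2‖δ‖/r)·B`), `poly_marginCauchy` = `MarginCauchy` with `c₀ = 4` and the constant gap `r` (telescoping over the layers `0, …, scale Y`,
one Cauchy step per layer under the half-gap precondition — print's `1/r` maximised over the layers, [I] p. 273 with [III] p. 261),
`poly_gapShape`; `clipTable`/`polyAdmT_clip`/`clipTable_abs_le`/`clipTable_fluct` (the class is inhabited by a non-constant table
bounded by `ρ + r` whose inserted fluctuation difference IS the layer displacement); END-TO-END `poly_fluctDampedOne_of_collar` =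
`FluctDampedOne` with `σ = layeredSigma (8s/r) (e^{−cw}) 1 ≤ (8s/r)(e^{−cw})^{scale X − scale Y}/(1 − e^{−cw})` for `4s ≤ r` (the closed form for `c > 0`, `w ≥ 1`, by the
parent's `layerSum_le` — prose, not a theorem of this file; the theorem is stated for `0 ≤ c` and any `w`) — the first model in the tree in which §11's profile, DECAYING IN THE SCALE SEPARATION, is produced by the mechanism of §12 (§12c's toy has
`δ = 1`).  (12e) THE ANALYTIC FRAME [folklore + hypothesis shapes] — (B)'s MODULUS DERIVED: `CplxFrame C A E` (POSITED INTERFACE, no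
existence smuggled: layer seminorms `semi`, encoded points `pt`, displacement vectors `disp`, encoded domains `dom`); the five
HYPOTHESIS SHAPES `FrameChart` (the chart is the translation by `disp` — [I] p. 273 *"To get an analytic extension of (3.7) we
substitute 𝐀 = 𝐇_j(B(t)) + t_□⟨…⟩"*), `FrameCore` (core points are encoded), `FrameGauge` (`semi n (disp) ≤ dist n (chart U) U` —
the maxima of p. 273's radius equality, read per layer), `FrameMargin` (the CLOSED gap-polydisc about a core point of the child lies
in the parent's `dom Y` — p. 277 *"we have to use a part of the analyticity domains of terms in 𝐁_k for the function 𝐇_k"* and the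
antitone radius factors of (2.34)–(2.39); p. 262's *"slightly larger spaces"* of the newly created terms is the within-step
enlargement consumed by 𝐑 — CONTEXT, not a support, C-adv8-81 D1), `FrameAnalytic` (every admissible
table on encoded points is a real component of ONE function complex differentiable on `dom Y` — (2.41) p. 261 *"(ii) it has an
extension to an analytic function on the space Ũ^c_j(X, α̃₀, α̃₁)"*); `norm_le_abs_cpart_add`; `norm_sub_le_two_mul_div`
(`Dimock2015.norm_sub_le_div_of_bound_sphere` at radius `r ≥ 2`: `≤ 2M/r`); `line_difference_le` (the complex line `z + t•v` inside
the domain for `‖t‖·S ≤ 1`, `0 ≤ S < ½` ⇒ `‖hc (z + v) − hc z‖ ≤ 2SM`; Liouville at `S = 0`); `marginCauchy_of_frame` — `MarginCauchy`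
WITH `c₀ = 4` (`2` for reading a real component off a complex value bounded through both components, `× 2` for `1/(r − 1) ≤ 2/r`);
`fluctDampedOne_of_frame`, `fluctDamped_of_frame`, `ne5B_of_frame` (END-TO-END: `ne5B_of_collar` with its margin-Cauchy binder
replaced by the five frame hypotheses, constant with `s₀ = 4ε/g₀`).  (12e-ii) `gapShape_of_shrink` — from the radius factors
`B14Radii.shrink β m = 1 − β(1 − 2^{−m})` of (2.34)–(2.39) p. 261 (typed in the tree, pv02) with a layer-constant coefficient:
`gap X Y j = a·(shrink β j − shrink β (scale X − scale Y + j))·α = aβα·2^{−j}(1 − 2^{−(scale X − scale Y)}) ≥ aβα·2^{−(j+1)}`, i.e.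
`GapShape` with `g₀ = aβα/2`, `ρ = 2` (the slow layer variation (2.8)–(2.9) of the printed `α_{·,n}` is not modelled — it multiplies
`ρ`; or it is normalized away, §12g).  (12e-iii) `shiftFrame`, `shift_frameChart`/`Core`/`Gauge`/`Margin`/`Analytic`: the §12c toy IS a frame;
`cauchy_marginCauchy_of_frame` (literally the statement of `cauchy_marginCauchy`, now an instance of `marginCauchy_of_frame`) and
`cauchy_fluctDampedOne_of_frame`.  (12f) THE PATH FRAME [folklore + one hypothesis shape] — print's OUTER device typed: `marginPts`
(the encoded points about which the closed gap-polydisc lies in every parent's encoded domain — the set (F-M) speaks about;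
`frameMargin_iff_marginPts`, `mem_dom_of_mem_marginPts`); `FramePath` (HYPOTHESIS SHAPE (F-P): a path on `[0,1]` of margin points
from the core-encoded point to the displaced point, differentiable, with velocity dominated layer-wise by the layer gauge of the
displacement — [I] (3.4) p. 270, `B(t)` p. 271, (3.8)–(3.9), p. 273); `norm_fderivWithin_apply_le` (Cauchy's estimate for the
DIRECTIONAL derivative: the closed disc `{p + s•v : ‖s‖ ≤ R}` in the domain, modulus bound `M` ⇒ `‖∂_v hc (p)‖ ≤ M/R` — Mathlib's
`Complex.norm_deriv_le_of_forall_mem_sphere_norm_le` on the complex line, the within-derivative along the line by the chain rule);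
`le_mul_of_forall_radius`; `norm_fderivWithin_velocity_le` ((3.17) typed: the disc of radius `1/S` gives `≤ S·M`);
`path_difference_le` (the mean value inequality on `[0,1]` over the velocity bound at every path point: `‖hc (γ 1) − hc (γ 0)‖ ≤
S·M`); `marginCauchy_of_pathFrame` — `MarginCauchy` WITH `c₀ = 2` from (F-Ch), (F-Co), (F-P), (F-An) and positive gaps;
`fluctDampedOne_of_pathFrame`, `fluctDamped_of_pathFrame`, `ne5B_of_pathFrame` (END-TO-END, constant with `s₀ = 2ε/g₀`);
`framePath_of_segment` (the affine frame = the straight path: (F-G) + the segment made of margin points ⇒ (F-P)); (12f-ii)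
`shift_frameChart'`/`Core'`/`Gauge'` (any encoded radius), `shift_marginPts`, `shift_framePath` (core radius `ρ`, amplitudes `≤ s`,
circles of radius `r`, encoded radius `ρ + s + r` — print's margin split between the path and the circles), `cauchy_marginCauchy_of_pathFrame`
(`c₀ = 2`), `cauchy_fluctDampedOne_of_pathFrame` (`layeredSigma (2s/r) 1 1`).  (12g) GAUGE NORMALIZATION [folklore + bookkeeping]:
`LayerGauge.rescale` (read the layer of scale `n` in the unit `u n > 0`), `LayerGauge.rescale_dist`, `marginCauchy_rescale`
(`MarginCauchy (lg, gap, c₀) ⇒ MarginCauchy (lg/u, gap/u, c₀)`: every displacement-over-margin ratio and the half-gap precondition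
are invariant), `collarDecay_rescale_of_floor` (a coefficient floor `0 < u₀ ≤ u n` moves `CollarDecay ε δ` to the rescaled gauge with
`ε/u₀` — a floor enters the amplitude, NOT `ρ`), `gapShape_of_shrink_normalized` (the printed-radii gaps `a·(shrink β j − shrink β
(scale X − scale Y + j))·α(scale Y − j)` with a layer-DEPENDENT coefficient, rescaled by `u = α`, ARE the `α = 1` profile of
`gapShape_of_shrink`: `g₀ = aβ/2`, `ρ = 2`), `fluctDampedOne_of_collar_normalized` (`MarginCauchy` on those gaps, any `c₀ ≥ 0`, +
`CollarDecay` OF THE RESCALED GAUGE with `δ ≤ ½` and `2ε ≤ aβ/2` ⇒ `FluctDampedOne` with `layeredSigma (c₀ε/(aβ/2)) δ 2`).  THE CELL GAP AFTER THIS MODULE, TYPED NOT DECIDED: §11's profile in the scale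
separation is now DERIVED from three separately sourced shapes, and its per-collar ratio is the explicit `e^{−cW}` of the
displayed decay rate (`c = ½δ₀`) GIVEN a walk expansion of the displacement of the displayed shape; what remains NOT PRINTED is
exactly — the PER-COLLAR `WalkBound`/`CollarDecay` for the non-linear 𝐇_k (per POINT displayed, [15] (190) p. 308, derived in print from
the kernel bound (189) — the formulated final result whose calculations print does not perform; per collar = this cell's summation reading) and for the boundary terms'
arguments (p. 276, by reference), the value of `W`, the INSTANTIATION of §12e's five frame hypotheses on print's spaces (2.34)–(2.39) for the boundary terms (p. 276:
*"To its terms we apply the formulas (3.6), (3.7) [I]"*; the modulus is no longer owed — `c₀ = 4` is kernel-derived in §12e —, a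
non-affine chart owing (3.7)'s outer real integral — v1.4: typed in §12f, `c₀ = 2`, a non-affine chart owing instead the path shape
(F-P) on print's `B(t)`: the path kept in the space, p. 273 *"We assume also that ε₁ is so small that 𝐇_j(B(t)) satisfies (3.14)
with 1/3α₂"*, and the velocity bound (3.9)), `ρ` (`= 2` for layer-constant coefficients, §12e(ii); the layer variation of
`α_{·,n}` unmodelled — v1.4: `ρ = 2` exactly for the printed radii read in each layer's own coefficient unit, §12g, the variation of
`α_{·,n}` being part of the NORMALIZED collar-decay binder, displacement over the layer's own coefficient, for which no law across
layers is displayed: (2.8)–(2.9) p. 256 display `ε_n`, `R_n` only), and EVERY two-run form (`TiltLip`, `OpDisc`, the admissibility of both runs' tables, `NE5B` itself):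
the manuscripts construct one run.

CITATION HEADER.  derivedFrom: [Balaban1985BackgroundPropagators, (3.89)–(3.94) pp.409–410 (Thm 3.7, Cor. 3.8), p.411,
(3.107)–(3.108) pp.415–416 (Thm 3.10), (3.109)–(3.110) p.417, (3.126) pp.420–421] (the series' ONE-run random walk expansion and
per-walk bound of the multi-scale propagators G′, G, the scale-free factor per separation, the representation of the linear
minimizer H = GQ*(QGQ*)^{−1} (its decay asserted p.421, not displayed) — = [13] of [I] cited on [III] p.276, CONTEXT only);
[Balaban1988Convergent, (2.8)–(2.9) p.256, p.256, (2.34)–(2.39) p.261,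
pp.276–277] (the slowly varying constants, the multi-scale domains and their collars, the layered printed spaces, the by-reference
sentences and the consistency sentence, CONTEXT only); [Balaban1987RG1, (3.14)–(3.17) p.273] (the one-run Cauchy form of the
displacement-over-margin factor, CONTEXT only); v1.2: [Balaban1985Variational, p.307, (189)–(190) p.308, Prop. 9 p.309] (= [15] of
[I]: the per-point decay of the non-linear minimizer's field derivative, displayed, derived in print from the kernel bound (189) — the
formulated final result with the calculations not performed —, CONTEXT only) and [Balaban1987RG1, p.282] (its per-step use, CONTEXT
only); v1.3: [Balaban1988Convergent, (2.40)–(2.42) p.261, p.262, p.277] (the analytic extension of the boundary terms to the complex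
spaces and the margin sentences of p. 277 — typed as the frame hypotheses, CONTEXT only —; p. 262's larger spaces of the newly
created terms = the within-step enlargement after `T` consumed by 𝐑, CONTEXT only and NOT a support of (F-M), C-adv8-81 D1) and
[Balaban1987RG1, p.273: the affine extension of (3.7), (3.15)–(3.17)] (the one-variable Cauchy device, CONTEXT only); v1.4:
[Balaban1987RG1, (3.4) p.270, (3.7)–(3.9) p.271, (3.14) p.272, (3.15)–(3.17) p.273] (the real interpolation path `B(t)`, the velocity
`δ𝐇_j` and its bound, the space condition kept along the path, the Cauchy integral for the `t_□`-derivative at `t_□ = 0` — typed as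
(F-P) and the path step, CONTEXT only) and [Balaban1988Convergent, (2.28) p.259] (the layer-dependent coefficients `α_{0,j}`,
`α_{1,j}`, CONTEXT only); tree `B14Radii`
(`shrink`; the v1.3 import, Mathlib-only), `Dimock2015.AnalyticLipschitz` (`norm_sub_le_div_of_bound_sphere`; in the import chain of
`T4BoundaryCarrier`), `T4BoundaryRate` (§8 `cauchyCarriers`, `cplx`, `cpart`, `cpart_sub`, `abs_cpart_le`, `cpart_cplx`; §10 `FluctChart`, `fluct`,
`FluctDampedOne`, `FluctDamped`, `fluctDamped_of_one`, `shiftChart`, `CauchyAdmT`, `cauchyGeneration`; §11 `LayeredDamped`,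
`ne5B_of_layered`, `displacement_le_domainDifference`), `T4BoundaryCarrier` (carriers, `NE5B`), `T4OutputRate` (`NE5`).  All
theorems [folklore] (finite sums, `Real.exp_nat_mul`, geometric bookkeeping of powers, Cauchy's estimate and the mean value
inequality from Mathlib; §12d also `hasSum_geometric_of_lt_one`, `hasSum_nat_add_iff`, `sum_geometric_two_le`,
`add_one_pow_unbounded_of_pos`, `Finset.sum_range_sub`/`sum_range_reflect`; §12e also Liouville's theorem
`Differentiable.apply_eq_apply_of_bounded`, `Complex.norm_le_abs_re_add_abs_im`, `normSeminorm`, `pow_le_pow_of_le_one`; §12f also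
`Complex.norm_deriv_le_of_forall_mem_sphere_norm_le`, `DifferentiableOn.diffContOnCl_ball`, `HasFDerivWithinAt.comp_hasDerivWithinAt`,
`norm_image_sub_le_of_norm_deriv_le_segment_01'`, `HasDerivAt.ofReal_comp`).
-/

namespace Literature.MathematicalPhysics.QuantumFieldTheory.Balaban1983to89.T4BoundaryRateCollar

open Finset T4OutputRate T4BoundaryCarrier T4BoundaryRate
open scoped BigOperators
open Metric

variable {C : T4BoundaryCarrier.Carriers}

/-! ## §12 (= `T4BoundaryRate` §12, housed here) `FluctDampedOne` with the layered profile ONE LEVEL DOWN: the layer gauge, the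
margin-Cauchy shape on the layered printed spaces, the displayed gap shape, the collar-decay shape of the displacement, and the
walk arithmetic of [13] = CMP 99 turning the displayed per-walk bound into the per-collar ratio.  Section numbers §7–§11 below refer
to the parent module `T4BoundaryRate`. -/

/-- **POSITED INTERFACE `LayerGauge`** (bookkeeping, NOT a printed object; no existence is smuggled — an instance is a datum of every
theorem below, and §12c builds one): `dist n U′ U` = the size, IN THE UNIT OF THE LAYER OF SCALE `n`, of the difference of two
run-B backgrounds on that layer — the typed reading of the layer-wise radii of the printed spaces of [III] p. 261, whose conditions
(2.34)–(2.39) are imposed *"on X∩(Ω_n∖Ω_{n+1}) for n = 1,.... j−1, or on X∩Ω_j for n = j"*, each in the layer's own unit `Lⁿξ`: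
(2.34) *"|∂U − 1|, |∂𝐔 − 1| < (1 − β(1 − 2^{−(j−n)}))α_{0,n}ξ²(Lⁿξ)^{−2}"*, (2.39) *"Lⁿξ|A′|, (Lⁿξ)²|∇^ξ_U A′| < (1 − β(1 − 2^{−(j−n)}))α_{1,n}"*.
Nothing of the spaces themselves is modelled. [cite: Balaban1988Convergent, (2.34)–(2.39) p.261] -/
structure LayerGauge (C : T4BoundaryCarrier.Carriers) where
  /-- size of the difference of two backgrounds on the layer of scale `n`, in that layer's unit -/
  dist : ℕ → C.BgB → C.BgB → ℝ
  /-- sizes are nonnegative -/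
  dist_nonneg : ∀ n U' U, 0 ≤ dist n U' U
  /-- no displacement has size zero -/
  dist_self : ∀ n U, dist n U U = 0

/-- **PRINTED-MECHANISM SHAPE `MarginCauchy`** (ONE run, ONE table; typed ABSTRACTLY — nothing of it is asserted for Bałaban's terms):
the Cauchy step of [Balaban1987RG1] p. 273 — (3.15) *"the Cauchy integral (1/2πi)∫_{|t_□|=r} dt_□ (1/t_□²)𝐄^{(j)}(X,…,…)"* with
*"the radius r given by the equality r max{|δ𝐇_j|_X, |P₁δ𝐇_j|_X, |∇^ξ_𝐔δ𝐇_j|_X, |Δ^ξ_𝐔δ𝐇_j|_X} = ⅓α₂"*, whence (3.17) *"|(3.15)| ≤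
(1/r)E₀exp(−κd_j(X))"* — READ ON THE LAYERED SPACES of [III] p. 261 (binder `LayerGauge`): print's `1/r` is
(displacement)/(margin) maximised over the finitely many constrained seminorms, here over the layers `n = scale Y − i`,
`i = 0, …, scale Y`, on which the parent's printed space constrains the background, and a maximum of nonnegative terms is at most
their SUM.  Typed: a sup bound `D·e^{−κd(Y)}` of one admissible table at ALL backgrounds of run B's carrier controls its inserted
fluctuation difference at a core background `U` displaced to `chart X U 𝒜` by `c₀ · Σ_i dist_{scale Y − i}(chart X U 𝒜, U)/gap X Y i`,
PROVIDED the displacement is at most HALF THE GAP on every constrained layer ([III] p. 277: *"The localization of the fluctuation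
field, and the exponential decay of the minimizing function 𝐇_k imply that this difference is still much greater than bounds on
this function."*; §11's `displacement_le_domainDifference`).  `gap X Y i` = the margin, on the layer `scale Y − i`, between the
parent's printed space and the space of the step creating `X` (binder; its displayed profile is `GapShape`).  HYPOTHESIS SHAPE for
the boundary terms ([III] p. 276 *"To its terms we apply the formulas (3.6), (3.7) [I]"*, no modulus printed) and for two runs.
[cite: Balaban1987RG1, (3.15)–(3.17) p.273; Balaban1988Convergent, (2.34)–(2.39) p.261, p.277] -/
def MarginCauchy {A : Type} (G : Generation C) (ch : FluctChart C A) (W : Set (ℕ → ℝ)) (κ : ℝ)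
    (AdmT : (ℕ → ℝ) → BTable C C.BgB → Prop) (lg : LayerGauge C) (gap : C.Dom → C.Dom → ℕ → ℝ) (c₀ : ℝ) : Prop :=
  ∀ g ∈ W, ∀ (h : BTable C C.BgB), AdmT g h →
    ∀ (X : C.Dom), ∀ Y ∈ G.parents X, ∀ (D : ℝ), 0 ≤ D →
      (∀ (U : C.BgB), ∀ a ∈ C.admFl, |h Y U a| ≤ D * Real.exp (-(κ * C.d Y))) →
      ∀ U ∈ ch.core X, ∀ 𝒜 ∈ ch.supp X,
        (∀ i ∈ range (C.scale Y + 1), lg.dist (C.scale Y - i) (ch.chart X U 𝒜) U ≤ gap X Y i / 2) →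
        ∀ a ∈ C.admFl,
          |fluct ch h X Y U 𝒜 a| ≤
            c₀ * (∑ i ∈ range (C.scale Y + 1), lg.dist (C.scale Y - i) (ch.chart X U 𝒜) U / gap X Y i) *
              (D * Real.exp (-(κ * C.d Y)))

/-- **DISPLAYED SHAPE `GapShape`** (ONE run; the profile is DISPLAYED, the constant `g₀` and the ratio `ρ` are this cell's reading):
by (2.34)–(2.39) p. 261 the radius factor of the index-`j` space on the layer `n ≤ j` is `1 − β(1 − 2^{−(j−n)})` (*"we can take
β = 1/4"*), so on the layer `n = j − i` the index-(k+1) space of the step creating `X` (`k + 1 = scale X > j = scale Y`) sits inside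
the scale-`j` parent's space with the gap `β(2^{−i} − 2^{−(k+1−j)−i})α_{·,j−i} ≥ ½β·2^{−i}·α_{·,j−i}` in the layer's unit: UNIFORM IN
`k`, HALVING per older layer of the parent.  Typed: `gap X Y i > 0` and `g₀ ≤ gap X Y i · ρ^i` for `i ≤ scale Y` — `ρ` absorbs the
halving AND the slow variation of the constants `α_{·,n}` between layers ([III] (2.8)–(2.9) p. 256, *"Similar inequalities hold for
other constants, which will be introduced later."*); no value of `ρ` is printed.  NOT PRINTED for two runs. [cite: Balaban1988Convergent, (2.34)–(2.39) p.261; (2.8)–(2.9) p.256] -/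
def GapShape (G : Generation C) (gap : C.Dom → C.Dom → ℕ → ℝ) (g₀ ρ : ℝ) : Prop :=
  ∀ X : C.Dom, ∀ Y ∈ G.parents X, ∀ i ∈ range (C.scale Y + 1), 0 < gap X Y i ∧ g₀ ≤ gap X Y i * ρ ^ i

/-- **HYPOTHESIS SHAPE `CollarDecay`** (ONE run; NOT PRINTED as a display for the objects it is used for here): the displacement of
the background seen ON THE LAYER OF SCALE `n < scale X` under an admissible fluctuation configuration of the step creating `X`
(fluctuation field localized in `Ω_{scale X}`) is at most `ε·δ^{scale X − n}` in the layer's unit — one factor `δ` per COLLAR between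
the fluctuation region and the layer ([III] p. 256: the domains Ω_j *"are unions of MR_j-cubes in the lattice T_{L^{−j}}. They satisfy
also other conditions, e.g., the distance between their boundaries is at least equal to 2MR_j"*).  What print DISPLAYS, one run:
the per-walk bounds of [13] = [Balaban1985BackgroundPropagators] for the PROPAGATORS `G′` ((3.94) p. 410) and `G` ((3.108) p. 416)
of the sequence {Ω_j}; the scale-free factor per separation, p. 411: kernels restricted *"to points separated at least by a
distance ML^jη (if □∈𝒟_j). Hence the part of the exponential factor can be estimated by e^{−(1/4)δ₀M}"*.  What print ASSERTS
(composed, NO per-walk formula displayed), one run: the same for the LINEAR minimizer `H` of (3.109)–(3.110) p. 417 (*"this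
variational problem is a linear approximation to a general non-linear variational problem for group-valued configurations we will
consider in forthcoming papers"*), via the displayed representation (3.126) p. 420 *"HB = GQ*(QGQ*)^{−1}B"*, p. 421 *"Now we will
prove that Theorems 3.3, 3.10, 3.11 hold for the propagators G, G₁"* and p. 421 *"3.11. We have to investigate also the operator
(QGQ*)^{−1}, but the analysis is very similar to this for the operator (Q′G′²Q′*)^{−1}."*  What print DISPLAYS, one run, PER POINT
(not per collar), for the NON-LINEAR minimizing function 𝐇_k = the `ℋ(B)` of [15] = [Balaban1985Variational] Sect. G: (190) p. 308,
the field derivative `(δ/δB_ν(y′))ℋ_μ(B, x)` bounded by `O(1)(Lʲη)^{−1}(L^{j′}η)^{−d}exp(−⅛δ₀d(y, y′))`, *"for x∈Δ(y), […] y∈Λ_j,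
y′∈Λ_{j′}"* — derived in print (p. 308) from the kernel bound (189), the formulated final result whose calculations print does not
perform (p. 308: *"We do not perform these calculations
here, we have obtained all necessary results to do the calculations and estimates, let us formulate a final result only."*; tree
`B11.Prop9Printed`, GAPS G-B11-G2); asserted per step in [I] p. 282; invoked BY REFERENCE in [III] p. 276 (*"the exponential decay
of propagators and minimizing functions yields additional small factors"*, *"we apply Theorems 3.7–3.10 [13] in their full
generality"*).  The PER-COLLAR ratio `δ` below is displayed nowhere: for 𝐇_k it is (190) summed over the source points ([15] Lemma
2.1) GIVEN the collar geometry — this cell's reading (`collarDecay_of_walks` with `ι` := source points); for the arguments of the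
boundary terms print has the by-reference sentence only.  `walkSum_le`/`collarDecay_of_walks` below derive THIS shape, with `δ = e^{−cW}` explicit, from the displayed
per-walk shape once the displacement is given by such a walk expansion (`WalkBound`, the by-reference step).  NOT PRINTED for two
runs. [cite: Balaban1985BackgroundPropagators, (3.94) p.410, (3.108) p.416, (3.126) p.420; Balaban1985Variational, (190) p.308, Prop. 9 p.309; Balaban1988Convergent, p.256, pp.276–277] -/
def CollarDecay {A : Type} (ch : FluctChart C A) (lg : LayerGauge C) (ε δ : ℝ) : Prop :=
  ∀ (X : C.Dom), ∀ U ∈ ch.core X, ∀ 𝒜 ∈ ch.supp X, ∀ n < C.scale X,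
    lg.dist n (ch.chart X U 𝒜) U ≤ ε * δ ^ (C.scale X - n)

/-- THE LAYERED DISPLACEMENT-OVER-MARGIN FACTOR [folklore]: `layeredSigma s₀ δ ρ X Y = s₀ · Σ_{i ≤ scale Y} δ^{(scale X − scale Y) + i}·ρ^i`
— the right-hand side of §11's `LayeredDamped` with unit weights. -/
def layeredSigma (C : T4BoundaryCarrier.Carriers) (s₀ δ ρ : ℝ) : C.Dom → C.Dom → ℝ := fun X Y =>
  s₀ * ∑ i ∈ range (C.scale Y + 1), δ ^ (C.scale X - C.scale Y + i) * ρ ^ i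

/-- The layered factor is nonnegative for nonnegative parameters. [folklore] -/
theorem layeredSigma_nonneg {s₀ δ ρ : ℝ} (hs₀ : 0 ≤ s₀) (hδ : 0 ≤ δ) (hρ : 0 ≤ ρ) (X Y : C.Dom) :
    0 ≤ layeredSigma C s₀ δ ρ X Y :=
  mul_nonneg hs₀ (sum_nonneg fun _ _ => mul_nonneg (pow_nonneg hδ _) (pow_nonneg hρ _))

/-- The layered factor IS `LayeredDamped` (§11) with unit weights — by definition. [folklore] -/
theorem layeredDamped_layeredSigma (G : Generation C) (s₀ δ ρ : ℝ) :
    LayeredDamped G (layeredSigma C s₀ δ ρ) s₀ δ ρ (fun _ _ => 1) := by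
  intro X Y _
  simp only [layeredSigma, mul_one, le_refl]

/-- **`FluctDampedOne` WITH THE LAYERED PROFILE FROM THE THREE SHAPES** [folklore]: the margin-Cauchy shape (constant `c₀`), the
displayed gap shape (`g₀`, ratio `ρ ≥ 0`) and the collar-decay shape of the displacement (`ε`, per-collar ratio `0 ≤ δ ≤ 1` with
`δρ ≤ 1`), under the smallness `2ε ≤ g₀` that puts every displacement below half the gap (print's consistency sentence, p. 277),
give the printed-mechanism shape `FluctDampedOne` of §10 with the factor `σ = layeredSigma (c₀ε/g₀) δ ρ`: on the parent's layer
`scale Y − i` the displacement is `≤ ε·δ^{(scale X − scale Y) + i}` (that many collars away from the fluctuation region) and the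
reciprocal gap is `≤ ρ^i/g₀`.  This is §11's `LayeredDamped` profile DERIVED, with `s₀ = c₀ε/g₀` — so after this module the undisplayed
inputs of the boundary-parent profile are exactly: the per-collar ratio `δ` of `CollarDecay` for the non-linear 𝐇_k (per POINT
displayed — [15] (190) p. 308, calculations not performed in print — per COLLAR this cell's summation reading) / the boundary terms'
arguments (by reference in print), the ratio `ρ` of `GapShape` (conversion of the slowly varying constants), the modulus
`c₀` of `MarginCauchy` for the boundary terms, and everything two-run. -/
theorem fluctDampedOne_of_collar {A : Type} {G : Generation C} {ch : FluctChart C A} {W : Set (ℕ → ℝ)} {κ : ℝ}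
    {AdmT : (ℕ → ℝ) → BTable C C.BgB → Prop} {lg : LayerGauge C} {gap : C.Dom → C.Dom → ℕ → ℝ}
    {c₀ g₀ ρ ε δ : ℝ}
    (hMC : MarginCauchy G ch W κ AdmT lg gap c₀) (hGap : GapShape G gap g₀ ρ) (hCD : CollarDecay ch lg ε δ)
    (hc₀ : 0 ≤ c₀) (hg₀ : 0 < g₀) (hρ : 0 ≤ ρ) (hε : 0 ≤ ε) (hδ : 0 ≤ δ) (hδ1 : δ ≤ 1) (hδρ : δ * ρ ≤ 1)
    (h2ε : 2 * ε ≤ g₀) :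
    FluctDampedOne G ch W κ AdmT (layeredSigma C (c₀ * ε / g₀) δ ρ) := by
  intro g hg h hh X Y hY D hD hsup U hU 𝒜 h𝒜 a ha
  have hYX : C.scale Y < C.scale X := G.parents_lt X Y hY
  -- powers: `δ^{m+i}·ρ^i = δ^m·(δρ)^i ≤ 1`
  have hpow1 : ∀ i : ℕ, δ ^ (C.scale X - C.scale Y + i) * ρ ^ i ≤ 1 := by
    intro i
    rw [pow_add, mul_assoc, ← mul_pow]
    calc δ ^ (C.scale X - C.scale Y) * (δ * ρ) ^ i ≤ 1 * 1 :=
          mul_le_mul (pow_le_one₀ hδ hδ1) (pow_le_one₀ (mul_nonneg hδ hρ) hδρ) (pow_nonneg (mul_nonneg hδ hρ) _)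
            zero_le_one
      _ = 1 := one_mul 1
  -- per constrained layer `n = scale Y − i`: displacement (collar decay) and gap (displayed shape)
  have hlayer : ∀ i ∈ range (C.scale Y + 1),
      lg.dist (C.scale Y - i) (ch.chart X U 𝒜) U ≤ ε * (δ ^ (C.scale X - C.scale Y + i)) ∧
        0 < gap X Y i ∧ g₀ ≤ gap X Y i * ρ ^ i := by
    intro i hi
    have hn : C.scale Y - i < C.scale X := lt_of_le_of_lt (Nat.sub_le _ _) hYX
    have hd := hCD X U hU 𝒜 h𝒜 (C.scale Y - i) hn
    have hi' : i ≤ C.scale Y := Nat.lt_succ_iff.mp (mem_range.mp hi)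
    have hexp : C.scale X - (C.scale Y - i) = C.scale X - C.scale Y + i := by omega
    rw [hexp] at hd
    exact ⟨hd, hGap X Y hY i hi⟩
  -- the half-gap precondition holds: `ε·δ^{m+i} ≤ ε ≤ g₀/2 ≤ gap·ρ^i/2`, and `gap ≥ g₀/ρ^i ≥ …`; done through `g₀ ≤ gap·ρ^i`
  have hhalf : ∀ i ∈ range (C.scale Y + 1), lg.dist (C.scale Y - i) (ch.chart X U 𝒜) U ≤ gap X Y i / 2 := by
    intro i hi
    obtain ⟨hd, hgpos, hg⟩ := hlayer i hi
    -- `ρ^i ≥ 1` is not available; argue with `δ^{m+i}ρ^i ≤ 1` : ε δ^{m+i} · (gap ρ^i) ≥ ε δ^{m+i} g₀ ≥ 2 ε δ^{m+i} · ε` — no; directly: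
    -- 2·(ε δ^{m+i}) = (2ε)·δ^{m+i} ≤ g₀·δ^{m+i} ≤ (gap·ρ^i)·δ^{m+i} = gap·(δ^{m+i}ρ^i) ≤ gap·1
    have hδmi : 0 ≤ δ ^ (C.scale X - C.scale Y + i) := pow_nonneg hδ _
    have h1 : 2 * (ε * δ ^ (C.scale X - C.scale Y + i)) ≤ gap X Y i * (δ ^ (C.scale X - C.scale Y + i) * ρ ^ i) := by
      calc 2 * (ε * δ ^ (C.scale X - C.scale Y + i)) = (2 * ε) * δ ^ (C.scale X - C.scale Y + i) := by ring
        _ ≤ (gap X Y i * ρ ^ i) * δ ^ (C.scale X - C.scale Y + i) :=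
            mul_le_mul_of_nonneg_right (h2ε.trans hg) hδmi
        _ = gap X Y i * (δ ^ (C.scale X - C.scale Y + i) * ρ ^ i) := by ring
    have h2 : gap X Y i * (δ ^ (C.scale X - C.scale Y + i) * ρ ^ i) ≤ gap X Y i * 1 :=
      mul_le_mul_of_nonneg_left (hpow1 i) hgpos.le
    linarith
  -- the margin-Cauchy shape at this (U, 𝒜)
  have hmc := hMC g hg h hh X Y hY D hD hsup U hU 𝒜 h𝒜 hhalf a ha
  -- bound the layer sum: `dist/gap ≤ ε·δ^{m+i}·ρ^i/g₀`
  have hsum : ∑ i ∈ range (C.scale Y + 1), lg.dist (C.scale Y - i) (ch.chart X U 𝒜) U / gap X Y i ≤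
      ∑ i ∈ range (C.scale Y + 1), ε / g₀ * (δ ^ (C.scale X - C.scale Y + i) * ρ ^ i) := by
    refine sum_le_sum fun i hi => ?_
    obtain ⟨hd, hgpos, hg⟩ := hlayer i hi
    rw [div_le_iff₀ hgpos]
    calc lg.dist (C.scale Y - i) (ch.chart X U 𝒜) U ≤ ε * δ ^ (C.scale X - C.scale Y + i) := hd
      _ = ε * δ ^ (C.scale X - C.scale Y + i) * g₀ / g₀ := by field_simp
      _ ≤ ε * δ ^ (C.scale X - C.scale Y + i) * (gap X Y i * ρ ^ i) / g₀ :=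
          div_le_div_of_nonneg_right (mul_le_mul_of_nonneg_left hg (mul_nonneg hε (pow_nonneg hδ _))) hg₀.le
      _ = ε / g₀ * (δ ^ (C.scale X - C.scale Y + i) * ρ ^ i) * gap X Y i := by ring
  have hDexp : 0 ≤ D * Real.exp (-(κ * C.d Y)) := mul_nonneg hD (Real.exp_pos _).le
  calc |fluct ch h X Y U 𝒜 a|
      ≤ c₀ * (∑ i ∈ range (C.scale Y + 1), lg.dist (C.scale Y - i) (ch.chart X U 𝒜) U / gap X Y i) *
          (D * Real.exp (-(κ * C.d Y))) := hmc
    _ ≤ c₀ * (∑ i ∈ range (C.scale Y + 1), ε / g₀ * (δ ^ (C.scale X - C.scale Y + i) * ρ ^ i)) *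
          (D * Real.exp (-(κ * C.d Y))) :=
        mul_le_mul_of_nonneg_right (mul_le_mul_of_nonneg_left hsum hc₀) hDexp
    _ = layeredSigma C (c₀ * ε / g₀) δ ρ X Y * (D * Real.exp (-(κ * C.d Y))) := by
        rw [layeredSigma, ← mul_sum]
        ring

/-- The two-table form with the layered factor, by linearity (`fluctDamped_of_one`, §10). [folklore] -/
theorem fluctDamped_of_collar {A : Type} {G : Generation C} {ch : FluctChart C A} {W : Set (ℕ → ℝ)} {κ : ℝ}
    {Adm : (ℕ → ℝ) → BTable C C.BgB → ETable C C.BgB → Prop} {AdmT : (ℕ → ℝ) → BTable C C.BgB → Prop}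
    {lg : LayerGauge C} {gap : C.Dom → C.Dom → ℕ → ℝ} {c₀ g₀ ρ ε δ : ℝ}
    (hcl : ∀ g ∈ W, ∀ (f f' : BTable C C.BgB) (e e' : ETable C C.BgB), Adm g f e → Adm g f' e' → AdmT g (f - f'))
    (hMC : MarginCauchy G ch W κ AdmT lg gap c₀) (hGap : GapShape G gap g₀ ρ) (hCD : CollarDecay ch lg ε δ)
    (hc₀ : 0 ≤ c₀) (hg₀ : 0 < g₀) (hρ : 0 ≤ ρ) (hε : 0 ≤ ε) (hδ : 0 ≤ δ) (hδ1 : δ ≤ 1) (hδρ : δ * ρ ≤ 1)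
    (h2ε : 2 * ε ≤ g₀) :
    FluctDamped G ch W κ Adm (layeredSigma C (c₀ * ε / g₀) δ ρ) :=
  fluctDamped_of_one hcl (fluctDampedOne_of_collar hMC hGap hCD hc₀ hg₀ hρ hε hδ hδ1 hδρ h2ε)

/-- **END-TO-END FROM THE THREE SHAPES** [folklore]: `RepresentsA/B` + `TiltLip KT` + the closure of the admissible class under
differences + `MarginCauchy c₀` + `GapShape g₀ ρ` + `CollarDecay ε δ` + `OpDisc` + admissibility of both runs' tables +
`SliceCountGrowing` (unit weights) + `EKernelContracts` + the regular inputs' rate give `NE5B` through `ne5B_of_layered` BY NAME (§11;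
`σ = layeredSigma (c₀ε/g₀) δ ρ`, `s₀ = c₀ε/g₀`), under `δρ < 1` and the effective-damping condition `δ·V < θ` — the per-collar ratio must
beat the rate times the volume entropy — with the constant `(Cop + lamE·CE)/(1 − kT·((c₀ε/g₀)/(1 − δρ))·Mc·(δV/θ)/(1 − δV/θ))`. -/
theorem ne5B_of_collar {A : Type} {G : Generation C} {ch : FluctChart C A} {ΦA : GenMap C C.BgA} {Φ : GenMap C C.BgB}
    {BA : BFunctional C C.BgA} {BB : BFunctional C C.BgB}
    {EA : Functional C.toCarriers C.BgA} {EB : Functional C.toCarriers C.BgB} {W : Set (ℕ → ℝ)}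
    {Adm : (ℕ → ℝ) → BTable C C.BgB → ETable C C.BgB → Prop} {AdmT : (ℕ → ℝ) → BTable C C.BgB → Prop}
    {lg : LayerGauge C} {gap : C.Dom → C.Dom → ℕ → ℝ}
    {κ θ δ ρ kT c₀ g₀ ε Mc V Cop CE lamE : ℝ} {KT : C.Dom → C.Dom → ℝ}
    (hRA : RepresentsA ΦA BA EA W) (hRB : RepresentsB Φ BB EB W)
    (hT : TiltLip G ch Φ W κ Adm KT)
    (hcl : ∀ g ∈ W, ∀ (f f' : BTable C C.BgB) (e e' : ETable C C.BgB), Adm g f e → Adm g f' e' → AdmT g (f - f'))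
    (hMC : MarginCauchy G ch W κ AdmT lg gap c₀) (hGap : GapShape G gap g₀ ρ) (hCD : CollarDecay ch lg ε δ)
    (hKT0 : ∀ X Y, 0 ≤ KT X Y) (hKT : ∀ X : C.Dom, ∀ Y ∈ G.parents X, KT X Y ≤ kT)
    (hOD : OpDisc ΦA Φ BA EA W κ θ Cop)
    (hadmA : ∀ g ∈ W, Adm g (pullB BA g) (epullB EA g)) (hadmB : ∀ g ∈ W, Adm g (tabB BB g) (etabB EB g))
    (hS : SliceCountGrowing G κ (fun _ _ => 1) Mc V)
    (hKE : EKernelContracts G κ θ lamE) (hE : NE5 EA EB W κ θ CE)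
    (hθ : 0 < θ) (hc₀ : 0 ≤ c₀) (hg₀ : 0 < g₀) (hρ : 0 ≤ ρ) (hε : 0 ≤ ε) (hδ : 0 ≤ δ) (hδ1 : δ ≤ 1) (hδρ : δ * ρ < 1)
    (h2ε : 2 * ε ≤ g₀) (hV : 0 ≤ V) (hδθ : δ * V < θ) (hkT : 0 ≤ kT) (hMc : 0 ≤ Mc)
    (hsmall : kT * ((c₀ * ε / g₀) / (1 - δ * ρ)) * Mc * (δ * V / θ) / (1 - δ * V / θ) < 1)
    (hCop : 0 ≤ Cop) (hCE : 0 ≤ CE) (hlamE : 0 ≤ lamE) :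
    NE5B BA BB W κ θ
      ((Cop + lamE * CE) / (1 - kT * ((c₀ * ε / g₀) / (1 - δ * ρ)) * Mc * (δ * V / θ) / (1 - δ * V / θ))) :=
  have hs₀ : 0 ≤ c₀ * ε / g₀ := div_nonneg (mul_nonneg hc₀ hε) hg₀.le
  ne5B_of_layered hRA hRB hT (fluctDamped_of_collar hcl hMC hGap hCD hc₀ hg₀ hρ hε hδ hδ1 hδρ.le h2ε) hKT0
    (layeredSigma_nonneg hs₀ hδ hρ) hKT (layeredDamped_layeredSigma G (c₀ * ε / g₀) δ ρ) hOD hadmA hadmB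
    (fun _ _ _ => zero_le_one) hS hKE hE hθ hδ hρ hδρ hV hδθ hkT hs₀ hMc hsmall hCop hCE hlamE

/-! ### §12b The walk arithmetic of [13]: the displayed per-walk shape and the collar width give the per-collar ratio -/

/-- **THE WALK-SUM LEMMA** [folklore] (the arithmetic of [Balaban1985BackgroundPropagators] p. 410 — *"We will use the factor
O(M^{−1/2}) to control the sum over random walks ω, and the last two factors in (3.94) will be important for other purposes."*):
if every term of a family indexed by walks `ω` is bounded by an entropy weight times a decay factor, `|term ω| ≤ a ω·e^{−c·dω ω}`
(`a ≥ 0`, `c ≥ 0`), the partial sums of the entropy weights are bounded by `A` (the displayed convergence, p. 416: *"From (3.108) it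
follows that the expansion (3.107) is convergent"*), and every CONTRIBUTING walk has scaled length at least `N·W` (it crosses `N`
collars, each of width `≥ W` in its own scale), then every partial sum of the family is at most `A·(e^{−cW})^N`: ONE FACTOR
`δ = e^{−cW}` PER COLLAR, explicitly. -/
theorem walkSum_le {ι : Type*} {term a dω : ι → ℝ} {c W A : ℝ} {N : ℕ}
    (hc : 0 ≤ c) (ha : ∀ ω, 0 ≤ a ω)
    (hterm : ∀ ω, |term ω| ≤ a ω * Real.exp (-(c * dω ω)))
    (hsep : ∀ ω, term ω ≠ 0 → (N : ℝ) * W ≤ dω ω)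
    (hA : ∀ s : Finset ι, ∑ ω ∈ s, a ω ≤ A) (s : Finset ι) :
    |∑ ω ∈ s, term ω| ≤ A * Real.exp (-(c * W)) ^ N := by
  have hpowexp : Real.exp (-(c * W)) ^ N = Real.exp (-(c * ((N : ℝ) * W))) := by
    rw [← Real.exp_nat_mul]
    congr 1
    ring
  have hA0 : 0 ≤ A := le_trans (by simp) (hA ∅)
  -- each term is at most `a ω · e^{−cNW}`
  have hω : ∀ ω, |term ω| ≤ a ω * Real.exp (-(c * ((N : ℝ) * W))) := by
    intro ω
    by_cases h0 : term ω = 0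
    · rw [h0, abs_zero]
      exact mul_nonneg (ha ω) (Real.exp_pos _).le
    · refine (hterm ω).trans (mul_le_mul_of_nonneg_left ?_ (ha ω))
      exact Real.exp_le_exp.mpr (by nlinarith [hsep ω h0])
  calc |∑ ω ∈ s, term ω| ≤ ∑ ω ∈ s, |term ω| := abs_sum_le_sum_abs _ _
    _ ≤ ∑ ω ∈ s, a ω * Real.exp (-(c * ((N : ℝ) * W))) := sum_le_sum fun ω _ => hω ω
    _ = (∑ ω ∈ s, a ω) * Real.exp (-(c * ((N : ℝ) * W))) := by rw [sum_mul]
    _ ≤ A * Real.exp (-(c * ((N : ℝ) * W))) := mul_le_mul_of_nonneg_right (hA s) (Real.exp_pos _).le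
    _ = A * Real.exp (-(c * W)) ^ N := by rw [hpowexp]

/-- **HYPOTHESIS SHAPE `WalkBound`** (the BY-REFERENCE step of [III] p. 276, typed; for 𝐇_k's response to the fluctuation field print
DISPLAYS instead the PER-POINT bound (190) of [15] p. 308 — derived in print from the kernel bound (189), the formulated final result
whose calculations it does not perform — which is
this shape with `ι` := the source points y′ and no walks (see `WalkShape`); NOT PRINTED for the boundary terms' arguments or for two
runs): the displacement seen on the layer of scale `n < scale X` is controlled,
up to the factor `ε₀`, by ANY bound, uniform in the base point `p : π`, of the partial sums of a walk expansion `term X U 𝒜 n p ω` over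
walks `ω : ι` — the typed form of "the displacement is given by a convergent random walk expansion", as print DISPLAYS it for `G′`
((3.90) p. 409) and `G` ((3.107) p. 416) and ASSERTS it for the linear minimizer `H` (representation (3.126) p. 420 + p. 421):
there the kernel is evaluated at a base point (`(3.94)`: *"for y∈□₀∩Λ_j, y′∈□ₙ"*) and expanded over the walks from its cube, and a
layer norm is a supremum over base points.
[cite: Balaban1985BackgroundPropagators, (3.90) p.409, (3.107) p.416, (3.126) p.420; Balaban1985Variational, (190) p.308; Balaban1988Convergent, p.276] -/
def WalkBound {A : Type} {π ι : Type*} (ch : FluctChart C A) (lg : LayerGauge C)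
    (term : C.Dom → C.BgB → A → ℕ → π → ι → ℝ) (ε₀ : ℝ) : Prop :=
  ∀ (X : C.Dom), ∀ U ∈ ch.core X, ∀ 𝒜 ∈ ch.supp X, ∀ n < C.scale X, ∀ t : ℝ,
    (∀ (p : π) (s : Finset ι), |∑ ω ∈ s, term X U 𝒜 n p ω| ≤ t) → lg.dist n (ch.chart X U 𝒜) U ≤ ε₀ * t

/-- **DISPLAYED SHAPE `WalkShape`** (ONE run; the per-walk bound DISPLAYED for the propagators, typed ABSTRACTLY over the carrier):
[Balaban1985BackgroundPropagators] Corollary 3.8 p. 410, (3.94) *"|Δ(y)h_{□₀}G′_{□₀}h_{□₀} Π_{i=1}^n K(h_{□ᵢ})G′_{□ᵢ}h_{□ᵢ}Δ(y′)λ| ≤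
O(1)(L^jη)²O(M^{−1/2})^{|ω|}M^{−1/2|ω|}e^{−(1/2)δ₀d(ω,y,y′)}|Δ(y′)λ|"* with (3.93) *"d(ω, y, y′) = inf_{(y₁,y₂,…,yₙ)} (d(y, y₁) + d(y₁, y₂) +
··· + d(y_{n−1}, yₙ) + d(yₙ, y′))"*, the distances in the cubes' OWN scales ((3.89) p. 409: *"O(M^{−1})e^{−δ₀(L^jη)^{−1}|y−y′|}"* for
*"y, y′∈□∈𝒟_j"*), and Theorem 3.10 p. 416, (3.108), the same for `G` (*"The constant O(1) depends on d and L only."*).  Typed: at every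
base point `p`, every term is bounded by an entropy weight `a p ω` (print's `O(M^{−1/2})^{|ω|}`: p. 410 *"We will use the factor O(M^{−1/2})
to control the sum over random walks ω"*) times `e^{−c·dω p ω}` (print's `c = ½δ₀`, `dω` = the scaled length (3.93)), and a walk
CONTRIBUTING to the layer-`n` displacement of the step creating `X` has scaled length at least `(scale X − n)·W` — THIS CELL'S READING of
the geometry, NOT displayed: such a walk joins the layer to the fluctuation region `Ω_{scale X}` across the `scale X − n` collars in
between, and consecutive boundaries are separated ([III] p. 256: *"the distance between their boundaries is at least equal to 2MR_j"*);
the conversion of that separation into the scaled length (3.93), i.e. the value of `W`, is not displayed (p. 411 displays the factor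
`e^{−(1/4)δ₀M}` for points *"separated at least by a distance ML^jη (if □∈𝒟_j)"*).  The sup-norm factor `(L^jη)²` is absorbed in the
layer unit (p. 410: *"The first factor O(1)(L^jη)² is unessential and is connected with the supremum norm"*).  DISPLAYED for `G′`, `G`
(and asserted for `H`, p. 421); HYPOTHESIS SHAPE for the objects of `WalkBound`.  For the NON-LINEAR 𝐇_k the displayed PER-POINT
bound (190) of [15] p. 308 (*"·(L^{j′}η)^{−d}exp(−⅛δ₀d(y, y′)) […] y∈Λ_j, y′∈Λ_{j′}"*; derived in print from the kernel bound (189) — the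
formulated final result whose calculations are not performed in print, GAPS G-B11-G2) is of this shape WITHOUT WALKS — `ι` := the source points y′, `dω p y′` := d(y, y′), `c` := δ₀/16
(half of the printed rate; the other half stays inside `a p y′ = O(1)(L^{j′}η)^{−d}e^{−(δ₀/16)d(y,y′)}·(size of 𝒜)` so that the source
sum `Σ a` converges by [15]'s Lemma 2.1, p. 308) — the separation clause being again this cell's reading of the collar geometry.
[cite: Balaban1985BackgroundPropagators, (3.89)–(3.90) p.409, (3.93)–(3.94) p.410, p.411, (3.108) p.416; Balaban1985Variational, (190) p.308; Balaban1988Convergent, p.256] -/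
def WalkShape {A : Type} {π ι : Type*} (ch : FluctChart C A) (term : C.Dom → C.BgB → A → ℕ → π → ι → ℝ)
    (a dω : π → ι → ℝ) (c W : ℝ) : Prop :=
  ∀ (X : C.Dom), ∀ U ∈ ch.core X, ∀ 𝒜 ∈ ch.supp X, ∀ n < C.scale X, ∀ (p : π) (ω : ι),
    |term X U 𝒜 n p ω| ≤ a p ω * Real.exp (-(c * dω p ω)) ∧
      (term X U 𝒜 n p ω ≠ 0 → ((C.scale X - n : ℕ) : ℝ) * W ≤ dω p ω)

/-- **`CollarDecay` FROM THE DISPLAYED WALK SHAPE** [folklore]: `WalkBound ε₀` + `WalkShape a dω c W` + walk entropy bounded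
uniformly in the base point (`Σ_{ω∈s} a p ω ≤ A` for every finite set of walks — the displayed convergence, p. 416: *"From (3.108) it
follows that the expansion (3.107) is convergent"*) give `CollarDecay` with `ε = ε₀·A` and the EXPLICIT per-collar ratio `δ = e^{−cW}`
(`walkSum_le` at every base point).  So the per-collar ratio of §11/§12 is an explicit function of the displayed decay rate `c = ½δ₀` and
the collar width `W` in scaled length as soon as the displacement has a walk expansion of the displayed shape — which print DISPLAYS per
point for 𝐇_k ([15] (190) p. 308: `ι` := source points, no walks; derived in print from (189), the formulated final result whose
calculations print does not perform), asserts for the boundary terms' arguments by reference only ([III] p. 276), and whose `W` is this cell's reading. -/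
theorem collarDecay_of_walks {A : Type} {π ι : Type*} {ch : FluctChart C A} {lg : LayerGauge C}
    {term : C.Dom → C.BgB → A → ℕ → π → ι → ℝ} {a dω : π → ι → ℝ} {c W Aw ε₀ : ℝ}
    (hWB : WalkBound ch lg term ε₀) (hWS : WalkShape ch term a dω c W)
    (hc : 0 ≤ c) (ha : ∀ p ω, 0 ≤ a p ω) (hA : ∀ (p : π) (s : Finset ι), ∑ ω ∈ s, a p ω ≤ Aw) :
    CollarDecay ch lg (ε₀ * Aw) (Real.exp (-(c * W))) := by
  intro X U hU 𝒜 h𝒜 n hn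
  have hbound : ∀ (p : π) (s : Finset ι), |∑ ω ∈ s, term X U 𝒜 n p ω| ≤ Aw * Real.exp (-(c * W)) ^ (C.scale X - n) :=
    fun p => walkSum_le hc (ha p) (fun ω => (hWS X U hU 𝒜 h𝒜 n hn p ω).1) (fun ω => (hWS X U hU 𝒜 h𝒜 n hn p ω).2) (hA p)
  calc lg.dist n (ch.chart X U 𝒜) U ≤ ε₀ * (Aw * Real.exp (-(c * W)) ^ (C.scale X - n)) := hWB X U hU 𝒜 h𝒜 n hn _ hbound
    _ = ε₀ * Aw * Real.exp (-(c * W)) ^ (C.scale X - n) := by ring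

/-- THE PER-COLLAR RATIO IS A GENUINE CONTRACTION [folklore]: `0 < e^{−cW} < 1` for `c, W > 0`. -/
theorem perCollar_ratio_lt_one {c W : ℝ} (hc : 0 < c) (hW : 0 < W) :
    0 < Real.exp (-(c * W)) ∧ Real.exp (-(c * W)) < 1 :=
  ⟨Real.exp_pos _, Real.exp_lt_one_iff.mpr (by nlinarith)⟩

/-- … AND AT LEAST A HALVING as soon as `cW ≥ log 2` [folklore] — the hypothesis `δ ≤ 1/2` under which §11's
`displacement_le_domainDifference` reads print's consistency sentence of p. 277 at every number of steps (there, together with the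
smallness `ε ≤ ½βα` of the first displacement against the first gap — both hypotheses of that lemma, cf. its statement). -/
theorem perCollar_ratio_le_half {c W : ℝ} (h : Real.log 2 ≤ c * W) : Real.exp (-(c * W)) ≤ 1 / 2 := by
  have h2 : Real.exp (-(c * W)) ≤ Real.exp (-Real.log 2) := Real.exp_le_exp.mpr (by linarith)
  have h3 : Real.exp (-Real.log 2) = 1 / 2 := by
    rw [Real.exp_neg, Real.exp_log (by norm_num : (0 : ℝ) < 2), inv_eq_one_div]
  exact h2.trans_eq h3

/-! ### §12c The toy: `MarginCauchy` realised by Cauchy's estimate on the displacement chart of §10b -/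

/-- The layer gauge of the toy: every layer reads the modulus of the complex displacement. [folklore] -/
noncomputable def shiftGauge : LayerGauge cauchyCarriers where
  dist := fun _ U' U => ‖U'.1 - U.1‖
  dist_nonneg := fun _ _ _ => norm_nonneg _
  dist_self := fun _ U => by simp

/-- **THE TOY REALISES `MarginCauchy`** with the constant `c₀ = 4` and the constant gap `r` [folklore] — the pointwise form of §10b's
`cauchy_fluctDampedOne`: a table whose complexification is differentiable on the disc of radius `ρ + r` and bounded by `D·e^{−κd}`
componentwise everywhere has, at a core point `‖z‖ < ρ` displaced by `𝒜` with `‖𝒜‖ ≤ r/2` (the half-gap precondition, layer `i = 0`),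
inserted fluctuation difference at most `(4‖𝒜‖/r)·D·e^{−κd}` (Cauchy on circles of radius `r/2` and the mean value inequality on the
disc of radius `ρ + r/2`), and `‖𝒜‖/r` is the `i = 0` term of the layer sum. -/
theorem cauchy_marginCauchy (ρ r s : ℝ) (hr : 0 < r) (W : Set (ℕ → ℝ)) (κ : ℝ) :
    MarginCauchy (cauchyGeneration r hr) (shiftChart ρ s) W κ (CauchyAdmT ρ r) shiftGauge (fun _ _ _ => r) 4 := by
  intro g _ h hh X Y _ D hD hsup U hU 𝒜 _ hhalf a ha
  obtain ⟨z, i⟩ := U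
  have hz : ‖z‖ < ρ := hU
  -- the half-gap precondition on the layer `i = 0` gives `‖𝒜‖ ≤ r/2`
  have h𝒜' : ‖𝒜‖ ≤ r / 2 := by
    have h0 := hhalf 0 (mem_range.mpr (Nat.succ_pos _))
    simpa [shiftGauge, shiftChart] using h0
  set δ : ℝ := D * Real.exp (-(κ * cauchyCarriers.d Y)) with hδ
  have hδ0 : 0 ≤ δ := mul_nonneg hD (Real.exp_pos _).le
  set F : ℂ → ℂ := cplx h Y a with hF
  have hFsup : ∀ w : ℂ, ‖F w‖ ≤ 2 * δ := by
    intro w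
    have h0 := hsup (w, 0) a ha
    have h1 := hsup (w, 1) a ha
    have hre : |(F w).re| ≤ δ := by simpa [hF, cplx] using h0
    have him : |(F w).im| ≤ δ := by simpa [hF, cplx] using h1
    calc ‖F w‖ ≤ |(F w).re| + |(F w).im| := Complex.norm_le_abs_re_add_abs_im _
      _ ≤ δ + δ := add_le_add hre him
      _ = 2 * δ := by ring
  have hderiv : ∀ y ∈ ball (0 : ℂ) (ρ + r / 2), ‖deriv F y‖ ≤ 4 * δ / r := by
    intro y hy
    rw [mem_ball, dist_zero_right] at hy
    have hsub : closedBall y (r / 2) ⊆ ball (0 : ℂ) (ρ + r) := by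
      intro u hu
      rw [mem_closedBall] at hu
      rw [mem_ball, dist_zero_right]
      calc ‖u‖ = ‖(u - y) + y‖ := by ring_nf
        _ ≤ ‖u - y‖ + ‖y‖ := norm_add_le _ _
        _ = dist u y + ‖y‖ := by rw [dist_eq_norm]
        _ < ρ + r := by linarith
    have hdc : DiffContOnCl ℂ F (ball y (r / 2)) := (hh Y a).diffContOnCl_ball hsub
    have hc := Complex.norm_deriv_le_of_forall_mem_sphere_norm_le (by positivity : 0 < r / 2) hdc
      (fun w _ => hFsup w)
    calc ‖deriv F y‖ ≤ 2 * δ / (r / 2) := hc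
      _ = 4 * δ / r := by field_simp; ring
  have hdiff : ∀ y ∈ ball (0 : ℂ) (ρ + r / 2), DifferentiableAt ℂ F y := by
    intro y hy
    rw [mem_ball, dist_zero_right] at hy
    exact (hh Y a).differentiableAt (isOpen_ball.mem_nhds (by rw [mem_ball, dist_zero_right]; linarith))
  have hzin : z ∈ ball (0 : ℂ) (ρ + r / 2) := by
    rw [mem_ball, dist_zero_right]; linarith
  have hz𝒜in : z + 𝒜 ∈ ball (0 : ℂ) (ρ + r / 2) := by
    rw [mem_ball, dist_zero_right]
    calc ‖z + 𝒜‖ ≤ ‖z‖ + ‖𝒜‖ := norm_add_le _ _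
      _ < ρ + r / 2 := by linarith
  have hmv := (convex_ball (0 : ℂ) (ρ + r / 2)).norm_image_sub_le_of_norm_deriv_le hdiff hderiv hzin hz𝒜in
  have hbound : ‖F (z + 𝒜) - F z‖ ≤ 4 * (‖𝒜‖ / r) * δ := by
    calc ‖F (z + 𝒜) - F z‖ ≤ 4 * δ / r * ‖z + 𝒜 - z‖ := hmv
      _ = 4 * δ / r * ‖𝒜‖ := by rw [add_sub_cancel_left]
      _ = 4 * (‖𝒜‖ / r) * δ := by field_simp
  -- the `i = 0` term of the layer sum dominates `‖𝒜‖/r`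
  have hsum : ‖𝒜‖ / r ≤ ∑ n ∈ range (cauchyCarriers.scale Y + 1),
      shiftGauge.dist (cauchyCarriers.scale Y - n) ((shiftChart ρ s).chart X (z, i) 𝒜) (z, i) / r := by
    have hterm : ∀ n ∈ range (cauchyCarriers.scale Y + 1),
        shiftGauge.dist (cauchyCarriers.scale Y - n) ((shiftChart ρ s).chart X (z, i) 𝒜) (z, i) / r = ‖𝒜‖ / r := by
      intro n _
      simp [shiftGauge, shiftChart]
    rw [sum_congr rfl hterm, sum_const, card_range, nsmul_eq_mul]
    have h1 : (1 : ℝ) ≤ ((cauchyCarriers.scale Y + 1 : ℕ) : ℝ) := by exact_mod_cast Nat.succ_pos _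
    have h𝒜r : 0 ≤ ‖𝒜‖ / r := div_nonneg (norm_nonneg _) hr.le
    nlinarith
  have hfin : ‖F (z + 𝒜) - F z‖ ≤ 4 * (∑ n ∈ range (cauchyCarriers.scale Y + 1),
      shiftGauge.dist (cauchyCarriers.scale Y - n) ((shiftChart ρ s).chart X (z, i) 𝒜) (z, i) / r) * δ :=
    hbound.trans (mul_le_mul_of_nonneg_right (mul_le_mul_of_nonneg_left hsum (by norm_num)) hδ0)
  show |h Y ((z, i).1 + 𝒜, (z, i).2) a - h Y (z, i) a| ≤ 4 * (∑ n ∈ range (cauchyCarriers.scale Y + 1),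
      shiftGauge.dist (cauchyCarriers.scale Y - n) ((shiftChart ρ s).chart X (z, i) 𝒜) (z, i) / r) *
        (D * Real.exp (-(κ * cauchyCarriers.d Y)))
  rw [← hδ]
  have hread : |h Y (z + 𝒜, i) a - h Y (z, i) a| ≤ ‖F (z + 𝒜) - F z‖ := by
    rw [← cpart_cplx h Y a (z + 𝒜) i, ← cpart_cplx h Y a z i, cpart_sub]
    exact abs_cpart_le i _
  exact hread.trans hfin

/-- The toy's constant gap `r` is `GapShape` with `g₀ = r`, `ρ = 1`. [folklore] -/
theorem cauchy_gapShape (r : ℝ) (hr : 0 < r) :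
    GapShape (cauchyGeneration r hr) (fun _ _ _ => r) r 1 := by
  intro X Y _ i _
  exact ⟨hr, by simp⟩

/-- The toy's shift chart is `CollarDecay` with `ε = s` and NO decay, `δ = 1` [folklore] — the toy has no geometry of collars; it
witnesses the margin-Cauchy mechanism only, the per-collar decay being the content of `WalkBound`/`WalkShape`. -/
theorem cauchy_collarDecay (ρ s : ℝ) : CollarDecay (shiftChart ρ s) shiftGauge s 1 := by
  intro X U _ 𝒜 h𝒜 n _
  have h𝒜' : ‖𝒜‖ ≤ s := by simpa [shiftChart] using h𝒜
  simpa [shiftGauge, shiftChart] using h𝒜'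

/-- CONSISTENCY [folklore]: on the toy the three shapes give back §10b's `FluctDampedOne` through `fluctDampedOne_of_collar` — with the
factor `layeredSigma (4s/r) 1 1`, i.e. `(4s/r)·(scale Y + 1)` (the layer sum over-counts the toy's single complex direction by the
number of layers; §10b's direct bound is `4s/r`) — for displacements `2s ≤ r`. -/
theorem cauchy_fluctDampedOne_of_collar (ρ r s : ℝ) (hr : 0 < r) (hs : 0 ≤ s) (hsr : 2 * s ≤ r) (W : Set (ℕ → ℝ)) (κ : ℝ) :
    FluctDampedOne (cauchyGeneration r hr) (shiftChart ρ s) W κ (CauchyAdmT ρ r) (layeredSigma cauchyCarriers (4 * s / r) 1 1) :=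
  fluctDampedOne_of_collar (cauchy_marginCauchy ρ r s hr W κ) (cauchy_gapShape r hr) (cauchy_collarDecay ρ s)
    (by norm_num) hr zero_le_one hs zero_le_one le_rfl (by norm_num) hsr

section PolydiscToy

open Filter Topology

/-! ### §12d The polydisc toy: `MarginCauchy`, `GapShape`, `WalkBound`, `WalkShape` and the walk entropy bound JOINTLY
INHABITED on layered carriers — `CollarDecay` with the genuine per-collar ratio `e^{−cw} < 1` through `collarDecay_of_walks`,
its exact value and sharpness, and `FluctDampedOne` with a profile DECAYING IN THE SCALE SEPARATION through
`fluctDampedOne_of_collar` (§12c's toy has `δ = 1`: it witnesses the margin-Cauchy mechanism but no collar geometry). -/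

/-! #### §12d(i) Walk arithmetic of the toy: geometric tails -/

/-- The per-step weight of the toy's walks [folklore]: `q = e^{−c}/2` — the entropy weight `1/2` per step times the decay `e^{−c}`
per unit of scaled length (one step = one unit of length in its own scale). -/
noncomputable def stepWeight (c : ℝ) : ℝ := Real.exp (-c) / 2

/-- `0 < q`. [folklore] -/
theorem stepWeight_pos (c : ℝ) : 0 < stepWeight c := by
  unfold stepWeight
  positivity

/-- `q < 1` for `c ≥ 0`. [folklore] -/
theorem stepWeight_lt_one {c : ℝ} (hc : 0 ≤ c) : stepWeight c < 1 := by
  unfold stepWeight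
  have h : Real.exp (-c) ≤ 1 := Real.exp_le_one_iff.mpr (by linarith)
  linarith

/-- `q^ℓ = (1/2)^ℓ · e^{−cℓ}`: entropy weight times decay in the scaled length `ℓ`. [folklore] -/
theorem stepWeight_pow (c : ℝ) (ℓ : ℕ) : stepWeight c ^ ℓ = (1 / 2 : ℝ) ^ ℓ * Real.exp (-(c * ℓ)) := by
  have h : Real.exp (-(c * ℓ)) = Real.exp (-c) ^ ℓ := by
    rw [← Real.exp_nat_mul]
    ring_nf
  rw [h, stepWeight, div_pow, one_div_pow]
  ring

/-- THE TOY'S WALK TERMS [folklore], for an amplitude `A`: the displacement of the layer `n` in the step creating `X` expands over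
walks indexed by their number of steps `ℓ : ℕ` (one base point per layer, `π = Unit`; the background argument is not read); a walk
of `ℓ` steps carries `A·q^ℓ` if it is long enough to cross the `X − n` collars of `w` steps each between the layer and the
fluctuation region, and NOTHING otherwise — the vanishing of the short walks' terms is part of the datum (`WalkShape` asks the
separation of CONTRIBUTING walks only; cf. the kernels' localisation *"(if □∈𝒟_j)"*, [13] p. 411). -/
noncomputable def walkTerm {B : Type} (c : ℝ) (w : ℕ) : ℕ → B → ℝ → ℕ → Unit → ℕ → ℝ :=
  fun X _ A n _ ℓ => if (X - n) * w ≤ ℓ then A * stepWeight c ^ ℓ else 0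

/-- The UNIT DISPLACEMENT of the layer `n` in the step creating `X` [folklore]: the geometric tail
`Σ_{ℓ ≥ (X−n)w} q^ℓ = q^{(X−n)w}/(1 − q)`. -/
noncomputable def walkDisp (c : ℝ) (w X n : ℕ) : ℝ := stepWeight c ^ ((X - n) * w) / (1 - stepWeight c)

/-- `0 < walkDisp` for `c ≥ 0`. [folklore] -/
theorem walkDisp_pos {c : ℝ} (hc : 0 ≤ c) (w X n : ℕ) : 0 < walkDisp c w X n :=
  div_pos (pow_pos (stepWeight_pos c) _) (by linarith [stepWeight_lt_one hc])

/-- THE WALK EXPANSION CONVERGES TO THE DISPLACEMENT [folklore]: `Σ_ℓ walkTerm … ℓ = A · walkDisp c w X n`. -/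
theorem walkTerm_hasSum {B : Type} {c : ℝ} (hc : 0 ≤ c) (w X n : ℕ) (U : B) (A : ℝ) (p : Unit) :
    HasSum (fun ℓ => walkTerm c w X U A n p ℓ) (A * walkDisp c w X n) := by
  have hq0 : 0 ≤ stepWeight c := (stepWeight_pos c).le
  have hq1 : stepWeight c < 1 := stepWeight_lt_one hc
  -- the series shifted by the minimal crossing length `(X − n)·w` is geometric
  have hfun : (fun ℓ : ℕ => walkTerm c w X U A n p (ℓ + (X - n) * w)) =
      fun ℓ : ℕ => A * stepWeight c ^ ((X - n) * w) * stepWeight c ^ ℓ := by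
    funext ℓ
    simp only [walkTerm, if_pos (Nat.le_add_left ((X - n) * w) ℓ), pow_add]
    ring
  have hshift : HasSum (fun ℓ : ℕ => walkTerm c w X U A n p (ℓ + (X - n) * w))
      (A * stepWeight c ^ ((X - n) * w) * (1 - stepWeight c)⁻¹) := by
    rw [hfun]
    exact (hasSum_geometric_of_lt_one hq0 hq1).mul_left _
  -- the terms of the walks too short to cross vanish
  have hzero : ∑ i ∈ range ((X - n) * w), walkTerm c w X U A n p i = 0 := by
    refine sum_eq_zero fun i hi => ?_
    have hi' : ¬ (X - n) * w ≤ i := not_le.mpr (mem_range.mp hi)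
    simp only [walkTerm, if_neg hi']
  have h := (hasSum_nat_add_iff ((X - n) * w)).mp hshift
  rw [hzero, add_zero] at h
  have hval : A * stepWeight c ^ ((X - n) * w) * (1 - stepWeight c)⁻¹ = A * walkDisp c w X n := by
    rw [walkDisp, div_eq_mul_inv, mul_assoc]
  rw [hval] at h
  exact h

/-- ANY BOUND OF ALL PARTIAL SUMS BOUNDS THE DISPLACEMENT [folklore] (limit of the partial sums over `range N`). -/
theorem walkDisp_le_of_partialSums {B : Type} {c : ℝ} (hc : 0 ≤ c) (w X n : ℕ) (U : B) (A : ℝ) {t : ℝ}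
    (ht : ∀ (p : Unit) (s : Finset ℕ), |∑ ℓ ∈ s, walkTerm c w X U A n p ℓ| ≤ t) : |A * walkDisp c w X n| ≤ t := by
  have hsum := walkTerm_hasSum hc w X n U A ()
  have hlim : Tendsto (fun N : ℕ => |∑ ℓ ∈ range N, walkTerm c w X U A n () ℓ|) atTop (𝓝 |A * walkDisp c w X n|) :=
    (continuous_abs.tendsto _).comp hsum.tendsto_sum_nat
  exact le_of_tendsto' hlim fun N => ht () (range N)

/-- THE PER-WALK BOUND [folklore]: `|walkTerm| ≤ s·(1/2)^ℓ·e^{−cℓ}` for amplitudes `|A| ≤ s` — entropy weight times decay in the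
scaled length. -/
theorem walkTerm_abs_le {B : Type} (c : ℝ) (w X n : ℕ) (U : B) {A s : ℝ} (hA : |A| ≤ s) (p : Unit) (ℓ : ℕ) :
    |walkTerm c w X U A n p ℓ| ≤ s * (1 / 2 : ℝ) ^ ℓ * Real.exp (-(c * ℓ)) := by
  have hs : 0 ≤ s := (abs_nonneg A).trans hA
  show |(if (X - n) * w ≤ ℓ then A * stepWeight c ^ ℓ else 0)| ≤ s * (1 / 2 : ℝ) ^ ℓ * Real.exp (-(c * ℓ))
  split_ifs with h
  · rw [abs_mul, abs_of_nonneg (pow_nonneg (stepWeight_pos c).le ℓ), stepWeight_pow, ← mul_assoc]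
    exact mul_le_mul_of_nonneg_right (mul_le_mul_of_nonneg_right hA (by positivity)) (Real.exp_pos _).le
  · rw [abs_zero]
    positivity

/-- THE SEPARATION OF THE CONTRIBUTING WALKS [folklore]: a non-zero term has `(X − n)·w ≤ ℓ`. -/
theorem walkTerm_sep {B : Type} (c : ℝ) (w X n : ℕ) (U : B) (A : ℝ) (p : Unit) (ℓ : ℕ)
    (hne : walkTerm c w X U A n p ℓ ≠ 0) : ((X - n : ℕ) : ℝ) * (w : ℝ) ≤ (ℓ : ℝ) := by
  have h : (X - n) * w ≤ ℓ := by
    by_contra h'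
    exact hne (if_neg h')
  exact_mod_cast h

/-- THE TOY'S WALK ENTROPY IS BOUNDED [folklore]: `Σ_{ℓ∈s} s·(1/2)^ℓ ≤ 2s` for every finite set of walks (`sum_geometric_two_le`). -/
theorem walk_entropy {s : ℝ} (hs : 0 ≤ s) (p : Unit) (t : Finset ℕ) :
    ∑ ℓ ∈ t, (fun (_ : Unit) (ℓ : ℕ) => s * (1 / 2 : ℝ) ^ ℓ) p ℓ ≤ 2 * s := by
  have hsub : t ⊆ range (t.sup id + 1) := by
    intro ℓ hℓ
    have : ℓ ≤ t.sup id := Finset.le_sup (f := id) hℓ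
    exact mem_range.mpr (by omega)
  have h1 : ∑ ℓ ∈ t, (1 / 2 : ℝ) ^ ℓ ≤ ∑ ℓ ∈ range (t.sup id + 1), (1 / 2 : ℝ) ^ ℓ :=
    sum_le_sum_of_subset_of_nonneg hsub fun ℓ _ _ => by positivity
  have h2 := sum_geometric_two_le (t.sup id + 1)
  calc ∑ ℓ ∈ t, s * (1 / 2 : ℝ) ^ ℓ = s * ∑ ℓ ∈ t, (1 / 2 : ℝ) ^ ℓ := by rw [mul_sum]
    _ ≤ s * 2 := mul_le_mul_of_nonneg_left (h1.trans h2) hs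
    _ = 2 * s := by ring

/-! #### §12d(ii) The layered carriers, the polydisc chart and the layer gauge -/

/-- The LAYERED toy carriers [folklore]: domains indexed by their creation step (`scale = id`, `d = 0`), a background is ONE
COMPLEX VALUE PER LAYER (`ℕ → ℂ`, read through the two real components as in §8), trivial gauge and transport, one pending field. -/
abbrev polyCarriers : T4BoundaryCarrier.Carriers where
  Dom := ℕ
  scale := fun n => n
  d := fun _ => 0
  d_nonneg := fun _ => le_rfl
  BgA := (ℕ → ℂ) × Fin 2
  BgB := (ℕ → ℂ) × Fin 2
  gauge := fun _ _ => 0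
  gauge_nonneg := fun _ _ => le_rfl
  transport := fun U => U
  Fl := Unit
  admFl := Set.univ

/-- The toy's generation datum [folklore]: EVERY older piece is a parent (`parents n = range n`), so the profile of the
displacement-over-margin factor in the scale separation is exercised at all separations; no regular inputs; kernels zero. -/
def polyGeneration : Generation polyCarriers where
  parents := fun n : ℕ => range n
  parents_lt := fun _ _ hm => mem_range.mp hm
  eparents := fun _ => ∅
  eparents_lt := fun _ _ h => by simp at h
  K := fun _ _ => 0
  K_nonneg := fun _ _ => le_rfl
  KE := fun _ _ => 0
  KE_nonneg := fun _ _ => le_rfl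

/-- THE POLYDISC CHART [folklore]: fluctuation configurations are complex amplitudes `𝒜` with `‖𝒜‖ ≤ s`; the core of every output
is the open polydisc `‖U n‖ < ρ` (all layers); the displaced background moves the layer `n` by `𝒜 · walkDisp c w X n` — by the SUM
of the walk expansion (`walkTerm_hasSum`): geometrically LESS the more collars lie between the layer and the fluctuation region. -/
noncomputable def polyChart (ρ c : ℝ) (w : ℕ) (s : ℝ) : FluctChart polyCarriers ℂ where
  supp := fun _ => closedBall (0 : ℂ) s
  core := fun _ => {U | ∀ n : ℕ, ‖U.1 n‖ < ρ}
  chart := fun X U 𝒜 => (fun n => U.1 n + 𝒜 * (walkDisp c w X n : ℂ), U.2)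
  zero := 0
  chart_zero := fun X U => by simp

/-- The layer gauge of the layered toy [folklore]: the layer `n` reads the modulus of the difference of the layer-`n` values. -/
noncomputable def polyGauge : LayerGauge polyCarriers where
  dist := fun n U' U => ‖U'.1 n - U.1 n‖
  dist_nonneg := fun _ _ _ => norm_nonneg _
  dist_self := fun _ _ => by simp

/-- The displacement read by the layer gauge [folklore]: `dist n (chart X U 𝒜) U = ‖𝒜‖ · walkDisp c w X n`. -/
theorem poly_dist_chart {ρ c : ℝ} (hc : 0 ≤ c) (w : ℕ) (s : ℝ) (X n : ℕ) (U : (ℕ → ℂ) × Fin 2) (𝒜 : ℂ) :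
    polyGauge.dist n ((polyChart ρ c w s).chart X U 𝒜) U = ‖𝒜‖ * walkDisp c w X n := by
  show ‖U.1 n + 𝒜 * (walkDisp c w X n : ℂ) - U.1 n‖ = ‖𝒜‖ * walkDisp c w X n
  rw [add_sub_cancel_left, norm_mul, Complex.norm_real, Real.norm_eq_abs, abs_of_pos (walkDisp_pos hc w X n)]

/-- The toy's walk terms over the polydisc chart: amplitude `‖𝒜‖`. [folklore] -/
noncomputable def polyTerm (c : ℝ) (w : ℕ) : ℕ → ((ℕ → ℂ) × Fin 2) → ℂ → ℕ → Unit → ℕ → ℝ :=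
  fun X U 𝒜 n p ℓ => walkTerm c w X U ‖𝒜‖ n p ℓ

/-! #### §12d(iii) `CollarDecay` of the toy through the walk route, its exact ratio and sharpness -/

/-- **THE TOY INHABITS `WalkBound`** with `ε₀ = 1` [folklore]: the layer-`n` displacement IS the sum of the walk expansion, so any bound
of all its partial sums bounds it. -/
theorem poly_walkBound {ρ c : ℝ} (hc : 0 ≤ c) (w : ℕ) (s : ℝ) :
    WalkBound (polyChart ρ c w s) polyGauge (polyTerm c w) 1 := by
  intro X U _ 𝒜 _ n _ t ht
  rw [poly_dist_chart hc, one_mul]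
  have h := walkDisp_le_of_partialSums hc w X n U ‖𝒜‖ ht
  rwa [abs_of_nonneg (mul_nonneg (norm_nonneg 𝒜) (walkDisp_pos hc w X n).le)] at h

/-- **THE TOY INHABITS `WalkShape`** with the entropy weights `a ℓ = s·(1/2)^ℓ`, the scaled length `dω ℓ = ℓ`, the decay rate `c` and
the collar width `W = w` [folklore]. -/
theorem poly_walkShape (ρ c : ℝ) (w : ℕ) (s : ℝ) :
    WalkShape (polyChart ρ c w s) (polyTerm c w) (fun _ ℓ => s * (1 / 2 : ℝ) ^ ℓ) (fun _ ℓ => (ℓ : ℝ)) c w := by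
  intro X U _ 𝒜 h𝒜 n _ p ℓ
  have h𝒜' : |‖𝒜‖| ≤ s := by
    rw [abs_of_nonneg (norm_nonneg 𝒜)]
    exact mem_closedBall_zero_iff.mp h𝒜
  exact ⟨walkTerm_abs_le c w X n U h𝒜' p ℓ, walkTerm_sep c w X n U ‖𝒜‖ p ℓ⟩

/-- **`CollarDecay` OF THE TOY THROUGH THE WALK ROUTE** [folklore]: `collarDecay_of_walks` on the three inhabited hypotheses gives
`CollarDecay` with `ε = 1·(2s)` and the per-collar ratio `δ = e^{−cw}` — a GENUINE contraction for `c > 0`, `w ≥ 1`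
(`perCollar_ratio_lt_one`), on a chart that genuinely moves every layer (`poly_displacement_pos`). -/
theorem poly_collarDecay {ρ c : ℝ} (hc : 0 ≤ c) (w : ℕ) {s : ℝ} (hs : 0 ≤ s) :
    CollarDecay (polyChart ρ c w s) polyGauge (1 * (2 * s)) (Real.exp (-(c * w))) :=
  collarDecay_of_walks (poly_walkBound hc w s) (poly_walkShape ρ c w s) hc (fun _ ℓ => by positivity) (walk_entropy hs)

/-- NON-DEGENERACY [folklore]: the chart MOVES every layer below the creation step — the displacement of the layer `n` under the
amplitude `s > 0` is `s·q^{(X−n)w}/(1 − q) > 0` — and the terms of the crossing walks are non-zero. -/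
theorem poly_displacement_pos {ρ c : ℝ} (hc : 0 ≤ c) (w X n : ℕ) {s : ℝ} (hs : 0 < s) (U : (ℕ → ℂ) × Fin 2) :
    0 < polyGauge.dist n ((polyChart ρ c w s).chart X U (s : ℂ)) U ∧ polyTerm c w X U (s : ℂ) n () ((X - n) * w) ≠ 0 := by
  have hns : ‖(s : ℂ)‖ = s := by rw [Complex.norm_real, Real.norm_eq_abs, abs_of_pos hs]
  refine ⟨?_, ?_⟩
  · rw [poly_dist_chart hc, hns]
    exact mul_pos hs (walkDisp_pos hc w X n)
  · show (if (X - n) * w ≤ (X - n) * w then ‖(s : ℂ)‖ * stepWeight c ^ ((X - n) * w) else 0) ≠ 0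
    rw [if_pos le_rfl, hns]
    exact (mul_pos hs (pow_pos (stepWeight_pos c) _)).ne'

/-- THE EXACT PER-COLLAR RATIO OF THE TOY [folklore]: directly from the closed form, `CollarDecay` holds with `ε = s/(1 − q)` and the
ratio `q^w = e^{−cw}·2^{−w}` — smaller than the walk route's `e^{−cw}` by the entropy gain `2^{−w}`, which `walkSum_le` spends on the
count of walks ([13] p. 410: *"We will use the factor O(M^{−1/2}) to control the sum over random walks ω"*), not on the decay. -/
theorem poly_collarDecay_exact {ρ c : ℝ} (hc : 0 ≤ c) (w : ℕ) (s : ℝ) :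
    CollarDecay (polyChart ρ c w s) polyGauge (s / (1 - stepWeight c)) (stepWeight c ^ w) := by
  intro X U _ 𝒜 h𝒜 n _
  have h𝒜' : ‖𝒜‖ ≤ s := mem_closedBall_zero_iff.mp h𝒜
  have hq1 : 0 < 1 - stepWeight c := by linarith [stepWeight_lt_one hc]
  have hq1' : (1 - stepWeight c) ≠ 0 := hq1.ne'
  rw [poly_dist_chart hc, walkDisp, ← pow_mul, mul_comm (X - n) w, pow_mul, ← mul_div_assoc, div_le_iff₀ hq1]
  calc ‖𝒜‖ * (stepWeight c ^ w) ^ (X - n) ≤ s * (stepWeight c ^ w) ^ (X - n) :=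
        mul_le_mul_of_nonneg_right h𝒜' (pow_nonneg (pow_nonneg (stepWeight_pos c).le w) _)
    _ = s / (1 - stepWeight c) * (stepWeight c ^ w) ^ (X - n) * (1 - stepWeight c) := by
        field_simp

/-- … AND NOTHING BELOW IT [folklore]: for `s > 0` and a non-empty core `ρ > 0` (for `ρ ≤ 0` the core is empty and `CollarDecay`,
like every shape of §12, holds vacuously — the binder `0 < ρ` is where the non-degeneracy lives) the toy is NOT `CollarDecay` with
any ratio `δ′ < q^w`, whatever the constant `ε` — the per-collar ratio is a property of the chart, read off exactly by the layer
gauge. -/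
theorem poly_not_collarDecay_below {ρ c : ℝ} (hρ : 0 < ρ) (hc : 0 ≤ c) (w : ℕ) {s : ℝ} (hs : 0 < s) {ε δ' : ℝ}
    (hδ' : δ' < stepWeight c ^ w) : ¬ CollarDecay (polyChart ρ c w s) polyGauge ε δ' := by
  intro hCD
  set Q := stepWeight c ^ w with hQ
  have hQ0 : 0 < Q := pow_pos (stepWeight_pos c) w
  have hq1 : 0 < 1 - stepWeight c := by linarith [stepWeight_lt_one hc]
  have hsupp : (s : ℂ) ∈ (polyChart ρ c w s).supp 0 := by
    show (s : ℂ) ∈ closedBall (0 : ℂ) s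
    rw [mem_closedBall_zero_iff, Complex.norm_real, Real.norm_eq_abs, abs_of_pos hs]
  have hcore : ((fun _ => (0 : ℂ)), (0 : Fin 2)) ∈ (polyChart ρ c w s).core 0 := by
    intro n
    simpa using hρ
  have hns : ‖(s : ℂ)‖ = s := by rw [Complex.norm_real, Real.norm_eq_abs, abs_of_pos hs]
  -- the collar-decay inequality at `X = k`, `n = 0`, amplitude `s`: `s·Q^k/(1−q) ≤ ε·δ′^k`
  have key : ∀ k : ℕ, 1 ≤ k → s * Q ^ k / (1 - stepWeight c) ≤ ε * δ' ^ k := by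
    intro k hk
    have h := hCD k _ hcore (s : ℂ) hsupp 0 (show 0 < k by omega)
    rw [poly_dist_chart hc, hns, walkDisp, Nat.sub_zero, mul_comm k w, pow_mul, ← hQ, ← mul_div_assoc] at h
    exact h
  have hpos : ∀ k : ℕ, 0 < s * Q ^ k / (1 - stepWeight c) := fun k => div_pos (mul_pos hs (pow_pos hQ0 k)) hq1
  have h1 := lt_of_lt_of_le (hpos 1) (key 1 le_rfl)
  have h2 := lt_of_lt_of_le (hpos 2) (key 2 (by norm_num))
  rcases lt_trichotomy δ' 0 with hneg | hzero | hposδ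
  · -- `δ′ < 0`: `ε·δ′` and `ε·δ′²` cannot both be positive
    rw [pow_one] at h1
    nlinarith [h1, h2, hneg, sq_nonneg δ']
  · rw [hzero, pow_one, mul_zero] at h1
    exact lt_irrefl 0 h1
  · -- `0 < δ′ < Q`: `(Q/δ′)^k` is unbounded, but `key` bounds it by `ε(1−q)/s`
    have hratio : 1 < Q / δ' := (one_lt_div hposδ).mpr hδ'
    have hy : 0 < Q / δ' - 1 := by linarith
    set M := ε * (1 - stepWeight c) / s with hM
    have hbound : ∀ k : ℕ, 1 ≤ k → (Q / δ') ^ k ≤ M := by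
      intro k hk
      have hk' := key k hk
      have hδk : 0 < δ' ^ k := pow_pos hposδ k
      rw [div_pow, div_le_iff₀ hδk]
      have h3 : s * Q ^ k ≤ s * (M * δ' ^ k) :=
        calc s * Q ^ k ≤ ε * δ' ^ k * (1 - stepWeight c) := (div_le_iff₀ hq1).mp hk'
          _ = s * (M * δ' ^ k) := by
            rw [hM]
            field_simp
      exact le_of_mul_le_mul_left h3 hs
    obtain ⟨N, hN⟩ := add_one_pow_unbounded_of_pos M hy
    rw [sub_add_cancel] at hN
    rcases Nat.eq_zero_or_pos N with hN0 | hNpos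
    · rw [hN0, pow_zero] at hN
      have := hbound 1 le_rfl
      rw [pow_one] at this
      linarith
    · exact absurd (hbound N hNpos) (not_le.mpr hN)

/-! #### §12d(iv) `MarginCauchy` of the toy: layer-local tables separately holomorphic with margin `r` in every layer -/

/-- The complex-valued function of the layered background rebuilt from the two real components of the table of the piece `m`
(§8's `cplx`, layered). [folklore] -/
def pcplx (h : BTable polyCarriers ((ℕ → ℂ) × Fin 2)) (m : ℕ) (a : Unit) : (ℕ → ℂ) → ℂ :=
  fun V => ⟨h m (V, 0) a, h m (V, 1) a⟩

/-- The component read-out inverts the complexification. [folklore] -/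
theorem cpart_pcplx (h : BTable polyCarriers ((ℕ → ℂ) × Fin 2)) (m : ℕ) (a : Unit) (V : ℕ → ℂ) (i : Fin 2) :
    cpart i (pcplx h m a V) = h m (V, i) a := by
  fin_cases i <;> simp [cpart, pcplx]

/-- THE TOY'S ONE-TABLE ADMISSIBLE CLASS [folklore] — the layered printed-space convention of [III] (2.34)–(2.39) p. 261 in the toy:
the table of the piece `m` reads the layers `n ≤ m` ONLY (a term created at the step `m` is a function of the background fields
of the steps up to `m`), and along every single layer, the other layers frozen anywhere, its complexification is differentiable
on the disc of radius `ρ + r`: margin `r` beyond the core radius `ρ` in EVERY layer. -/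
def PolyAdmT (ρ r : ℝ) : (ℕ → ℝ) → BTable polyCarriers ((ℕ → ℂ) × Fin 2) → Prop := fun _ h =>
  (∀ (m : ℕ) (i : Fin 2) (a : Unit) (V V' : ℕ → ℂ), (∀ n ≤ m, V n = V' n) → h m (V, i) a = h m (V', i) a) ∧
    ∀ (m : ℕ) (a : Unit) (k : ℕ) (V : ℕ → ℂ),
      DifferentiableOn ℂ (fun z => pcplx h m a (Function.update V k z)) (ball 0 (ρ + r))

/-- THE ONE-VARIABLE CAUCHY STEP [folklore] (§10b's computation, abstracted): a function differentiable on the disc of radius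
`ρ + r` and bounded by `B` everywhere moves by at most `(2‖δ‖/r)·B` from a point of the core disc `‖z‖ < ρ` under a
displacement `‖δ‖ ≤ r/2` (Cauchy's estimate on circles of radius `r/2`, then the mean value inequality on the disc of radius
`ρ + r/2`). -/
theorem oneVar_cauchy {φ : ℂ → ℂ} {ρ r B : ℝ} (hr : 0 < r) (hφ : DifferentiableOn ℂ φ (ball 0 (ρ + r)))
    (hB : ∀ u : ℂ, ‖φ u‖ ≤ B) {z δ : ℂ} (hz : ‖z‖ < ρ) (hδ : ‖δ‖ ≤ r / 2) :
    ‖φ (z + δ) - φ z‖ ≤ 2 * ‖δ‖ / r * B := by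
  have hB0 : 0 ≤ B := (norm_nonneg _).trans (hB 0)
  -- derivative bound on the disc of radius ρ + r/2, by Cauchy on circles of radius r/2
  have hderiv : ∀ y ∈ ball (0 : ℂ) (ρ + r / 2), ‖deriv φ y‖ ≤ 2 * B / r := by
    intro y hy
    rw [mem_ball, dist_zero_right] at hy
    have hsub : closedBall y (r / 2) ⊆ ball (0 : ℂ) (ρ + r) := by
      intro u hu
      rw [mem_closedBall] at hu
      rw [mem_ball, dist_zero_right]
      calc ‖u‖ = ‖(u - y) + y‖ := by ring_nf
        _ ≤ ‖u - y‖ + ‖y‖ := norm_add_le _ _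
        _ = dist u y + ‖y‖ := by rw [dist_eq_norm]
        _ < ρ + r := by linarith
    have hdc : DiffContOnCl ℂ φ (ball y (r / 2)) := hφ.diffContOnCl_ball hsub
    have hc := Complex.norm_deriv_le_of_forall_mem_sphere_norm_le (by positivity : 0 < r / 2) hdc (fun u _ => hB u)
    calc ‖deriv φ y‖ ≤ B / (r / 2) := hc
      _ = 2 * B / r := by field_simp
  have hdiff : ∀ y ∈ ball (0 : ℂ) (ρ + r / 2), DifferentiableAt ℂ φ y := by
    intro y hy
    rw [mem_ball, dist_zero_right] at hy
    exact hφ.differentiableAt (isOpen_ball.mem_nhds (by rw [mem_ball, dist_zero_right]; linarith))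
  have hzin : z ∈ ball (0 : ℂ) (ρ + r / 2) := by
    rw [mem_ball, dist_zero_right]; linarith
  have hzδin : z + δ ∈ ball (0 : ℂ) (ρ + r / 2) := by
    rw [mem_ball, dist_zero_right]
    calc ‖z + δ‖ ≤ ‖z‖ + ‖δ‖ := norm_add_le _ _
      _ < ρ + r / 2 := by linarith
  have hmv := (convex_ball (0 : ℂ) (ρ + r / 2)).norm_image_sub_le_of_norm_deriv_le hdiff hderiv hzin hzδin
  calc ‖φ (z + δ) - φ z‖ ≤ 2 * B / r * ‖z + δ - z‖ := hmv
    _ = 2 * B / r * ‖δ‖ := by rw [add_sub_cancel_left]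
    _ = 2 * ‖δ‖ / r * B := by ring

/-- **THE TOY REALISES `MarginCauchy` ON THE LAYERED SPACES** with `c₀ = 4` and the constant gap `r` [folklore] — the typed form of
print's `1/r` maximised over the layers ([I] p. 273 with [III] p. 261): change the layers `0, 1, …, scale Y` of the background one
at a time (telescoping; the table of the parent `Y` does not read the higher layers); on each layer the one-variable Cauchy step
costs `(2·dist_n/r)·(2D·e^{−κd})` (the factor `2` from the two real components), PROVIDED the displacement of that layer is at most
half the gap — the precondition of `MarginCauchy`; the sum over the layers is the layer sum of `MarginCauchy`. -/
theorem poly_marginCauchy (ρ r c : ℝ) (w : ℕ) (s : ℝ) (hr : 0 < r) (W : Set (ℕ → ℝ)) (κ : ℝ) :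
    MarginCauchy polyGeneration (polyChart ρ c w s) W κ (PolyAdmT ρ r) polyGauge (fun _ _ _ => r) 4 := by
  intro g _ h hh X Y _ D hD hsup U hU 𝒜 _ hhalf a _
  change ℕ at X Y
  obtain ⟨hloc, hdiff⟩ := hh
  obtain ⟨U₁, i⟩ := U
  have hcoreU : ∀ n : ℕ, ‖U₁ n‖ < ρ := hU
  set B : ℝ := D * Real.exp (-(κ * polyCarriers.d Y)) with hB
  have hB0 : 0 ≤ B := mul_nonneg hD (Real.exp_pos _).le
  -- the layer displacements and the partially displaced backgrounds
  set Δ : ℕ → ℂ := fun n => 𝒜 * (walkDisp c w X n : ℂ) with hΔ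
  set V : ℕ → ℕ → ℂ := fun k n => if n < k then U₁ n + Δ n else U₁ n with hV
  have hV0 : V 0 = U₁ := by
    funext n
    simp [hV]
  have hVkk : ∀ k, V k k = U₁ k := by
    intro k
    simp [hV]
  have hVsucc : ∀ k, V (k + 1) = Function.update (V k) k (V k k + Δ k) := by
    intro k
    funext n
    by_cases hnk : n = k
    · subst hnk
      simp [hV]
    · rw [Function.update_of_ne hnk]
      have h1 : (n < k + 1) ↔ (n < k) := by omega
      simp only [hV, h1]
  have hVtop : ∀ n ≤ Y, V (Y + 1) n = U₁ n + Δ n := by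
    intro n hn
    have h1 : n < Y + 1 := by omega
    simp only [hV, if_pos h1]
  -- the displacement of the layer `k ≤ Y` is what the gauge reads, and is at most half the gap
  have hdistk : ∀ k, polyGauge.dist k ((polyChart ρ c w s).chart X (U₁, i) 𝒜) (U₁, i) = ‖Δ k‖ := by
    intro k
    show ‖U₁ k + 𝒜 * (walkDisp c w X k : ℂ) - U₁ k‖ = ‖Δ k‖
    rw [add_sub_cancel_left]
  have hhalfk : ∀ k ≤ Y, ‖Δ k‖ ≤ r / 2 := by
    intro k hk
    have h1 : Y - k ∈ range (polyCarriers.scale Y + 1) := mem_range.mpr (show Y - k < Y + 1 by omega)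
    have h2 := hhalf (Y - k) h1
    rw [show polyCarriers.scale Y - (Y - k) = k from Nat.sub_sub_self hk, hdistk] at h2
    exact h2
  -- the complexified table along the telescoping path
  set F : ℕ → ℂ := fun k => pcplx h Y a (V k) with hF
  have hFsup : ∀ V' : ℕ → ℂ, ‖pcplx h Y a V'‖ ≤ 2 * B := by
    intro V'
    have h0 := hsup (V', 0) a (Set.mem_univ _)
    have h1 := hsup (V', 1) a (Set.mem_univ _)
    have hre : |(pcplx h Y a V').re| ≤ B := by simpa [pcplx] using h0
    have him : |(pcplx h Y a V').im| ≤ B := by simpa [pcplx] using h1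
    calc ‖pcplx h Y a V'‖ ≤ |(pcplx h Y a V').re| + |(pcplx h Y a V').im| := Complex.norm_le_abs_re_add_abs_im _
      _ ≤ B + B := add_le_add hre him
      _ = 2 * B := by ring
  -- one layer at a time: the one-variable Cauchy step
  have hstep : ∀ k ∈ range (Y + 1), ‖F (k + 1) - F k‖ ≤ 4 * B * (‖Δ k‖ / r) := by
    intro k hk
    have hkY : k ≤ Y := Nat.lt_succ_iff.mp (mem_range.mp hk)
    set φ : ℂ → ℂ := fun z => pcplx h Y a (Function.update (V k) k z) with hφ
    have hφk : F k = φ (V k k) := by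
      simp only [hF, hφ, Function.update_eq_self]
    have hφk1 : F (k + 1) = φ (V k k + Δ k) := by
      simp only [hF, hφ, hVsucc k]
    rw [hφk, hφk1]
    have hzk : ‖V k k‖ < ρ := by rw [hVkk]; exact hcoreU k
    have h := oneVar_cauchy hr (hdiff Y a k (V k)) (fun u => hFsup _) hzk (hhalfk k hkY)
    calc ‖φ (V k k + Δ k) - φ (V k k)‖ ≤ 2 * ‖Δ k‖ / r * (2 * B) := h
      _ = 4 * B * (‖Δ k‖ / r) := by ring
  -- telescoping over the layers 0, …, Y
  have htel : F (Y + 1) - F 0 = ∑ k ∈ range (Y + 1), (F (k + 1) - F k) := (sum_range_sub F (Y + 1)).symm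
  have hnorm : ‖F (Y + 1) - F 0‖ ≤ 4 * B * ∑ k ∈ range (Y + 1), ‖Δ k‖ / r := by
    rw [htel, mul_sum]
    exact (norm_sum_le _ _).trans (sum_le_sum hstep)
  -- the endpoints are the displaced and the undisplaced background (layer-locality of the parent's table)
  have htop : h Y ((polyChart ρ c w s).chart X (U₁, i) 𝒜) a = h Y (V (Y + 1), i) a := by
    show h Y ((fun n => U₁ n + 𝒜 * (walkDisp c w X n : ℂ)), i) a = h Y (V (Y + 1), i) a
    exact hloc Y i a _ _ fun n hn => (hVtop n hn).symm
  have hbot : h Y (U₁, i) a = h Y (V 0, i) a := by rw [hV0]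
  -- reflect the layer sum: `Σ_{k ≤ Y} ‖Δ k‖/r = Σ_{i ≤ Y} dist_{Y − i}/r`
  have hrefl : ∑ k ∈ range (Y + 1), ‖Δ k‖ / r =
      ∑ j ∈ range (polyCarriers.scale Y + 1),
        polyGauge.dist (polyCarriers.scale Y - j) ((polyChart ρ c w s).chart X (U₁, i) 𝒜) (U₁, i) / r := by
    show ∑ k ∈ range (Y + 1), ‖Δ k‖ / r =
      ∑ j ∈ range (Y + 1), polyGauge.dist (Y - j) ((polyChart ρ c w s).chart X (U₁, i) 𝒜) (U₁, i) / r
    rw [← sum_range_reflect (fun k => ‖Δ k‖ / r) (Y + 1)]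
    refine sum_congr rfl fun j hj => ?_
    rw [hdistk, show Y + 1 - 1 - j = Y - j by omega]
  -- assemble
  show |fluct (polyChart ρ c w s) h X Y (U₁, i) 𝒜 a| ≤ 4 * (∑ j ∈ range (polyCarriers.scale Y + 1),
      polyGauge.dist (polyCarriers.scale Y - j) ((polyChart ρ c w s).chart X (U₁, i) 𝒜) (U₁, i) / r) * B
  rw [fluct, htop, hbot, ← hrefl, ← cpart_pcplx h Y a (V (Y + 1)) i, ← cpart_pcplx h Y a (V 0) i, cpart_sub]
  calc |cpart i (pcplx h Y a (V (Y + 1)) - pcplx h Y a (V 0))| ≤ ‖pcplx h Y a (V (Y + 1)) - pcplx h Y a (V 0)‖ :=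
        abs_cpart_le i _
    _ = ‖F (Y + 1) - F 0‖ := rfl
    _ ≤ 4 * B * ∑ k ∈ range (Y + 1), ‖Δ k‖ / r := hnorm
    _ = 4 * (∑ k ∈ range (Y + 1), ‖Δ k‖ / r) * B := by ring

/-- The toy's constant gap `r` is `GapShape` with `g₀ = r`, `ρ = 1`. [folklore] -/
theorem poly_gapShape (r : ℝ) (hr : 0 < r) : GapShape polyGeneration (fun _ _ _ => r) r 1 := by
  intro X Y _ i _
  exact ⟨hr, by simp⟩

/-- THE CLIP TABLE [folklore]: the piece `m` reads the CLIPPED layer-`m` value (`U m` on the disc of radius `ρ + r`, `0` outside)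
through its two real components — a non-constant, bounded, layer-local table. -/
noncomputable def clipTable (ρ r : ℝ) : BTable polyCarriers ((ℕ → ℂ) × Fin 2) :=
  fun m U _ => cpart U.2 (if ‖U.1 m‖ < ρ + r then U.1 m else 0)

/-- THE ADMISSIBLE CLASS IS INHABITED BY THE CLIP TABLE [folklore]: layer-local, separately differentiable on the disc in the layer
`m` (it agrees with the identity there) and constant in every other layer. -/
theorem polyAdmT_clip (ρ r : ℝ) (g : ℕ → ℝ) : PolyAdmT ρ r g (clipTable ρ r) := by
  refine ⟨?_, ?_⟩
  · intro m i a V V' hVV'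
    simp only [clipTable, hVV' m le_rfl]
  · intro m a k V
    have hfun : ∀ z : ℂ, pcplx (clipTable ρ r) m a (Function.update V k z) =
        (if ‖Function.update V k z m‖ < ρ + r then Function.update V k z m else 0) := by
      intro z
      apply Complex.ext <;> simp [pcplx, clipTable, cpart]
    simp_rw [hfun]
    by_cases hkm : k = m
    · subst hkm
      simp_rw [Function.update_self]
      refine differentiableOn_id.congr ?_
      intro z hz
      rw [mem_ball, dist_zero_right] at hz
      simp [hz]
    · simp_rw [Function.update_of_ne (Ne.symm hkm)]
      exact differentiableOn_const _

/-- … IS BOUNDED EVERYWHERE by `ρ + r` [folklore], so the sup hypothesis of `MarginCauchy`/`FluctDampedOne` is met with a finite `D`. -/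
theorem clipTable_abs_le {ρ r : ℝ} (hR : 0 ≤ ρ + r) (m : ℕ) (U : (ℕ → ℂ) × Fin 2) (a : Unit) :
    |clipTable ρ r m U a| ≤ ρ + r := by
  unfold clipTable
  refine (abs_cpart_le U.2 _).trans ?_
  split_ifs with h
  · exact h.le
  · rwa [norm_zero]

/-- … AND ITS INSERTED FLUCTUATION DIFFERENCE IS THE LAYER DISPLACEMENT ITSELF [folklore]: at the zero background, for the parent
`m` of the output `X` and a real amplitude `s` with `s·walkDisp < ρ + r`, the real component of the clip table moves by exactly
`s · walkDisp c w X m` — the chain `MarginCauchy → FluctDampedOne` is exercised on a non-zero difference. -/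
theorem clipTable_fluct {ρ r c : ℝ} (hc : 0 ≤ c) (w : ℕ) {s : ℝ} (hs : 0 ≤ s) (X m : ℕ)
    (hsmall : s * walkDisp c w X m < ρ + r) :
    fluct (polyChart ρ c w s) (clipTable ρ r) X m ((fun _ => (0 : ℂ)), (0 : Fin 2)) (s : ℂ) () = s * walkDisp c w X m := by
  have hnorm : ‖(s : ℂ) * (walkDisp c w X m : ℂ)‖ = s * walkDisp c w X m := by
    rw [← Complex.ofReal_mul, Complex.norm_real, Real.norm_eq_abs, abs_of_nonneg (mul_nonneg hs (walkDisp_pos hc w X m).le)]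
  show cpart 0 (if ‖(0 : ℂ) + (s : ℂ) * (walkDisp c w X m : ℂ)‖ < ρ + r then (0 : ℂ) + (s : ℂ) * (walkDisp c w X m : ℂ) else 0) -
      cpart 0 (if ‖(0 : ℂ)‖ < ρ + r then (0 : ℂ) else 0) = s * walkDisp c w X m
  rw [zero_add, hnorm, if_pos hsmall]
  simp [cpart, ← Complex.ofReal_mul]

/-! #### §12d(v) The three shapes compose: `FluctDampedOne` with a profile decaying in the scale separation -/

/-- **END-TO-END ON THE TOY** [folklore]: `poly_marginCauchy` + `poly_gapShape` + `poly_collarDecay` through `fluctDampedOne_of_collar`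
give `FluctDampedOne` for the admissible class with the LAYERED factor `layeredSigma (4·(1·2s)/r) (e^{−cw}) 1`, i.e.
`σ X Y = (8s/r)·Σ_{i ≤ scale Y} (e^{−cw})^{(scale X − scale Y) + i} ≤ (8s/r)·(e^{−cw})^{scale X − scale Y}/(1 − e^{−cw})` — DECAYING
GEOMETRICALLY IN THE SCALE SEPARATION with the per-collar ratio, for displacements `4s ≤ r`: the three shapes of §12 are jointly
inhabited with a genuine contraction (`c > 0`, `w ≥ 1`), which §12c's toy (`δ = 1`) does not show. -/
theorem poly_fluctDampedOne_of_collar (ρ r c : ℝ) (w : ℕ) (s : ℝ) (hr : 0 < r) (hc : 0 ≤ c) (hs : 0 ≤ s)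
    (h4s : 4 * s ≤ r) (W : Set (ℕ → ℝ)) (κ : ℝ) :
    FluctDampedOne polyGeneration (polyChart ρ c w s) W κ (PolyAdmT ρ r)
      (layeredSigma polyCarriers (4 * (1 * (2 * s)) / r) (Real.exp (-(c * w))) 1) := by
  have hδ1 : Real.exp (-(c * w)) ≤ 1 := Real.exp_le_one_iff.mpr (by
    have : (0 : ℝ) ≤ c * w := by positivity
    linarith)
  exact fluctDampedOne_of_collar (poly_marginCauchy ρ r c w s hr W κ) (poly_gapShape r hr) (poly_collarDecay hc w hs)
    (by norm_num) hr zero_le_one (by positivity) (Real.exp_pos _).le hδ1 (by rw [mul_one]; exact hδ1) (by linarith)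

end PolydiscToy

/-! ### §12e THE ANALYTIC FRAME: the margin-Cauchy shape (B) with its modulus DERIVED, `c₀ = 4`

Print states the analyticity of every boundary term as an EXTENSION to a complex space of field configurations — [III] p. 261,
(2.41): *"(ii) it has an extension to an analytic function on the space Ũ^c_j(X, α̃₀, α̃₁)"*, bounded there by (2.42) *"|𝐁^{(j)}(X,(𝐔,𝐉),
A,{S_i∩X})| < B₀exp(−κd_j(X))"* —, reaches a displaced configuration along an AFFINE complex line — [I] p. 273: *"To get an analytic
extension of (3.7) we substitute 𝐀 = 𝐇_j(B(t)) + t_□⟨…⟩"*, the Cauchy formula (3.15) *"(1/2πi)∫_{|t_□|=r} dt_□ (1/t_□²)𝐄^{(j)}(X, …, …)"* in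
the ONE complex variable `t_□`, *"r max{|δ𝐇_j|_X, |P₁δ𝐇_j|_X, |∇^ξ_𝐔δ𝐇_j|_X, |Δ^ξ_𝐔δ𝐇_j|_X} = ⅓α₂"*, (3.17) *"|(3.15)| ≤ (1/r)E₀exp(−κd_j(X))"*
—, and fits that line into the LARGER space of the parent by the margin between consecutive printed spaces — p. 277: *"we have to
use a part of the analyticity domains of terms in 𝐁_k for the function 𝐇_k. This is the reason for putting the powers of 1/2 in the
conditions (2.36)–(2.39). The analyticity domains become smaller after each step, but the difference is very small and exponentially
decreasing in the number of steps."* together with the antitone radius factors of (2.34)–(2.39) (`B14Radii.shrink`, decreasing in the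
step count).  (p. 262's *"newly created expressions 𝐄^{(k)}, 𝐑^{(k)}, 𝐁^{(k)} are defined on slightly larger spaces, with the
coefficients in their definition bigger by β multiplied by a corresponding number"* is CONTEXT only: on the page it is the transient
within-step enlargement of the NEWLY created index-`k` terms after the operation `T` — *"Such improved bounds are needed for the
𝐑-operation"* —, the opposite direction to this margin and not a support of (F-M); cross-read C-adv8-81 D1.)  §12–§12d typed the
OUTCOME of that step as
the hypothesis shape `MarginCauchy … c₀` with an UNDISPLAYED modulus `c₀` (no modulus is displayed for the boundary terms: p. 276
*"To its terms we apply the formulas (3.6), (3.7) [I]"*).  This section types THE STEP ITSELF over a posited encoding `CplxFrame` —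
the run-B backgrounds near the core are real components of points of a complex normed space `E` carrying one seminorm per layer,
the chart is a translation in `E`, the layer gauge dominates the layer seminorms of the displacement vector, the closed gap-polydisc
about a core point of the child lies in the parent's encoded domain, and every admissible table restricted to encoded points is a
real component of ONE complex-differentiable function on that domain: five HYPOTHESIS SHAPES (F-Ch), (F-Co), (F-G), (F-M), (F-An),
each a located sentence of print typed abstractly, none asserted — and DERIVES `MarginCauchy` with `c₀ = 4` [folklore: Liouville's
theorem and Cauchy's estimate on one complex line, through `Dimock2015.norm_sub_le_div_of_bound_sphere`]: `marginCauchy_of_frame`.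
The modulus is thereby a kernel-checked `4` (`2` for reading a real component off a complex value bounded through both components,
`× 2` for `1/(r − 1) ≤ 2/r` at radius `r = 1/S ≥ 2`), and what an instantiation owes INSTEAD of `c₀` is the five frame hypotheses on
print's spaces (2.34)–(2.39).  §12e(ii): the displayed radius factors, typed in the tree as `B14Radii.shrink` (pv02), give the gap
profile `GapShape` with `g₀ = aβα/2`, `ρ = 2` for layer-constant coefficients; §12e(iii): the §12c toy is a frame and
`cauchy_marginCauchy` becomes an instance.  SCOPE, honest as typed: the frame reaches the displaced configuration along ONE affine
line (print's `t_□`-device at fixed `t`); print reaches a general one by the outer real interpolation (3.7) — *"an analytic extension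
of (3.7)"* — whose integrand is bounded by the same step at every `t`; a non-affine chart owes that outer integral at instantiation.
Typing + bookkeeping; NOT summit progress; nothing of Bałaban's objects is asserted. -/

/-- **POSITED INTERFACE `CplxFrame C A E`** (bookkeeping, NOT a printed object; no existence smuggled — an instance is a datum of
every theorem of §12e, and §12e(iii) builds one): an ENCODING of run-B backgrounds as real components of points of a complex normed
space `E` — `semi n` the seminorm of the layer of scale `n` (the typed reading of the layer-wise maxima constrained in (2.34)–(2.39)
p. 261, each in the layer's unit `Lⁿξ`), `pt z i` the background read as the real component `i` of the complex configuration `z`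
(print's complex spaces `Ũ^c_j(X, α̃₀, α̃₁)` of (2.41), in the convention of §8's Cauchy carriers), `disp X z 𝒜` the displacement
VECTOR of the chart of the step creating `X` (print's `t_□`-direction `⟨…⟩` of [I] p. 273 *"𝐀 = 𝐇_j(B(t)) + t_□⟨…⟩"*), `dom Y` the
encoded analyticity domain of the parent `Y`'s tables.  Nothing of the spaces themselves is modelled.
[cite: Balaban1988Convergent, (2.34)–(2.41) p.261; Balaban1987RG1, p.273] -/
structure CplxFrame (C : T4BoundaryCarrier.Carriers) (A : Type) (E : Type*) [NormedAddCommGroup E] [NormedSpace ℂ E]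
    where
  /-- the seminorm of the layer of scale `n` -/
  semi : ℕ → Seminorm ℂ E
  /-- encoded background points: the real component `i` read at the complex configuration `z` -/
  pt : E → Fin 2 → C.BgB
  /-- the displacement vector of the chart of the step creating `X`, at `z`, under `𝒜` -/
  disp : C.Dom → E → A → E
  /-- the encoded analyticity domain of the tables of the parent `Y` -/
  dom : C.Dom → Set E

section Frame

variable {A : Type} {E : Type*} [NormedAddCommGroup E] [NormedSpace ℂ E]

/-- **(F-Ch) HYPOTHESIS SHAPE** (print's affine device typed; asserted for nothing of Bałaban's): on core points and admissible
amplitudes the chart of the step creating `X` acts on encoded points as the TRANSLATION by the displacement vector — [I] p. 273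
*"To get an analytic extension of (3.7) we substitute 𝐀 = 𝐇_j(B(t)) + t_□⟨…⟩"* at `t_□ = 1`. [cite: Balaban1987RG1, p.273] -/
def FrameChart (F : CplxFrame C A E) (ch : FluctChart C A) : Prop :=
  ∀ (X : C.Dom) (z : E) (i : Fin 2), F.pt z i ∈ ch.core X → ∀ 𝒜 ∈ ch.supp X,
    ch.chart X (F.pt z i) 𝒜 = F.pt (z + F.disp X z 𝒜) i

/-- **(F-Co) HYPOTHESIS SHAPE**: every core point of the step creating `X` is an encoded point (real configurations are points of
print's complex spaces, (2.41) p. 261). [cite: Balaban1988Convergent, (2.41) p.261] -/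
def FrameCore (F : CplxFrame C A E) (ch : FluctChart C A) : Prop :=
  ∀ (X : C.Dom), ∀ U ∈ ch.core X, ∃ (z : E) (i : Fin 2), U = F.pt z i

/-- **(F-G) HYPOTHESIS SHAPE**: the layer gauge DOMINATES the layer seminorms of the displacement vector —
`semi n (disp X z 𝒜) ≤ dist n (chart X U 𝒜) U` at every core point `U = pt z i`: print measures the displacement `δ𝐇_j` by exactly
the maxima fixing the radius, [I] p. 273 *"r max{|δ𝐇_j|_X, |P₁δ𝐇_j|_X, |∇^ξ_𝐔δ𝐇_j|_X, |Δ^ξ_𝐔δ𝐇_j|_X} = ⅓α₂"*, which §12 reads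
layer by layer (`LayerGauge`). [cite: Balaban1987RG1, (3.15)–(3.17) p.273; Balaban1988Convergent, (2.34)–(2.39) p.261] -/
def FrameGauge (F : CplxFrame C A E) (ch : FluctChart C A) (lg : LayerGauge C) : Prop :=
  ∀ (X : C.Dom) (z : E) (i : Fin 2), F.pt z i ∈ ch.core X → ∀ 𝒜 ∈ ch.supp X, ∀ n : ℕ,
    F.semi n (F.disp X z 𝒜) ≤ lg.dist n (ch.chart X (F.pt z i) 𝒜) (F.pt z i)

/-- **(F-M) HYPOTHESIS SHAPE — THE MARGIN** (located, typed, not asserted): for every parent `Y` of `X` and every core point `z`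
of the step creating `X`, the CLOSED polydisc `{z + w | semi (scale Y − j) w ≤ gap X Y j, j ≤ scale Y}` lies in the parent's encoded
domain `dom Y` — the space of the creating step (index `scale X`, the smaller) plus the per-layer gaps sits inside the parent's
space (index `scale Y < scale X`, the larger): p. 277 *"we have to use a part of the analyticity domains of terms in 𝐁_k for the
function 𝐇_k. This is the reason for putting the powers of 1/2 in the conditions (2.36)–(2.39). The analyticity domains become
smaller after each step, but the difference is very small and exponentially decreasing in the number of steps."* and the antitone
radius factors of (2.34)–(2.39) (`B14Radii.shrink β m` decreasing in `m`); p. 262's *"newly created expressions 𝐄^{(k)}, 𝐑^{(k)},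
𝐁^{(k)} are defined on slightly larger spaces"* is NOT a support of this shape — it is the within-step enlargement of the new
index-`k` terms after `T`, consumed by 𝐑 (CONTEXT only; cross-read C-adv8-81 D1); the gaps themselves are `GapShape`'s (§12, and
§12e(ii) from the typed radii). [cite: Balaban1988Convergent, (2.34)–(2.39) p.261, p.277] -/
def FrameMargin (F : CplxFrame C A E) (G : Generation C) (ch : FluctChart C A) (gap : C.Dom → C.Dom → ℕ → ℝ) :
    Prop :=
  ∀ (X : C.Dom), ∀ Y ∈ G.parents X, ∀ (z : E) (i : Fin 2), F.pt z i ∈ ch.core X → ∀ w : E,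
    (∀ j ∈ range (C.scale Y + 1), F.semi (C.scale Y - j) w ≤ gap X Y j) → z + w ∈ F.dom Y

/-- **(F-An) HYPOTHESIS SHAPE — print's (2.41)(ii) TYPED** (one run, asserted for nothing of Bałaban's): every admissible table of
the parent `Y`, at every admissible fluctuation value, restricted to the encoded points of `dom Y`, is a real component of ONE
function complex differentiable on `dom Y` — [III] p. 261 (2.41) *"(ii) it has an extension to an analytic function on the space
Ũ^c_j(X, α̃₀, α̃₁)"* (the sup bound (2.42) on that space is `MarginCauchy`'s own binder, not part of this shape).  READING
(cross-read C-adv8-81 I2): the shape takes the table `h` on ALL encoded points of `dom Y`, i.e. `h` is read as ALREADY the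
extension — (2.41)(ii) asserts the existence of an extension of a function of real configurations; in §8's convention the
encoded `BgB` contains the complex configurations —, consistently with `MarginCauchy`'s sup binder over all of `BgB` (= (2.42) on
the complex space). [cite: Balaban1988Convergent, (2.41)–(2.42) p.261] -/
def FrameAnalytic (F : CplxFrame C A E) (W : Set (ℕ → ℝ)) (AdmT : (ℕ → ℝ) → BTable C C.BgB → Prop) : Prop :=
  ∀ g ∈ W, ∀ (h : BTable C C.BgB), AdmT g h → ∀ (Y : C.Dom), ∀ a ∈ C.admFl,
    ∃ hc : E → ℂ, DifferentiableOn ℂ hc (F.dom Y) ∧ ∀ w ∈ F.dom Y, ∀ i : Fin 2, h Y (F.pt w i) a = cpart i (hc w)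

/-- A complex number is bounded by the sum of the moduli of its two components. [folklore] -/
theorem norm_le_abs_cpart_add (w : ℂ) : ‖w‖ ≤ |cpart 0 w| + |cpart 1 w| := by
  simpa [cpart] using Complex.norm_le_abs_re_add_abs_im w

/-- THE ONE-VARIABLE STEP [folklore]: Dimock's difference formula on the circle `|t| = r`, `r ≥ 2`, for a function
complex differentiable on the closed disc and bounded by `M` there, gives `‖ψ 1 − ψ 0‖ ≤ M/(r − 1) ≤ 2M/r`. -/
theorem norm_sub_le_two_mul_div {ψ : ℂ → ℂ} {r M : ℝ} (hr : 2 ≤ r) (hψ : DifferentiableOn ℂ ψ (closedBall 0 r))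
    (hM : ∀ t ∈ closedBall (0 : ℂ) r, ‖ψ t‖ ≤ M) : ‖ψ 1 - ψ 0‖ ≤ 2 * M / r := by
  have hr1 : (1 : ℝ) < r := by linarith
  have h := Dimock2015.norm_sub_le_div_of_bound_sphere hr1 hψ (fun t ht => hM t (sphere_subset_closedBall ht))
  have hM0 : 0 ≤ M := (norm_nonneg _).trans (hM 0 (mem_closedBall_self (by linarith)))
  calc ‖ψ 1 - ψ 0‖ ≤ M / (r - 1) := h
    _ ≤ 2 * M / r := by
        rw [div_le_div_iff₀ (by linarith) (by linarith)]
        nlinarith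

/-- THE LINE STEP [folklore]: if the complex line `t ↦ z + t•v` stays in the domain of a function complex differentiable and
bounded by `M` there whenever `‖t‖·S ≤ 1`, with `0 ≤ S < ½`, then `‖hc (z + v) − hc z‖ ≤ 2·S·M` — for `S = 0` the line is entire
and Liouville's theorem applies, for `S > 0` the one-variable step on the disc of radius `1/S ≥ 2`. -/
theorem line_difference_le {hc : E → ℂ} {dom : Set E} {z v : E} {S M : ℝ} (hS0 : 0 ≤ S) (hS : S < 1 / 2)
    (hmem : ∀ t : ℂ, ‖t‖ * S ≤ 1 → z + t • v ∈ dom) (hdiff : DifferentiableOn ℂ hc dom)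
    (hbound : ∀ w ∈ dom, ‖hc w‖ ≤ M) : ‖hc (z + v) - hc z‖ ≤ 2 * S * M := by
  have hlin : Differentiable ℂ (fun t : ℂ => z + t • v) := by fun_prop
  rcases eq_or_lt_of_le hS0 with h0 | hpos
  · -- zero ratio: the whole line lies in the domain; Liouville
    have hmem' : ∀ t : ℂ, z + t • v ∈ dom := fun t => hmem t (by rw [← h0]; simp)
    have hent : Differentiable ℂ (fun t : ℂ => hc (z + t • v)) := by
      rw [← differentiableOn_univ]
      exact hdiff.comp hlin.differentiableOn fun t _ => hmem' t
    have hbdd : Bornology.IsBounded (Set.range fun t : ℂ => hc (z + t • v)) :=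
      isBounded_iff_forall_norm_le.2 ⟨M, by rintro _ ⟨t, rfl⟩; exact hbound _ (hmem' t)⟩
    have h10 := hent.apply_eq_apply_of_bounded hbdd 1 0
    simp only [one_smul, zero_smul, add_zero] at h10
    rw [h10, sub_self, norm_zero, ← h0]
    simp
  · have hr : 2 ≤ 1 / S := by rw [le_div_iff₀ hpos]; linarith
    have hball : ∀ t ∈ closedBall (0 : ℂ) (1 / S), z + t • v ∈ dom := by
      intro t ht
      rw [mem_closedBall, dist_zero_right] at ht
      refine hmem t ?_
      calc ‖t‖ * S ≤ 1 / S * S := mul_le_mul_of_nonneg_right ht hpos.le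
        _ = 1 := by field_simp
    have hψ : DifferentiableOn ℂ (fun t : ℂ => hc (z + t • v)) (closedBall 0 (1 / S)) :=
      hdiff.comp hlin.differentiableOn hball
    have hstep := norm_sub_le_two_mul_div hr hψ (fun t ht => hbound _ (hball t ht))
    simp only [one_smul, zero_smul, add_zero] at hstep
    calc ‖hc (z + v) - hc z‖ ≤ 2 * M / (1 / S) := hstep
      _ = 2 * S * M := by rw [div_div_eq_mul_div, div_one]; ring

/-- **`MarginCauchy` WITH THE MODULUS `c₀ = 4`, DERIVED FROM THE FRAME** [folklore: Liouville's theorem + Cauchy's estimate on one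
complex line].  Under (F-Ch), (F-Co), (F-G), (F-M), (F-An) and positive gaps: for a parent `Y` of `X`, an admissible table `h` of `Y`
bounded by `D e^{−κ d Y}`, a core point `U = pt z i` of the step creating `X` and an admissible amplitude displacing every layer by at
most HALF its gap, `|fluct| ≤ 4·S·D e^{−κ d Y}` with `S = Σ_{j ≤ scale Y} dist (scale Y − j) (chart U) U / gap X Y j` — print's
(3.17) *"|(3.15)| ≤ (1/r)E₀exp(−κd_j(X))"*, *"Let us stress that it follows only from the fact that 𝐇_j(B(t)) satisfies (3.14) with
1/3α₂, and δ𝐇_j satisfies (3.9)."* ([I] p. 273), on the layer SUM — with one difference of QUANTITY (cross-read C-adv8-81 I1):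
print bounds the `t_□`-DERIVATIVE at `t_□ = 0` (*"The derivative with respect to t_□, at t_□ = 0, can be written as the Cauchy
integral"* (3.15)), the typed step the two-point DIFFERENCE at `t_□ = 1` on the disc of radius `1/S ≥ 2 ∋ 1` (same Cauchy
mechanism, its own constant).  PROOF: by (F-G) and `dist ≤ S·gap` termwise the complex line
`z + t•disp` displaces the layer `scale Y − j` by `≤ ‖t‖·S·gap X Y j ≤ gap X Y j` whenever `‖t‖·S ≤ 1`, so lies in `dom Y` by (F-M);
there the function of (F-An) is bounded by `2·D e^{−κdY}` (both its real components are table values); by (F-Ch) the inserted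
difference is a real component of `hc (z + disp) − hc z`; then `S ≥ ½`: the two-point bound `2·D e^{−κdY} ≤ 4S·D e^{−κdY}`;
`0 ≤ S < ½`: `line_difference_le` (radius `1/S ≥ 2`, Liouville at `S = 0`).  Typed abstractly; asserts nothing of Bałaban's
objects; the instantiation owes the five frame hypotheses, not a modulus. [cite: Balaban1987RG1, (3.15)–(3.17) p.273;
Balaban1988Convergent, (2.41)–(2.42) p.261, p.277] -/
theorem marginCauchy_of_frame {F : CplxFrame C A E} {G : Generation C} {ch : FluctChart C A} {W : Set (ℕ → ℝ)}
    {κ : ℝ} {AdmT : (ℕ → ℝ) → BTable C C.BgB → Prop} {lg : LayerGauge C} {gap : C.Dom → C.Dom → ℕ → ℝ}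
    (hCh : FrameChart F ch) (hCo : FrameCore F ch) (hG : FrameGauge F ch lg) (hM : FrameMargin F G ch gap)
    (hAn : FrameAnalytic F W AdmT)
    (hgap : ∀ (X : C.Dom), ∀ Y ∈ G.parents X, ∀ j ∈ range (C.scale Y + 1), 0 < gap X Y j) :
    MarginCauchy G ch W κ AdmT lg gap 4 := by
  intro g hg h hh X Y hY D hD hsup U hU 𝒜 h𝒜 hhalf a ha
  obtain ⟨z, i, rfl⟩ := hCo X U hU
  obtain ⟨hc, hdiff, hread⟩ := hAn g hg h hh Y a ha
  obtain ⟨S, hS⟩ : ∃ S : ℝ, S = ∑ j ∈ range (C.scale Y + 1),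
      lg.dist (C.scale Y - j) (ch.chart X (F.pt z i) 𝒜) (F.pt z i) / gap X Y j := ⟨_, rfl⟩
  rw [← hS]
  have hM0 : 0 ≤ D * Real.exp (-(κ * C.d Y)) := mul_nonneg hD (Real.exp_pos _).le
  -- each ratio is nonnegative and at most the sum
  have hterm0 : ∀ j ∈ range (C.scale Y + 1),
      0 ≤ lg.dist (C.scale Y - j) (ch.chart X (F.pt z i) 𝒜) (F.pt z i) / gap X Y j :=
    fun j hj => div_nonneg (lg.dist_nonneg _ _ _) (hgap X Y hY j hj).le
  have hS0 : 0 ≤ S := hS ▸ sum_nonneg hterm0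
  have hratio : ∀ j ∈ range (C.scale Y + 1),
      lg.dist (C.scale Y - j) (ch.chart X (F.pt z i) 𝒜) (F.pt z i) ≤ S * gap X Y j := by
    intro j hj
    have h1 : lg.dist (C.scale Y - j) (ch.chart X (F.pt z i) 𝒜) (F.pt z i) / gap X Y j ≤ S :=
      hS ▸ single_le_sum hterm0 hj
    rwa [div_le_iff₀ (hgap X Y hY j hj)] at h1
  -- the complex line `z + t • disp` lies in the encoded domain whenever `‖t‖·S ≤ 1`
  have hmem : ∀ t : ℂ, ‖t‖ * S ≤ 1 → z + t • F.disp X z 𝒜 ∈ F.dom Y := by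
    intro t ht
    refine hM X Y hY z i hU (t • F.disp X z 𝒜) fun j hj => ?_
    rw [map_smul_eq_mul]
    have hsemi : F.semi (C.scale Y - j) (F.disp X z 𝒜) ≤
        lg.dist (C.scale Y - j) (ch.chart X (F.pt z i) 𝒜) (F.pt z i) := hG X z i hU 𝒜 h𝒜 _
    have hgp := hgap X Y hY j hj
    calc ‖t‖ * F.semi (C.scale Y - j) (F.disp X z 𝒜) ≤ ‖t‖ * (S * gap X Y j) :=
          mul_le_mul_of_nonneg_left (hsemi.trans (hratio j hj)) (norm_nonneg _)
      _ = (‖t‖ * S) * gap X Y j := by ring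
      _ ≤ 1 * gap X Y j := mul_le_mul_of_nonneg_right ht hgp.le
      _ = gap X Y j := one_mul _
  -- the sup bound on the encoded domain, read off the two real components
  have hbound : ∀ w ∈ F.dom Y, ‖hc w‖ ≤ 2 * (D * Real.exp (-(κ * C.d Y))) := by
    intro w hw
    have h0 := hsup (F.pt w 0) a ha
    have h1 := hsup (F.pt w 1) a ha
    rw [hread w hw 0] at h0
    rw [hread w hw 1] at h1
    calc ‖hc w‖ ≤ |cpart 0 (hc w)| + |cpart 1 (hc w)| := norm_le_abs_cpart_add _
      _ ≤ D * Real.exp (-(κ * C.d Y)) + D * Real.exp (-(κ * C.d Y)) := add_le_add h0 h1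
      _ = 2 * (D * Real.exp (-(κ * C.d Y))) := by ring
  -- both endpoints lie in the domain (zero displacement; the half-gap precondition)
  have hz : z ∈ F.dom Y := by simpa using hmem 0 (by simp)
  have hzv : z + F.disp X z 𝒜 ∈ F.dom Y := by
    refine hM X Y hY z i hU _ fun j hj => ?_
    have hsemi := hG X z i hU 𝒜 h𝒜 (C.scale Y - j)
    have hh2 := hhalf j hj
    have hgp := hgap X Y hY j hj
    linarith
  -- the inserted difference is a component of the difference of the analytic function along the line
  have hfl : fluct ch h X Y (F.pt z i) 𝒜 a = cpart i (hc (z + F.disp X z 𝒜) - hc z) := by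
    simp only [fluct]
    rw [hCh X z i hU 𝒜 h𝒜, hread _ hzv i, hread _ hz i, cpart_sub]
  have habs : |fluct ch h X Y (F.pt z i) 𝒜 a| ≤ ‖hc (z + F.disp X z 𝒜) - hc z‖ := by
    rw [hfl]; exact abs_cpart_le _ _
  by_cases hShalf : 1 / 2 ≤ S
  · -- large ratio: the trivial two-point bound already carries the factor `4S ≥ 2`
    have h0 := hsup (ch.chart X (F.pt z i) 𝒜) a ha
    have h1 := hsup (F.pt z i) a ha
    have hnn := mul_nonneg hM0 (show (0 : ℝ) ≤ 2 * S - 1 by linarith)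
    calc |fluct ch h X Y (F.pt z i) 𝒜 a| ≤ |h Y (ch.chart X (F.pt z i) 𝒜) a| + |h Y (F.pt z i) a| := by
          unfold fluct; exact abs_sub _ _
      _ ≤ D * Real.exp (-(κ * C.d Y)) + D * Real.exp (-(κ * C.d Y)) := add_le_add h0 h1
      _ ≤ 4 * S * (D * Real.exp (-(κ * C.d Y))) := by nlinarith
  · -- the Cauchy regime (`0 < S < ½`, radius `1/S ≥ 2`) and the Liouville regime (`S = 0`)
    have hShalf : S < 1 / 2 := not_le.mp hShalf
    calc |fluct ch h X Y (F.pt z i) 𝒜 a| ≤ ‖hc (z + F.disp X z 𝒜) - hc z‖ := habs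
      _ ≤ 2 * S * (2 * (D * Real.exp (-(κ * C.d Y)))) := line_difference_le hS0 hShalf hmem hdiff hbound
      _ = 4 * S * (D * Real.exp (-(κ * C.d Y))) := by ring

/-- `FluctDampedOne` with the layered profile FROM THE FRAME [folklore]: `fluctDampedOne_of_collar` with the margin-Cauchy binder
discharged by `marginCauchy_of_frame` (`c₀ = 4`, so `s₀ = 4ε/g₀`). -/
theorem fluctDampedOne_of_frame {F : CplxFrame C A E} {G : Generation C} {ch : FluctChart C A} {W : Set (ℕ → ℝ)} {κ : ℝ}
    {AdmT : (ℕ → ℝ) → BTable C C.BgB → Prop} {lg : LayerGauge C} {gap : C.Dom → C.Dom → ℕ → ℝ} {g₀ ρ ε δ : ℝ}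
    (hCh : FrameChart F ch) (hCo : FrameCore F ch) (hG : FrameGauge F ch lg) (hM : FrameMargin F G ch gap)
    (hAn : FrameAnalytic F W AdmT) (hGap : GapShape G gap g₀ ρ) (hCD : CollarDecay ch lg ε δ)
    (hg₀ : 0 < g₀) (hρ : 0 ≤ ρ) (hε : 0 ≤ ε) (hδ : 0 ≤ δ) (hδ1 : δ ≤ 1) (hδρ : δ * ρ ≤ 1) (h2ε : 2 * ε ≤ g₀) :
    FluctDampedOne G ch W κ AdmT (layeredSigma C (4 * ε / g₀) δ ρ) :=
  fluctDampedOne_of_collar (marginCauchy_of_frame hCh hCo hG hM hAn fun X Y hY j hj => (hGap X Y hY j hj).1) hGap hCD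
    (by norm_num) hg₀ hρ hε hδ hδ1 hδρ h2ε

/-- The two-table form from the frame, by linearity (`fluctDamped_of_one`, §10). [folklore] -/
theorem fluctDamped_of_frame {F : CplxFrame C A E} {G : Generation C} {ch : FluctChart C A} {W : Set (ℕ → ℝ)} {κ : ℝ}
    {Adm : (ℕ → ℝ) → BTable C C.BgB → ETable C C.BgB → Prop} {AdmT : (ℕ → ℝ) → BTable C C.BgB → Prop}
    {lg : LayerGauge C} {gap : C.Dom → C.Dom → ℕ → ℝ} {g₀ ρ ε δ : ℝ}
    (hcl : ∀ g ∈ W, ∀ (f f' : BTable C C.BgB) (e e' : ETable C C.BgB), Adm g f e → Adm g f' e' → AdmT g (f - f'))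
    (hCh : FrameChart F ch) (hCo : FrameCore F ch) (hG : FrameGauge F ch lg) (hM : FrameMargin F G ch gap)
    (hAn : FrameAnalytic F W AdmT) (hGap : GapShape G gap g₀ ρ) (hCD : CollarDecay ch lg ε δ)
    (hg₀ : 0 < g₀) (hρ : 0 ≤ ρ) (hε : 0 ≤ ε) (hδ : 0 ≤ δ) (hδ1 : δ ≤ 1) (hδρ : δ * ρ ≤ 1) (h2ε : 2 * ε ≤ g₀) :
    FluctDamped G ch W κ Adm (layeredSigma C (4 * ε / g₀) δ ρ) :=
  fluctDamped_of_one hcl (fluctDampedOne_of_frame hCh hCo hG hM hAn hGap hCD hg₀ hρ hε hδ hδ1 hδρ h2ε)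

/-- **END-TO-END FROM THE FRAME** [folklore]: `ne5B_of_collar` (§12) with its `MarginCauchy c₀` binder replaced by the five frame
hypotheses (`c₀ = 4`): `RepresentsA/B` + `TiltLip KT` + closure of the admissible class under differences + `FrameChart` +
`FrameCore` + `FrameGauge` + `FrameMargin` + `FrameAnalytic` + `GapShape g₀ ρ` + `CollarDecay ε δ` + `OpDisc` + admissibility of both
runs' tables + `SliceCountGrowing` + `EKernelContracts` + the regular inputs' rate give `NE5B` with the constant
`(Cop + lamE·CE)/(1 − kT·((4ε/g₀)/(1 − δρ))·Mc·(δV/θ)/(1 − δV/θ))`. -/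
theorem ne5B_of_frame {F : CplxFrame C A E} {G : Generation C} {ch : FluctChart C A} {ΦA : GenMap C C.BgA}
    {Φ : GenMap C C.BgB} {BA : BFunctional C C.BgA} {BB : BFunctional C C.BgB}
    {EA : Functional C.toCarriers C.BgA} {EB : Functional C.toCarriers C.BgB} {W : Set (ℕ → ℝ)}
    {Adm : (ℕ → ℝ) → BTable C C.BgB → ETable C C.BgB → Prop} {AdmT : (ℕ → ℝ) → BTable C C.BgB → Prop}
    {lg : LayerGauge C} {gap : C.Dom → C.Dom → ℕ → ℝ}
    {κ θ δ ρ kT g₀ ε Mc V Cop CE lamE : ℝ} {KT : C.Dom → C.Dom → ℝ}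
    (hRA : RepresentsA ΦA BA EA W) (hRB : RepresentsB Φ BB EB W)
    (hT : TiltLip G ch Φ W κ Adm KT)
    (hcl : ∀ g ∈ W, ∀ (f f' : BTable C C.BgB) (e e' : ETable C C.BgB), Adm g f e → Adm g f' e' → AdmT g (f - f'))
    (hCh : FrameChart F ch) (hCo : FrameCore F ch) (hG : FrameGauge F ch lg) (hM : FrameMargin F G ch gap)
    (hAn : FrameAnalytic F W AdmT) (hGap : GapShape G gap g₀ ρ) (hCD : CollarDecay ch lg ε δ)
    (hKT0 : ∀ X Y, 0 ≤ KT X Y) (hKT : ∀ X : C.Dom, ∀ Y ∈ G.parents X, KT X Y ≤ kT)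
    (hOD : OpDisc ΦA Φ BA EA W κ θ Cop)
    (hadmA : ∀ g ∈ W, Adm g (pullB BA g) (epullB EA g)) (hadmB : ∀ g ∈ W, Adm g (tabB BB g) (etabB EB g))
    (hS : SliceCountGrowing G κ (fun _ _ => 1) Mc V)
    (hKE : EKernelContracts G κ θ lamE) (hE : NE5 EA EB W κ θ CE)
    (hθ : 0 < θ) (hg₀ : 0 < g₀) (hρ : 0 ≤ ρ) (hε : 0 ≤ ε) (hδ : 0 ≤ δ) (hδ1 : δ ≤ 1) (hδρ : δ * ρ < 1)
    (h2ε : 2 * ε ≤ g₀) (hV : 0 ≤ V) (hδθ : δ * V < θ) (hkT : 0 ≤ kT) (hMc : 0 ≤ Mc)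
    (hsmall : kT * ((4 * ε / g₀) / (1 - δ * ρ)) * Mc * (δ * V / θ) / (1 - δ * V / θ) < 1)
    (hCop : 0 ≤ Cop) (hCE : 0 ≤ CE) (hlamE : 0 ≤ lamE) :
    NE5B BA BB W κ θ
      ((Cop + lamE * CE) / (1 - kT * ((4 * ε / g₀) / (1 - δ * ρ)) * Mc * (δ * V / θ) / (1 - δ * V / θ))) :=
  ne5B_of_collar hRA hRB hT hcl (marginCauchy_of_frame hCh hCo hG hM hAn fun X Y hY j hj => (hGap X Y hY j hj).1)
    hGap hCD hKT0 hKT hOD hadmA hadmB hS hKE hE hθ (by norm_num) hg₀ hρ hε hδ hδ1 hδρ h2ε hV hδθ hkT hMc hsmall hCop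
    hCE hlamE

end Frame

/-! #### §12e(ii) The displayed gap profile from the printed radius factors -/

/-- **`GapShape` FROM THE PRINTED RADIUS FACTORS** [folklore arithmetic on the typed radii of `B14Radii`, pv02]: with the factor
`shrink β m = 1 − β(1 − 2^{−m})` of (2.34)–(2.37), (2.39) p. 261 (`m` = space index minus layer index), the margin on the parent's
layer `scale Y − j` between the parent's space (index `scale Y`) and the space of the step creating `X` (index `scale X`) is
`a·(shrink β j − shrink β (scale X − scale Y + j))·α = a·β·2^{−j}·(1 − 2^{−(scale X − scale Y)})·α ≥ a·β·α·2^{−(j+1)}` for a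
coefficient `α` CONSTANT ACROSS LAYERS (`a` = the overall coefficient, `1` in (2.34) or `1 + β` in (3.43)): `GapShape` with
`g₀ = aβα/2` and the ratio `ρ = 2`.  The slow layer variation of the printed `α_{·,n}` ((2.8)–(2.9) p. 256) is NOT modelled — it
multiplies `ρ`. [cite: Balaban1988Convergent, (2.34)–(2.39) p.261] -/
theorem gapShape_of_shrink (G : Generation C) {a β α : ℝ} (ha : 0 < a) (hβ : 0 < β) (hα : 0 < α) :
    GapShape G (fun X Y j => a * (B14Radii.shrink β j - B14Radii.shrink β (C.scale X - C.scale Y + j)) * α)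
      (a * β * α / 2) 2 := by
  intro X Y hY j _
  have hm : 1 ≤ C.scale X - C.scale Y := by have := G.parents_lt X Y hY; omega
  have hdiff : B14Radii.shrink β j - B14Radii.shrink β (C.scale X - C.scale Y + j) =
      β * (1 / 2 : ℝ) ^ j * (1 - (1 / 2 : ℝ) ^ (C.scale X - C.scale Y)) := by
    unfold B14Radii.shrink; rw [pow_add]; ring
  have hq : (1 / 2 : ℝ) ^ (C.scale X - C.scale Y) ≤ 1 / 2 := by
    calc (1 / 2 : ℝ) ^ (C.scale X - C.scale Y) ≤ (1 / 2 : ℝ) ^ 1 := pow_le_pow_of_le_one (by norm_num) (by norm_num) hm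
      _ = 1 / 2 := pow_one _
  have hpos : 0 < 1 - (1 / 2 : ℝ) ^ (C.scale X - C.scale Y) := by linarith
  have h2j : (1 / 2 : ℝ) ^ j * 2 ^ j = 1 := by rw [← mul_pow]; norm_num
  refine ⟨?_, ?_⟩
  · show 0 < a * (B14Radii.shrink β j - B14Radii.shrink β (C.scale X - C.scale Y + j)) * α
    rw [hdiff]
    exact mul_pos (mul_pos ha (mul_pos (mul_pos hβ (pow_pos (by norm_num) _)) hpos)) hα
  · show a * β * α / 2 ≤ a * (B14Radii.shrink β j - B14Radii.shrink β (C.scale X - C.scale Y + j)) * α * 2 ^ j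
    rw [hdiff]
    calc a * β * α / 2 = a * β * α * (1 / 2) := by ring
      _ ≤ a * β * α * (1 - (1 / 2 : ℝ) ^ (C.scale X - C.scale Y)) :=
          mul_le_mul_of_nonneg_left (by linarith) (by positivity)
      _ = a * β * α * (1 - (1 / 2 : ℝ) ^ (C.scale X - C.scale Y)) * ((1 / 2 : ℝ) ^ j * 2 ^ j) := by rw [h2j, mul_one]
      _ = a * (β * (1 / 2 : ℝ) ^ j * (1 - (1 / 2 : ℝ) ^ (C.scale X - C.scale Y))) * α * 2 ^ j := by ring

/-! #### §12e(iii) The §12c toy is a frame -/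

/-- The frame of the displacement toy of §10b/§12c [folklore]: `E = ℂ`, every layer seminorm the modulus, encoded points `(z, i)`,
displacement vector `𝒜`, encoded domain the disc of radius `ρ + r`. -/
noncomputable def shiftFrame (ρ r : ℝ) : CplxFrame cauchyCarriers ℂ ℂ where
  semi := fun _ => normSeminorm ℂ ℂ
  pt := fun z i => (z, i)
  disp := fun _ _ 𝒜 => 𝒜
  dom := fun _ => ball 0 (ρ + r)

/-- The toy chart is the frame translation. [folklore] -/
theorem shift_frameChart (ρ r s : ℝ) : FrameChart (shiftFrame ρ r) (shiftChart ρ s) := fun _ _ _ _ _ _ => rfl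

/-- Every toy background is an encoded point. [folklore] -/
theorem shift_frameCore (ρ r s : ℝ) : FrameCore (shiftFrame ρ r) (shiftChart ρ s) := fun _ U _ => ⟨U.1, U.2, rfl⟩

/-- The toy gauge reads exactly the modulus of the displacement. [folklore] -/
theorem shift_frameGauge (ρ r s : ℝ) : FrameGauge (shiftFrame ρ r) (shiftChart ρ s) shiftGauge := by
  intro X z i _ 𝒜 _ n
  simp [shiftFrame, shiftChart, shiftGauge]

/-- The closed disc of radius `r` about a core point `‖z‖ < ρ` lies in the disc of radius `ρ + r`. [folklore] -/
theorem shift_frameMargin (ρ r s : ℝ) (hr : 0 < r) :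
    FrameMargin (shiftFrame ρ r) (cauchyGeneration r hr) (shiftChart ρ s) (fun _ _ _ => r) := by
  intro X Y _ z i hz w hw
  have h0 : ‖w‖ ≤ r := by simpa [shiftFrame] using hw 0 (by simp)
  have hz' : ‖z‖ < ρ := hz
  show z + w ∈ ball (0 : ℂ) (ρ + r)
  rw [mem_ball, dist_zero_right]
  calc ‖z + w‖ ≤ ‖z‖ + ‖w‖ := norm_add_le _ _
    _ < ρ + r := by linarith

/-- The toy's admissible tables are read off their complexifications. [folklore] -/
theorem shift_frameAnalytic (ρ r : ℝ) (W : Set (ℕ → ℝ)) : FrameAnalytic (shiftFrame ρ r) W (CauchyAdmT ρ r) := by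
  intro g _ h hh Y a _
  exact ⟨cplx h Y a, hh Y a, fun w _ i => (cpart_cplx h Y a w i).symm⟩

/-- CONSISTENCY [folklore]: the frame route gives back LITERALLY the statement of §12c's `cauchy_marginCauchy` (`c₀ = 4`, constant
gap `r`) — now a one-line instance of `marginCauchy_of_frame`. -/
theorem cauchy_marginCauchy_of_frame (ρ r s : ℝ) (hr : 0 < r) (W : Set (ℕ → ℝ)) (κ : ℝ) :
    MarginCauchy (cauchyGeneration r hr) (shiftChart ρ s) W κ (CauchyAdmT ρ r) shiftGauge (fun _ _ _ => r) 4 :=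
  marginCauchy_of_frame (shift_frameChart ρ r s) (shift_frameCore ρ r s) (shift_frameGauge ρ r s)
    (shift_frameMargin ρ r s hr) (shift_frameAnalytic ρ r W) fun _ _ _ _ _ => hr

/-- CONSISTENCY [folklore]: §12c's `cauchy_fluctDampedOne_of_collar` (profile `layeredSigma (4s/r) 1 1`, displacements `2s ≤ r`)
through the frame corollary `fluctDampedOne_of_frame`. -/
theorem cauchy_fluctDampedOne_of_frame (ρ r s : ℝ) (hr : 0 < r) (hs : 0 ≤ s) (hsr : 2 * s ≤ r) (W : Set (ℕ → ℝ)) (κ : ℝ) :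
    FluctDampedOne (cauchyGeneration r hr) (shiftChart ρ s) W κ (CauchyAdmT ρ r)
      (layeredSigma cauchyCarriers (4 * s / r) 1 1) :=
  fluctDampedOne_of_frame (shift_frameChart ρ r s) (shift_frameCore ρ r s) (shift_frameGauge ρ r s)
    (shift_frameMargin ρ r s hr) (shift_frameAnalytic ρ r W) (cauchy_gapShape r hr) (cauchy_collarDecay ρ s) hr zero_le_one hs
    zero_le_one le_rfl (by norm_num) hsr

/-! ### §12f THE PATH FRAME: print's outer interpolation device typed; the margin-Cauchy modulus `c₀ = 2`

[I] = [Balaban1987RG1] bounds ONE boundary term's fluctuation by a TWO-LEVEL device (pp. 270–273, renders p022–p025 read as images):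
the OUTER real interpolation (3.4) p. 270 — *"= ∫₀¹ dt (d/dt) 𝐄^{(j)}(U_j(exp iQ_j(ηt𝐇_k(B′))Ū^j_{k+1}))"* … *"= Σ_□ ∫₀¹ dt (d/dt_□)
𝐄^{(j)}(U_j(exp iQ_j(η(t + t_□ζ_□)𝐇_k(B′))Ū^j_{k+1}))|_{t_□=0}"*, p. 271 *"denoting Q_j(η(t + t_□ζ_□)𝐇_k(B′)) = B_□, Q_j(ηt𝐇_k(B′)) =
B(t)"* — and the INNER complex one at each `t`: p. 273 *"To get an analytic extension of (3.7) we substitute 𝐀 = 𝐇_j(B(t)) +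
t_□⟨…⟩"*, *"The derivative with respect to t_□, at t_□ = 0, can be written as the Cauchy integral"* (3.15), radius by *"r max{|δ𝐇_j|_X,
|P₁δ𝐇_j|_X, |∇^ξ_𝐔δ𝐇_j|_X, |Δ^ξ_𝐔δ𝐇_j|_X} = ⅓α₂"*, *"We assume also that ε₁ is so small that 𝐇_j(B(t)) satisfies (3.14) with 1/3α₂ on
the right-hand side"*, (3.17) *"|(3.15)| ≤ (1/r)E₀exp(−κd_j(X))"*, *"Let us stress that it follows only from the fact that 𝐇_j(B(t))
satisfies (3.14) with 1/3α₂, and δ𝐇_j satisfies (3.9)."*; the velocity `δ𝐇_j` of (3.8) obeys, p. 271, *"In the case when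
dist^{(ξ)}(X, □) ≥ M(Lʲη)^{−1}, this function satisfies the bound"* (3.9) *"|δ𝐇_j| ≤ B₃ exp(−½δ₀ dist^{(ξ)}(X, □) − ½δ₀M(Lʲη)^{−1})
× 2Lʲη|ζ_□𝐇_k(B′)| on X,"* … *"and the same for derivatives and the second order operators applied to it"* — a CONDITIONAL display,
holding in the first of p. 271's two cases (*"There are two cases possible, either X∩□̃ = ∅, or X∩□̃ ≠ ∅."* … *"In the second case X
is a big domain in ξ-scale"*); for the second, p. 273 says *"The only difference is that we do not have the exponential factors in (3.9),
(3.17) connected with the decay rate of the functional derivative (δ/δB)𝐇_j."* (v1.4.1, G-t4r2-93 / C-pv19g11-1 D-1).  §12e typed the inner level for an AFFINE chart (difference at `t_□ = 1` on one disc,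
`c₀ = 4`, C-adv8-81 I1).  This section types BOTH levels: the hypothesis shape (F-P) `FramePath` posits a differentiable path of
MARGIN POINTS (`marginPts`: the closed gap-polydisc about the point lies in every parent's encoded domain — print's *"satisfies (3.14)
with 1/3α₂"* leaving the circles' third) from the encoded core point to the displaced point, with velocity dominated layer-wise by
the layer gauge; then Cauchy's estimate for the directional derivative at EVERY path point (`norm_fderivWithin_apply_le`, modulus
exactly print's `1/r`) and the mean value inequality on `[0,1]` (`path_difference_le`) give `MarginCauchy` with `c₀ = 2`
(`marginCauchy_of_pathFrame`; the `2` is §8's Re/Im reading convention alone), END-TO-END `ne5B_of_pathFrame`.  The chart need not be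
affine (print's `exp iQ_j(ηt𝐇_k(B′))Ū` is not, in any encoding); the affine frame is the straight-path case
(`framePath_of_segment`), and the §12c toy is a path frame exhibiting print's margin split (§12f(ii)).  SCOPE, honest as typed: every
shape is over the POSITED encoding `CplxFrame` and asserts nothing of Bałaban's objects; an instantiation on print's spaces
(2.34)–(2.39) owes (F-Ch), (F-Co), (F-An) as in §12e and (F-P) — the path kept in the space (print ASSUMES `ε₁` small for it,
p. 273) with the velocity bound (3.9) (DISPLAYED one run, in the first of p. 271's two cases; derived in print, by reference, from the decay of
the FUNCTIONAL DERIVATIVE `(δ/δB)𝐇_j` — p. 271 *"The derivative (δ/δB)𝐇_j is an exponentially decaying function, with the decay rate δ₀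
on the ξ-scale, see Proposition 9, (190) [15]."* — the function `𝐇_k(B′)` entering (3.9) only through the source factor
`2Lʲη|ζ_□𝐇_k(B′)|`; v1.4.1, C-pv19g11-1 D-2) —;
NOT PRINTED stay the per-collar `CollarDecay` for the non-linear `𝐇_k` and the boundary terms' arguments, `W`, and every two-run
form (`TiltLip`, `OpDisc`, both runs' admissibility, `NE5B`).  Cell record `t4/T4-EST-U3-NE5B-P3.md` §12. -/

section PathFrame

variable {A : Type} {E : Type*} [NormedAddCommGroup E] [NormedSpace ℂ E]

/-- MARGIN POINTS of the step creating `X` [bookkeeping]: the encoded points `z` about which the CLOSED gap-polydisc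
`{z + w | semi (scale Y − j) w ≤ gap X Y j, j ≤ scale Y}` lies in the encoded domain of EVERY parent `Y` of `X` — the set (F-M)
speaks about (print: the configurations satisfying (3.14) p. 272 with `⅓α₂`, about which the `t_□`-circles of p. 273 still lie in
the space). [folklore] [cite: Balaban1987RG1, (3.14) p.272, p.273] -/
def marginPts (F : CplxFrame C A E) (G : Generation C) (gap : C.Dom → C.Dom → ℕ → ℝ) (X : C.Dom) : Set E :=
  {z | ∀ Y ∈ G.parents X, ∀ w : E, (∀ j ∈ range (C.scale Y + 1), F.semi (C.scale Y - j) w ≤ gap X Y j) →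
    z + w ∈ F.dom Y}

/-- (F-M) says exactly: every core-encoded point is a margin point. [folklore] -/
theorem frameMargin_iff_marginPts (F : CplxFrame C A E) (G : Generation C) (ch : FluctChart C A)
    (gap : C.Dom → C.Dom → ℕ → ℝ) :
    FrameMargin F G ch gap ↔
      ∀ (X : C.Dom) (z : E) (i : Fin 2), F.pt z i ∈ ch.core X → z ∈ marginPts F G gap X :=
  ⟨fun h X z i hz Y hY w hw => h X Y hY z i hz w hw, fun h X Y hY z i hz w hw => h X z i hz Y hY w hw⟩

/-- A margin point lies in every parent's encoded domain (zero displacement, nonnegative gaps). [folklore] -/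
theorem mem_dom_of_mem_marginPts {F : CplxFrame C A E} {G : Generation C} {gap : C.Dom → C.Dom → ℕ → ℝ}
    {X : C.Dom} {z : E} (hz : z ∈ marginPts F G gap X)
    (hgap : ∀ Y ∈ G.parents X, ∀ j ∈ range (C.scale Y + 1), 0 ≤ gap X Y j) :
    ∀ Y ∈ G.parents X, z ∈ F.dom Y := by
  intro Y hY
  simpa using hz Y hY 0 (fun j hj => by rw [map_zero]; exact hgap Y hY j hj)

/-- **(F-P) HYPOTHESIS SHAPE — THE REAL INTERPOLATION PATH** (print's OUTER device typed; asserted for nothing of Bałaban's):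
for every core-encoded point `z` of the step creating `X` and every admissible amplitude `𝒜` there is a path `γ : [0,1] → E`
from `z` to the displaced point `z + disp X z 𝒜`, differentiable on `[0,1]` with velocity `γ′`, consisting of MARGIN POINTS, whose
velocity has layer seminorms dominated by the layer gauge of the displacement.  Print: [I] p. 270 (3.4)
*"= ∫₀¹ dt (d/dt) 𝐄^{(j)}(U_j(exp iQ_j(ηt𝐇_k(B′))Ū^j_{k+1}))"* … *"= Σ_□ ∫₀¹ dt (d/dt_□) 𝐄^{(j)}(U_j(exp iQ_j(η(t + t_□ζ_□)𝐇_k(B′))Ū^j_{k+1}))|_{t_□=0}"*,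
p. 271 *"denoting Q_j(η(t + t_□ζ_□)𝐇_k(B′)) = B_□, Q_j(ηt𝐇_k(B′)) = B(t)"* and (3.7), p. 273 *"To get an analytic extension of (3.7)
we substitute 𝐀 = 𝐇_j(B(t)) + t_□⟨…⟩"*; the path stays in the space: p. 273 *"We assume also that ε₁ is so small that 𝐇_j(B(t))
satisfies (3.14) with 1/3α₂ on the right-hand side."*; the velocity is print's `δ𝐇_j` of (3.8), bounded — p. 271 *"In the case
when dist^{(ξ)}(X, □) ≥ M(Lʲη)^{−1}"* — by (3.9) *"|δ𝐇_j| ≤ B₃ exp(−½δ₀ dist^{(ξ)}(X, □) − ½δ₀M(Lʲη)^{−1}) × 2Lʲη|ζ_□𝐇_k(B′)| on X,"*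
(without the exponential factors in the second of p. 271's two cases, a big domain `X`, p. 273; the typed velocity clause below is
a general binder and never uses the exponential factor).  The path is NOT affine (print's `exp iQ_j(ηt𝐇_k(B′))Ū`),
which is what this shape adds to (F-Ch)/(F-G)/(F-M). [cite: Balaban1987RG1, (3.4) p.270, (3.7)–(3.9) p.271, (3.14)–(3.17) p.272–273] -/
def FramePath (F : CplxFrame C A E) (G : Generation C) (ch : FluctChart C A) (lg : LayerGauge C)
    (gap : C.Dom → C.Dom → ℕ → ℝ) : Prop :=
  ∀ (X : C.Dom) (z : E) (i : Fin 2), F.pt z i ∈ ch.core X → ∀ 𝒜 ∈ ch.supp X,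
    ∃ γ γ' : ℝ → E, γ 0 = z ∧ γ 1 = z + F.disp X z 𝒜 ∧
      (∀ t ∈ Set.Icc (0 : ℝ) 1, HasDerivWithinAt γ (γ' t) (Set.Icc (0 : ℝ) 1) t) ∧
      (∀ t ∈ Set.Icc (0 : ℝ) 1, γ t ∈ marginPts F G gap X) ∧
      (∀ t ∈ Set.Icc (0 : ℝ) 1, ∀ n : ℕ, F.semi n (γ' t) ≤ lg.dist n (ch.chart X (F.pt z i) 𝒜) (F.pt z i))

/-- **CAUCHY'S ESTIMATE FOR THE DIRECTIONAL DERIVATIVE** [folklore; Mathlib `Complex.norm_deriv_le_of_forall_mem_sphere_norm_le`]: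
if the closed complex disc `{p + s•v | ‖s‖ ≤ R}` lies in the domain of a function complex differentiable and bounded by `M` there,
the derivative at `p` in the direction `v` has norm `≤ M/R` — print's (3.15)/(3.17): *"The derivative with respect to t_□, at
t_□ = 0, can be written as the Cauchy integral (1/2πi)∫_{|t_□|=r} dt_□ (1/t_□²)𝐄^{(j)}(X,…,…)"*, *"|(3.15)| ≤ (1/r)E₀exp(−κd_j(X))"*,
modulus exactly `1/r`. [cite: Balaban1987RG1, (3.15)–(3.17) p.273] -/
theorem norm_fderivWithin_apply_le {hc : E → ℂ} {dom : Set E} {p v : E} {R M : ℝ} (hR : 0 < R)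
    (hmem : ∀ s : ℂ, ‖s‖ ≤ R → p + s • v ∈ dom) (hdiff : DifferentiableOn ℂ hc dom)
    (hbound : ∀ w ∈ dom, ‖hc w‖ ≤ M) : ‖fderivWithin ℂ hc dom p v‖ ≤ M / R := by
  have hp : p ∈ dom := by simpa using hmem 0 (by simpa using hR.le)
  have hline : ∀ s : ℂ, HasDerivAt (fun s : ℂ => p + s • v) v s := fun s => by
    simpa using ((hasDerivAt_id s).smul_const v).const_add p
  have hmaps : Set.MapsTo (fun s : ℂ => p + s • v) (closedBall (0 : ℂ) R) dom := fun s hs =>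
    hmem s (by simpa using hs)
  have hψ : DifferentiableOn ℂ (fun s : ℂ => hc (p + s • v)) (closedBall 0 R) :=
    hdiff.comp (fun s _ => (hline s).differentiableAt.differentiableWithinAt) hmaps
  have hψ0 : HasDerivAt (fun s : ℂ => hc (p + s • v)) (fderivWithin ℂ hc dom p v) 0 := by
    have hl : HasFDerivWithinAt hc (fderivWithin ℂ hc dom p) dom (p + (0 : ℂ) • v) := by
      simpa using (hdiff p hp).hasFDerivWithinAt
    exact (hl.comp_hasDerivWithinAt (0 : ℂ) (hline 0).hasDerivWithinAt hmaps).hasDerivAt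
      (closedBall_mem_nhds _ hR)
  rw [← hψ0.deriv]
  exact Complex.norm_deriv_le_of_forall_mem_sphere_norm_le hR (hψ.diffContOnCl_ball le_rfl)
    fun s hs => hbound _ (hmaps (sphere_subset_closedBall hs))

/-- Radius bookkeeping [folklore]: a quantity at most `M/R` for every radius `R > 0` with `R·S ≤ 1` is at most `S·M`
(`R = 1/S` for `S > 0`; `R → ∞` for `S = 0`). -/
theorem le_mul_of_forall_radius {x S M : ℝ} (hS : 0 ≤ S) (hM : 0 ≤ M)
    (h : ∀ R : ℝ, 0 < R → R * S ≤ 1 → x ≤ M / R) : x ≤ S * M := by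
  rcases hS.eq_or_lt with h0 | hpos
  · rw [← h0, zero_mul]
    by_contra hx'
    have hx : 0 < x := not_le.mp hx'
    have h1 := h (M / x + 1) (by positivity) (by rw [← h0]; simp)
    rw [le_div_iff₀ (by positivity)] at h1
    have h2 : x * (M / x + 1) = M + x := by field_simp
    linarith
  · have h1 := h (1 / S) (by positivity) (by rw [one_div, inv_mul_cancel₀ hpos.ne'])
    rw [div_div_eq_mul_div, div_one] at h1
    linarith [mul_comm S M]

/-- **(3.17) TYPED — THE VELOCITY DERIVATIVE** [folklore]: if the closed complex disc `{p + s•v | ‖s‖·S ≤ 1}` (radius `1/S` in the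
direction `v`; all of the line if `S = 0`) lies in the domain of a function complex differentiable and bounded by `M` there, the
derivative at `p` in the direction `v` has norm `≤ S·M` — print's *"|(3.15)| ≤ (1/r)E₀exp(−κd_j(X))"* with `r = 1/S`, the
`t_□`-derivative at `t_□ = 0` of p. 270 (3.4) being this directional derivative (velocity `v = δ𝐇_j`-direction, (3.8)). [cite:
Balaban1987RG1, (3.4) p.270, (3.8) p.271, (3.15)–(3.17) p.273] -/
theorem norm_fderivWithin_velocity_le {hc : E → ℂ} {dom : Set E} {p v : E} {S M : ℝ} (hS0 : 0 ≤ S) (hM : 0 ≤ M)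
    (hmem : ∀ s : ℂ, ‖s‖ * S ≤ 1 → p + s • v ∈ dom) (hdiff : DifferentiableOn ℂ hc dom)
    (hbound : ∀ w ∈ dom, ‖hc w‖ ≤ M) : ‖fderivWithin ℂ hc dom p v‖ ≤ S * M :=
  le_mul_of_forall_radius hS0 hM fun _ hR hRS =>
    norm_fderivWithin_apply_le hR (fun s hs => hmem s ((mul_le_mul_of_nonneg_right hs hS0).trans hRS)) hdiff hbound

/-- **THE PATH STEP** [folklore: the mean value inequality on `[0,1]` (Mathlib `norm_image_sub_le_of_norm_deriv_le_segment_01'`)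
over Cauchy's estimate for the directional derivative at every point of the path]: if along a path `γ` on `[0,1]` with velocity
`γ′` the closed complex discs `{γ t + s•γ′ t | ‖s‖·S ≤ 1}` lie in the domain of a function complex differentiable and bounded by
`M` there, then `‖hc (γ 1) − hc (γ 0)‖ ≤ S·M` — print's outer `∫₀¹ dt` of (3.4) p. 270 over (3.17) p. 273 at each `t`, modulus `1`. -/
theorem path_difference_le {hc : E → ℂ} {dom : Set E} {γ γ' : ℝ → E} {S M : ℝ} (hS0 : 0 ≤ S)
    (hγ : ∀ t ∈ Set.Icc (0 : ℝ) 1, HasDerivWithinAt γ (γ' t) (Set.Icc (0 : ℝ) 1) t)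
    (hmem : ∀ t ∈ Set.Icc (0 : ℝ) 1, ∀ s : ℂ, ‖s‖ * S ≤ 1 → γ t + s • γ' t ∈ dom)
    (hdiff : DifferentiableOn ℂ hc dom) (hbound : ∀ w ∈ dom, ‖hc w‖ ≤ M) :
    ‖hc (γ 1) - hc (γ 0)‖ ≤ S * M := by
  have hγdom : ∀ t ∈ Set.Icc (0 : ℝ) 1, γ t ∈ dom := fun t ht => by simpa using hmem t ht 0 (by simp)
  have hM : 0 ≤ M := (norm_nonneg _).trans (hbound _ (hγdom 0 (Set.left_mem_Icc.2 zero_le_one)))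
  have hderiv : ∀ t ∈ Set.Icc (0 : ℝ) 1,
      HasDerivWithinAt (hc ∘ γ) ((fderivWithin ℂ hc dom (γ t)).restrictScalars ℝ (γ' t)) (Set.Icc (0 : ℝ) 1) t := by
    intro t ht
    have hl : HasFDerivWithinAt hc ((fderivWithin ℂ hc dom (γ t)).restrictScalars ℝ) dom (γ t) :=
      ((hdiff (γ t) (hγdom t ht)).hasFDerivWithinAt).restrictScalars ℝ
    exact hl.comp_hasDerivWithinAt t (hγ t ht) (fun t' ht' => hγdom t' ht')
  have hbd : ∀ t ∈ Set.Ico (0 : ℝ) 1, ‖(fderivWithin ℂ hc dom (γ t)).restrictScalars ℝ (γ' t)‖ ≤ S * M := by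
    intro t ht
    have ht' : t ∈ Set.Icc (0 : ℝ) 1 := Set.Ico_subset_Icc_self ht
    show ‖fderivWithin ℂ hc dom (γ t) (γ' t)‖ ≤ S * M
    exact norm_fderivWithin_velocity_le hS0 hM (hmem t ht') hdiff hbound
  simpa using norm_image_sub_le_of_norm_deriv_le_segment_01' hderiv hbd

/-- **`MarginCauchy` WITH THE MODULUS `c₀ = 2`, DERIVED FROM THE PATH FRAME** [folklore: Cauchy's estimate for the first
derivative on one complex line at every point of a real path + the mean value inequality — print's two-level device of [I]
pp. 270–273 ((3.4): outer `∫₀¹dt`, inner `d/dt_□` at `t_□ = 0`; (3.15)–(3.17)) typed].  Under (F-Ch), (F-Co), (F-P), (F-An) and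
positive gaps: for a parent `Y` of `X`, an admissible table `h` of `Y` bounded by `D e^{−κ d Y}`, a core point `U = pt z i` of
the step creating `X` and an admissible amplitude, `|fluct| ≤ 2·S·D e^{−κ d Y}` with `S = Σ_{j ≤ scale Y} dist (scale Y − j)
(chart U) U / gap X Y j`: at every path point the complex line in the direction of the velocity displaces the layer `scale Y − j` by
`≤ ‖s‖·S·gap X Y j ≤ gap X Y j` for `‖s‖ ≤ 1/S`, so lies in `dom Y` (margin point); there the function of (F-An) is bounded by
`2·D e^{−κdY}` (both real components are table values); Cauchy's estimate gives the `t`-derivative of `hc ∘ γ` the bound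
`2·D e^{−κdY}·S` (modulus EXACTLY print's `1/r`, `r = 1/S`), the mean value inequality integrates it over `[0,1]`, and by (F-Ch)
the inserted difference is a real component of `hc (γ 1) − hc (γ 0)`.  The `2` is the Re/Im reading convention of §8 alone; the
half-gap precondition of `MarginCauchy` is not even used (the path's margin points carry the endpoints).  Compared with §12e's
affine frame (`c₀ = 4`, regimes `S < ½` / `S ≥ ½`, two-point difference on one disc): no regime split, no factor `1/(r − 1)`,
and a NON-affine chart is covered — (3.7)'s outer integral is no longer owed at instantiation; owed instead is (F-P) on print's
path `B(t)`.  Typed abstractly; asserts nothing of Bałaban's objects. [cite: Balaban1987RG1, (3.4) p.270, (3.7)–(3.9) p.271,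
(3.14)–(3.17) p.272–273; Balaban1988Convergent, (2.41)–(2.42) p.261, p.277] -/
theorem marginCauchy_of_pathFrame {F : CplxFrame C A E} {G : Generation C} {ch : FluctChart C A} {W : Set (ℕ → ℝ)}
    {κ : ℝ} {AdmT : (ℕ → ℝ) → BTable C C.BgB → Prop} {lg : LayerGauge C} {gap : C.Dom → C.Dom → ℕ → ℝ}
    (hCh : FrameChart F ch) (hCo : FrameCore F ch) (hP : FramePath F G ch lg gap) (hAn : FrameAnalytic F W AdmT)
    (hgap : ∀ (X : C.Dom), ∀ Y ∈ G.parents X, ∀ j ∈ range (C.scale Y + 1), 0 < gap X Y j) :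
    MarginCauchy G ch W κ AdmT lg gap 2 := by
  intro g hg h hh X Y hY D hD hsup U hU 𝒜 h𝒜 _ a ha
  obtain ⟨z, i, rfl⟩ := hCo X U hU
  obtain ⟨hc, hdiff, hread⟩ := hAn g hg h hh Y a ha
  obtain ⟨γ, γ', hγ0, hγ1, hγd, hγm, hγv⟩ := hP X z i hU 𝒜 h𝒜
  obtain ⟨S, hS⟩ : ∃ S : ℝ, S = ∑ j ∈ range (C.scale Y + 1),
      lg.dist (C.scale Y - j) (ch.chart X (F.pt z i) 𝒜) (F.pt z i) / gap X Y j := ⟨_, rfl⟩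
  rw [← hS]
  have hterm0 : ∀ j ∈ range (C.scale Y + 1),
      0 ≤ lg.dist (C.scale Y - j) (ch.chart X (F.pt z i) 𝒜) (F.pt z i) / gap X Y j :=
    fun j hj => div_nonneg (lg.dist_nonneg _ _ _) (hgap X Y hY j hj).le
  have hS0 : 0 ≤ S := hS ▸ sum_nonneg hterm0
  have hratio : ∀ j ∈ range (C.scale Y + 1),
      lg.dist (C.scale Y - j) (ch.chart X (F.pt z i) 𝒜) (F.pt z i) ≤ S * gap X Y j := by
    intro j hj
    have h1 : lg.dist (C.scale Y - j) (ch.chart X (F.pt z i) 𝒜) (F.pt z i) / gap X Y j ≤ S :=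
      hS ▸ single_le_sum hterm0 hj
    rwa [div_le_iff₀ (hgap X Y hY j hj)] at h1
  -- the complex line through every path point in the direction of the velocity stays in the encoded domain
  have hmem : ∀ t ∈ Set.Icc (0 : ℝ) 1, ∀ s : ℂ, ‖s‖ * S ≤ 1 → γ t + s • γ' t ∈ F.dom Y := by
    intro t ht s hs
    refine hγm t ht Y hY (s • γ' t) fun j hj => ?_
    rw [map_smul_eq_mul]
    have hgp := hgap X Y hY j hj
    calc ‖s‖ * F.semi (C.scale Y - j) (γ' t) ≤ ‖s‖ * (S * gap X Y j) :=
          mul_le_mul_of_nonneg_left ((hγv t ht _).trans (hratio j hj)) (norm_nonneg _)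
      _ = (‖s‖ * S) * gap X Y j := by ring
      _ ≤ 1 * gap X Y j := mul_le_mul_of_nonneg_right hs hgp.le
      _ = gap X Y j := one_mul _
  -- the sup bound on the encoded domain, read off the two real components
  have hbound : ∀ w ∈ F.dom Y, ‖hc w‖ ≤ 2 * (D * Real.exp (-(κ * C.d Y))) := by
    intro w hw
    have h0 := hsup (F.pt w 0) a ha
    have h1 := hsup (F.pt w 1) a ha
    rw [hread w hw 0] at h0
    rw [hread w hw 1] at h1
    calc ‖hc w‖ ≤ |cpart 0 (hc w)| + |cpart 1 (hc w)| := norm_le_abs_cpart_add _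
      _ ≤ D * Real.exp (-(κ * C.d Y)) + D * Real.exp (-(κ * C.d Y)) := add_le_add h0 h1
      _ = 2 * (D * Real.exp (-(κ * C.d Y))) := by ring
  -- the endpoints lie in the domain (they are path points)
  have hz : z ∈ F.dom Y := by
    simpa [hγ0] using hmem 0 (Set.left_mem_Icc.2 zero_le_one) 0 (by simp)
  have hzv : z + F.disp X z 𝒜 ∈ F.dom Y := by
    simpa [hγ1] using hmem 1 (Set.right_mem_Icc.2 zero_le_one) 0 (by simp)
  have hfl : fluct ch h X Y (F.pt z i) 𝒜 a = cpart i (hc (γ 1) - hc (γ 0)) := by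
    simp only [fluct]
    rw [hCh X z i hU 𝒜 h𝒜, hread _ hzv i, hread _ hz i, cpart_sub, hγ1, hγ0]
  calc |fluct ch h X Y (F.pt z i) 𝒜 a| ≤ ‖hc (γ 1) - hc (γ 0)‖ := by rw [hfl]; exact abs_cpart_le _ _
    _ ≤ S * (2 * (D * Real.exp (-(κ * C.d Y)))) := path_difference_le hS0 hγd hmem hdiff hbound
    _ = 2 * S * (D * Real.exp (-(κ * C.d Y))) := by ring

/-- `FluctDampedOne` with the layered profile FROM THE PATH FRAME [folklore]: `fluctDampedOne_of_collar` with the margin-Cauchy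
binder discharged by `marginCauchy_of_pathFrame` (`c₀ = 2`, so `s₀ = 2ε/g₀`). -/
theorem fluctDampedOne_of_pathFrame {F : CplxFrame C A E} {G : Generation C} {ch : FluctChart C A} {W : Set (ℕ → ℝ)}
    {κ : ℝ} {AdmT : (ℕ → ℝ) → BTable C C.BgB → Prop} {lg : LayerGauge C} {gap : C.Dom → C.Dom → ℕ → ℝ}
    {g₀ ρ ε δ : ℝ}
    (hCh : FrameChart F ch) (hCo : FrameCore F ch) (hP : FramePath F G ch lg gap) (hAn : FrameAnalytic F W AdmT)
    (hGap : GapShape G gap g₀ ρ) (hCD : CollarDecay ch lg ε δ)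
    (hg₀ : 0 < g₀) (hρ : 0 ≤ ρ) (hε : 0 ≤ ε) (hδ : 0 ≤ δ) (hδ1 : δ ≤ 1) (hδρ : δ * ρ ≤ 1) (h2ε : 2 * ε ≤ g₀) :
    FluctDampedOne G ch W κ AdmT (layeredSigma C (2 * ε / g₀) δ ρ) :=
  fluctDampedOne_of_collar (marginCauchy_of_pathFrame hCh hCo hP hAn fun X Y hY j hj => (hGap X Y hY j hj).1) hGap
    hCD (by norm_num) hg₀ hρ hε hδ hδ1 hδρ h2ε

/-- The two-table form from the path frame, by linearity (`fluctDamped_of_one`, §10). [folklore] -/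
theorem fluctDamped_of_pathFrame {F : CplxFrame C A E} {G : Generation C} {ch : FluctChart C A} {W : Set (ℕ → ℝ)}
    {κ : ℝ} {Adm : (ℕ → ℝ) → BTable C C.BgB → ETable C C.BgB → Prop} {AdmT : (ℕ → ℝ) → BTable C C.BgB → Prop}
    {lg : LayerGauge C} {gap : C.Dom → C.Dom → ℕ → ℝ} {g₀ ρ ε δ : ℝ}
    (hcl : ∀ g ∈ W, ∀ (f f' : BTable C C.BgB) (e e' : ETable C C.BgB), Adm g f e → Adm g f' e' → AdmT g (f - f'))
    (hCh : FrameChart F ch) (hCo : FrameCore F ch) (hP : FramePath F G ch lg gap) (hAn : FrameAnalytic F W AdmT)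
    (hGap : GapShape G gap g₀ ρ) (hCD : CollarDecay ch lg ε δ)
    (hg₀ : 0 < g₀) (hρ : 0 ≤ ρ) (hε : 0 ≤ ε) (hδ : 0 ≤ δ) (hδ1 : δ ≤ 1) (hδρ : δ * ρ ≤ 1) (h2ε : 2 * ε ≤ g₀) :
    FluctDamped G ch W κ Adm (layeredSigma C (2 * ε / g₀) δ ρ) :=
  fluctDamped_of_one hcl (fluctDampedOne_of_pathFrame hCh hCo hP hAn hGap hCD hg₀ hρ hε hδ hδ1 hδρ h2ε)

/-- **END-TO-END FROM THE PATH FRAME** [folklore]: `ne5B_of_collar` (§12) with its `MarginCauchy c₀` binder replaced by the path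
frame (`c₀ = 2`): `RepresentsA/B` + `TiltLip KT` + closure of the admissible class under differences + `FrameChart` + `FrameCore`
+ `FramePath` + `FrameAnalytic` + `GapShape g₀ ρ` + `CollarDecay ε δ` + `OpDisc` + admissibility of both runs' tables +
`SliceCountGrowing` + `EKernelContracts` + the regular inputs' rate give `NE5B` with the constant
`(Cop + lamE·CE)/(1 − kT·((2ε/g₀)/(1 − δρ))·Mc·(δV/θ)/(1 − δV/θ))`.  `NE5B` stays NOT PRINTED; `TiltLip`, `OpDisc` two-run. -/
theorem ne5B_of_pathFrame {F : CplxFrame C A E} {G : Generation C} {ch : FluctChart C A} {ΦA : GenMap C C.BgA}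
    {Φ : GenMap C C.BgB} {BA : BFunctional C C.BgA} {BB : BFunctional C C.BgB}
    {EA : Functional C.toCarriers C.BgA} {EB : Functional C.toCarriers C.BgB} {W : Set (ℕ → ℝ)}
    {Adm : (ℕ → ℝ) → BTable C C.BgB → ETable C C.BgB → Prop} {AdmT : (ℕ → ℝ) → BTable C C.BgB → Prop}
    {lg : LayerGauge C} {gap : C.Dom → C.Dom → ℕ → ℝ}
    {κ θ δ ρ kT g₀ ε Mc V Cop CE lamE : ℝ} {KT : C.Dom → C.Dom → ℝ}
    (hRA : RepresentsA ΦA BA EA W) (hRB : RepresentsB Φ BB EB W)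
    (hT : TiltLip G ch Φ W κ Adm KT)
    (hcl : ∀ g ∈ W, ∀ (f f' : BTable C C.BgB) (e e' : ETable C C.BgB), Adm g f e → Adm g f' e' → AdmT g (f - f'))
    (hCh : FrameChart F ch) (hCo : FrameCore F ch) (hP : FramePath F G ch lg gap) (hAn : FrameAnalytic F W AdmT)
    (hGap : GapShape G gap g₀ ρ) (hCD : CollarDecay ch lg ε δ)
    (hKT0 : ∀ X Y, 0 ≤ KT X Y) (hKT : ∀ X : C.Dom, ∀ Y ∈ G.parents X, KT X Y ≤ kT)
    (hOD : OpDisc ΦA Φ BA EA W κ θ Cop)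
    (hadmA : ∀ g ∈ W, Adm g (pullB BA g) (epullB EA g)) (hadmB : ∀ g ∈ W, Adm g (tabB BB g) (etabB EB g))
    (hS : SliceCountGrowing G κ (fun _ _ => 1) Mc V)
    (hKE : EKernelContracts G κ θ lamE) (hE : NE5 EA EB W κ θ CE)
    (hθ : 0 < θ) (hg₀ : 0 < g₀) (hρ : 0 ≤ ρ) (hε : 0 ≤ ε) (hδ : 0 ≤ δ) (hδ1 : δ ≤ 1) (hδρ : δ * ρ < 1)
    (h2ε : 2 * ε ≤ g₀) (hV : 0 ≤ V) (hδθ : δ * V < θ) (hkT : 0 ≤ kT) (hMc : 0 ≤ Mc)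
    (hsmall : kT * ((2 * ε / g₀) / (1 - δ * ρ)) * Mc * (δ * V / θ) / (1 - δ * V / θ) < 1)
    (hCop : 0 ≤ Cop) (hCE : 0 ≤ CE) (hlamE : 0 ≤ lamE) :
    NE5B BA BB W κ θ
      ((Cop + lamE * CE) / (1 - kT * ((2 * ε / g₀) / (1 - δ * ρ)) * Mc * (δ * V / θ) / (1 - δ * V / θ))) :=
  ne5B_of_collar hRA hRB hT hcl (marginCauchy_of_pathFrame hCh hCo hP hAn fun X Y hY j hj => (hGap X Y hY j hj).1)
    hGap hCD hKT0 hKT hOD hadmA hadmB hS hKE hE hθ (by norm_num) hg₀ hρ hε hδ hδ1 hδρ h2ε hV hδθ hkT hMc hsmall hCop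
    hCE hlamE

/-- THE AFFINE FRAME AS A PATH FRAME [folklore]: if the SEGMENT `z + t•disp`, `t ∈ [0,1]`, consists of margin points, (F-G) gives
(F-P) with the straight path and constant velocity `disp` — print's affine `t_□`-device is the special case of a linear `B(t)`. -/
theorem framePath_of_segment {F : CplxFrame C A E} {G : Generation C} {ch : FluctChart C A} {lg : LayerGauge C}
    {gap : C.Dom → C.Dom → ℕ → ℝ} (hG : FrameGauge F ch lg)
    (hseg : ∀ (X : C.Dom) (z : E) (i : Fin 2), F.pt z i ∈ ch.core X → ∀ 𝒜 ∈ ch.supp X,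
      ∀ t ∈ Set.Icc (0 : ℝ) 1, z + (t : ℂ) • F.disp X z 𝒜 ∈ marginPts F G gap X) :
    FramePath F G ch lg gap := by
  intro X z i hz 𝒜 h𝒜
  refine ⟨fun t => z + (t : ℂ) • F.disp X z 𝒜, fun _ => F.disp X z 𝒜, by simp, by simp, ?_, hseg X z i hz 𝒜 h𝒜,
    fun t _ n => hG X z i hz 𝒜 h𝒜 n⟩
  intro t _
  have h1 : HasDerivAt (fun y : ℝ => (y : ℂ)) 1 t := by simpa using (hasDerivAt_id t).ofReal_comp
  have h2 := (h1.smul_const (F.disp X z 𝒜)).const_add z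
  simp only [one_smul] at h2
  exact h2.hasDerivWithinAt

end PathFrame

/-! #### §12f(ii) The §12c toy is a path frame, with print's margin split visible -/

/-- The toy chart read in the frame with ANY encoded radius `ρ'`: the chart is the frame translation. [folklore] -/
theorem shift_frameChart' (ρ' ρ r s : ℝ) : FrameChart (shiftFrame ρ' r) (shiftChart ρ s) := fun _ _ _ _ _ _ => rfl

/-- … every toy background is an encoded point. [folklore] -/
theorem shift_frameCore' (ρ' ρ r s : ℝ) : FrameCore (shiftFrame ρ' r) (shiftChart ρ s) := fun _ U _ => ⟨U.1, U.2, rfl⟩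

/-- … the toy gauge reads exactly the modulus of the displacement. [folklore] -/
theorem shift_frameGauge' (ρ' ρ r s : ℝ) : FrameGauge (shiftFrame ρ' r) (shiftChart ρ s) shiftGauge := by
  intro X z i _ 𝒜 _ n
  simp [shiftFrame, shiftChart, shiftGauge]

/-- The margin points of the toy frame with encoded radius `ρ' + r` and gap `r` contain the open disc of radius `ρ'`. [folklore] -/
theorem shift_marginPts {ρ' r : ℝ} (hr : 0 < r) {X : ℕ} {z : ℂ} (hz : ‖z‖ < ρ') :
    z ∈ marginPts (shiftFrame ρ' r) (cauchyGeneration r hr) (fun _ _ _ => r) X := by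
  intro Y _ w hw
  have h0 : ‖w‖ ≤ r := by simpa [shiftFrame] using hw 0 (by simp)
  show z + w ∈ ball (0 : ℂ) (ρ' + r)
  rw [mem_ball, dist_zero_right]
  calc ‖z + w‖ ≤ ‖z‖ + ‖w‖ := norm_add_le _ _
    _ < ρ' + r := by linarith

/-- **THE TOY IS A PATH FRAME, WITH PRINT'S MARGIN SPLIT** [folklore]: core radius `ρ`, displacements `‖𝒜‖ ≤ s` — the straight
path `z + t𝒜` stays in the disc of radius `ρ + s` (print: *"𝐇_j(B(t)) satisfies (3.14) with 1/3α₂"*, the PATH's share of the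
margin), about whose points the closed discs of radius `r` (the CIRCLES' share, print's `r max{…} = ⅓α₂`) lie in the encoded
domain of radius `ρ + s + r`. [cite: Balaban1987RG1, (3.14)–(3.17) p.272–273] -/
theorem shift_framePath (ρ r s : ℝ) (hr : 0 < r) :
    FramePath (shiftFrame (ρ + s) r) (cauchyGeneration r hr) (shiftChart ρ s) shiftGauge (fun _ _ _ => r) := by
  refine framePath_of_segment (shift_frameGauge' (ρ + s) ρ r s) fun X z i hz 𝒜 h𝒜 t ht => shift_marginPts hr ?_
  have hz' : ‖z‖ < ρ := hz
  have h𝒜' : ‖𝒜‖ ≤ s := by simpa [shiftChart] using h𝒜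
  have ht0 : 0 ≤ t := ht.1
  have ht1 : t ≤ 1 := ht.2
  calc ‖z + (t : ℂ) • (shiftFrame (ρ + s) r).disp X z 𝒜‖ = ‖z + (t : ℂ) • 𝒜‖ := rfl
    _ ≤ ‖z‖ + ‖(t : ℂ) • 𝒜‖ := norm_add_le _ _
    _ = ‖z‖ + t * ‖𝒜‖ := by rw [norm_smul, Complex.norm_real, Real.norm_of_nonneg ht0]
    _ ≤ ‖z‖ + 1 * s := by gcongr
    _ < ρ + s := by linarith

/-- CONSISTENCY [folklore]: the path-frame route gives the toy's `MarginCauchy` with `c₀ = 2` (half of §12c's `4`) on the encoded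
domain of radius `ρ + s + r` (analyticity class `CauchyAdmT (ρ + s) r`). -/
theorem cauchy_marginCauchy_of_pathFrame (ρ r s : ℝ) (hr : 0 < r) (W : Set (ℕ → ℝ)) (κ : ℝ) :
    MarginCauchy (cauchyGeneration r hr) (shiftChart ρ s) W κ (CauchyAdmT (ρ + s) r) shiftGauge (fun _ _ _ => r) 2 :=
  marginCauchy_of_pathFrame (shift_frameChart' (ρ + s) ρ r s) (shift_frameCore' (ρ + s) ρ r s) (shift_framePath ρ r s hr)
    (shift_frameAnalytic (ρ + s) r W) fun _ _ _ _ _ => hr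

/-- CONSISTENCY [folklore]: the toy's `FluctDampedOne` through the path frame — profile `layeredSigma (2s/r) 1 1` for displacements
`2s ≤ r` on the encoded domain of radius `ρ + s + r` (§10b's `cauchy_fluctDampedOne`: `4s/r` with circles of radius `r/2`). -/
theorem cauchy_fluctDampedOne_of_pathFrame (ρ r s : ℝ) (hr : 0 < r) (hs : 0 ≤ s) (hsr : 2 * s ≤ r) (W : Set (ℕ → ℝ))
    (κ : ℝ) :
    FluctDampedOne (cauchyGeneration r hr) (shiftChart ρ s) W κ (CauchyAdmT (ρ + s) r)
      (layeredSigma cauchyCarriers (2 * s / r) 1 1) :=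
  fluctDampedOne_of_pathFrame (shift_frameChart' (ρ + s) ρ r s) (shift_frameCore' (ρ + s) ρ r s) (shift_framePath ρ r s hr)
    (shift_frameAnalytic (ρ + s) r W) (cauchy_gapShape r hr) (cauchy_collarDecay ρ s) hr zero_le_one hs zero_le_one le_rfl
    (by norm_num) hsr

/-! ### §12g GAUGE NORMALIZATION: `ρ = 2` EXACTLY for the printed radii; the coefficient variation belongs to the collar-decay binder -/

/-- The layer gauge RESCALED by positive layer weights `u n` (read the layer of scale `n` in the unit `u n`) — bookkeeping; with
`u n = α_{·,n}` the printed layer coefficient of (2.28) p. 259 / (2.34)–(2.39) p. 261. [folklore] [cite: Balaban1988Convergent,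
(2.28) p.259, (2.34)–(2.39) p.261] -/
noncomputable def LayerGauge.rescale (lg : LayerGauge C) (u : ℕ → ℝ) (hu : ∀ n, 0 < u n) : LayerGauge C where
  dist := fun n U' U => lg.dist n U' U / u n
  dist_nonneg := fun n U' U => div_nonneg (lg.dist_nonneg n U' U) (hu n).le
  dist_self := fun n U => by simp [lg.dist_self]

/-- The rescaled gauge, unfolded. [folklore] -/
@[simp] theorem LayerGauge.rescale_dist (lg : LayerGauge C) (u : ℕ → ℝ) (hu : ∀ n, 0 < u n) (n : ℕ) (U' U : C.BgB) :
    (lg.rescale u hu).dist n U' U = lg.dist n U' U / u n := rfl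

/-- `MarginCauchy` IS GAUGE-COVARIANT [folklore]: rescaling the layer gauge and the gaps by the same positive layer weights leaves
the displacement-over-margin ratios and the half-gap precondition unchanged. -/
theorem marginCauchy_rescale {A : Type} {G : Generation C} {ch : FluctChart C A} {W : Set (ℕ → ℝ)} {κ : ℝ}
    {AdmT : (ℕ → ℝ) → BTable C C.BgB → Prop} {lg : LayerGauge C} {gap : C.Dom → C.Dom → ℕ → ℝ} {c₀ : ℝ}
    (u : ℕ → ℝ) (hu : ∀ n, 0 < u n) (h : MarginCauchy G ch W κ AdmT lg gap c₀) :
    MarginCauchy G ch W κ AdmT (lg.rescale u hu) (fun X Y j => gap X Y j / u (C.scale Y - j)) c₀ := by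
  intro g hg hT hh X Y hY D hD hsup U hU 𝒜 h𝒜 hhalf a ha
  have hhalf' : ∀ j ∈ range (C.scale Y + 1), lg.dist (C.scale Y - j) (ch.chart X U 𝒜) U ≤ gap X Y j / 2 := by
    intro j hj
    have h1 := hhalf j hj
    rw [LayerGauge.rescale_dist, div_right_comm, div_le_div_iff_of_pos_right (hu _)] at h1
    exact h1
  have key := h g hg hT hh X Y hY D hD hsup U hU 𝒜 h𝒜 hhalf' a ha
  simp_rw [LayerGauge.rescale_dist, div_div_div_cancel_right₀ (hu _).ne']
  exact key

/-- A coefficient FLOOR enters the collar-decay amplitude, not the gap ratio [folklore]: `CollarDecay ch lg ε δ` and `u₀ ≤ u n`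
(`u₀ > 0`) give `CollarDecay ch (lg.rescale u hu) (ε/u₀) δ`. -/
theorem collarDecay_rescale_of_floor {A : Type} {ch : FluctChart C A} {lg : LayerGauge C} {ε δ u₀ : ℝ} {u : ℕ → ℝ}
    (hu : ∀ n, 0 < u n) (hu₀ : 0 < u₀) (hfloor : ∀ n, u₀ ≤ u n) (hε : 0 ≤ ε) (hδ : 0 ≤ δ)
    (h : CollarDecay ch lg ε δ) : CollarDecay ch (lg.rescale u hu) (ε / u₀) δ := by
  intro X U hU 𝒜 h𝒜 n hn
  rw [LayerGauge.rescale_dist, div_le_iff₀ (hu n)]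
  calc lg.dist n (ch.chart X U 𝒜) U ≤ ε * δ ^ (C.scale X - n) := h X U hU 𝒜 h𝒜 n hn
    _ = ε / u₀ * δ ^ (C.scale X - n) * u₀ := by field_simp
    _ ≤ ε / u₀ * δ ^ (C.scale X - n) * u n :=
        mul_le_mul_of_nonneg_left (hfloor n) (mul_nonneg (div_nonneg hε hu₀.le) (pow_nonneg hδ _))

/-- **`GapShape` WITH `ρ = 2` EXACTLY, LAYER-VARYING COEFFICIENTS** [folklore arithmetic on pv02's typed radii]: the printed radius of
the index-`j` space on the layer `n` is `(1 − β(1 − 2^{−(j−n)}))·α_{·,n}` ((2.34)–(2.37), (2.39) p. 261) with a coefficient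
`α_{·,n}` that VARIES with the layer ((2.28) p. 259 *"α_{0,j} = g_jC₀(log g_j^{−2})^{q₀}, α_{1,j} = g_jC₁(log g_j^{−2})^{q₁}"*);
read in the unit `α (scale Y − j)` of its own layer, the margin `a·(shrink β j − shrink β (scale X − scale Y + j))·α(scale Y − j)`
becomes the layer-constant profile of `gapShape_of_shrink`: `g₀ = aβ/2`, `ρ = 2`, WHATEVER the variation of `α`.  Where the
variation goes: into the collar-decay binder read in the same units (`CollarDecay ch (lg.rescale α _) ε δ` = displacement on the
layer over the layer's own coefficient — print's per-layer comparison of the shift with the room, p. 277, typed for the innermost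
layer in `B14Radii` §D–§E (`innermost_fits_iff`, `fits_of_exponents`: `p₀ ≤ q₀`)).  No law for `α_{·,n}` across layers is asserted
((2.8)–(2.9) p. 256 display comparability for `ε_n`, `R_n` only: *"Similar inequalities hold for other constants"*). [cite:
Balaban1988Convergent, (2.28) p.259, (2.34)–(2.39) p.261, p.277] -/
theorem gapShape_of_shrink_normalized (G : Generation C) {a β : ℝ} {α : ℕ → ℝ} (ha : 0 < a) (hβ : 0 < β)
    (hα : ∀ n, 0 < α n) :
    GapShape G (fun X Y j => a * (B14Radii.shrink β j - B14Radii.shrink β (C.scale X - C.scale Y + j)) * α (C.scale Y - j) /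
      α (C.scale Y - j)) (a * β / 2) 2 := by
  intro X Y hY j hj
  obtain ⟨h1, h2⟩ := gapShape_of_shrink G ha hβ one_pos X Y hY j hj
  beta_reduce at h1 h2 ⊢
  have hgap_eq : a * (B14Radii.shrink β j - B14Radii.shrink β (C.scale X - C.scale Y + j)) * α (C.scale Y - j) /
      α (C.scale Y - j) = a * (B14Radii.shrink β j - B14Radii.shrink β (C.scale X - C.scale Y + j)) * 1 := by
    rw [mul_div_assoc, div_self (hα _).ne']
  have hg₀ : a * β / 2 = a * β * 1 / 2 := by rw [mul_one]
  rw [hgap_eq, hg₀]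
  exact ⟨h1, h2⟩

/-- **`FluctDampedOne` WITH `ρ = 2` FOR LAYER-VARYING COEFFICIENTS** [folklore]: the margin-Cauchy shape on the printed-radii gaps
`a·(shrink β j − shrink β (scale X − scale Y + j))·α(scale Y − j)` (any modulus `c₀ ≥ 0`, e.g. `2` from the path frame or `4` from
the affine frame) and the collar-decay shape READ IN THE LAYER'S OWN COEFFICIENT UNIT (`lg.rescale α`, amplitude `ε`, per-collar
ratio `δ ≤ ½`) give `FluctDampedOne` with `σ = layeredSigma (c₀ε/(aβ/2)) δ 2` — the ratio `ρ = 2` is the kernel-exact halving of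
the printed factors, no longer a carrier of the coefficient variation (§11(k) of the record resolved: nothing is owed to `ρ`; the
variation is part of the normalized collar-decay binder, i.e. of wall W2a's input). -/
theorem fluctDampedOne_of_collar_normalized {A : Type} {G : Generation C} {ch : FluctChart C A} {W : Set (ℕ → ℝ)} {κ : ℝ}
    {AdmT : (ℕ → ℝ) → BTable C C.BgB → Prop} {lg : LayerGauge C} {a β c₀ ε δ : ℝ} {α : ℕ → ℝ} (hα : ∀ n, 0 < α n)
    (hMC : MarginCauchy G ch W κ AdmT lg
      (fun X Y j => a * (B14Radii.shrink β j - B14Radii.shrink β (C.scale X - C.scale Y + j)) * α (C.scale Y - j)) c₀)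
    (hCD : CollarDecay ch (lg.rescale α hα) ε δ)
    (hc₀ : 0 ≤ c₀) (ha : 0 < a) (hβ : 0 < β) (hε : 0 ≤ ε) (hδ : 0 ≤ δ) (hδ2 : δ ≤ 1 / 2) (h2ε : 2 * ε ≤ a * β / 2) :
    FluctDampedOne G ch W κ AdmT (layeredSigma C (c₀ * ε / (a * β / 2)) δ 2) :=
  fluctDampedOne_of_collar (marginCauchy_rescale α hα hMC) (gapShape_of_shrink_normalized G ha hβ hα) hCD hc₀
    (by positivity) (by norm_num) hε hδ (by linarith) (by linarith) h2ε


/-! ### §12h CONVEX ENCODINGS: for convex encoded domains the path hypothesis (F-P) is two static inclusions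

For an encoding whose parents' domains `dom Y` are CONVEX (in the real structure of the complex space `E`), the margin points of a
step form a convex set, so the CHORD from the encoded core point `z` to the displaced point `z + disp X z 𝒜` consists of margin points
as soon as its two ENDPOINTS do: with the affine gauge domination (F-G) for the chord's constant velocity (and, for the necessity of
(F-M), a NONEMPTY set of admissible amplitudes — `framePath_iff_margins_of_convex`'s binder `hne`), (F-P) `FramePath` is then
EQUIVALENT to (F-M) `FrameMargin` (the start point keeps the margin — the powers of 1/2, [III] p. 277) together with the new
endpoint shape (F-E) `FrameEndMargin` (the DISPLACED point keeps the margin — the typed face, for such encodings, of the sentence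
that keeps print's path in the space, [I] p. 273 *"We assume also that ε₁ is so small that 𝐇_j(B(t)) satisfies (3.14) with 1/3α₂ on
the right-hand side."*, read at the path's end `t = 1`, and of [III] p. 277 *"this difference is still much greater than bounds on this
function"*).  HONEST FRAMING: convexity is a property of an ENCODING `E`, `dom`, which an instantiation chooses; print's conditions
(2.34)–(2.39) p. 261 bound `|∂U − 1|`, `|𝐉|`, `|A|`, `|A′|` of group- and algebra-valued multi-scale configurations, and NOTHING is
claimed here about the existence of a convex encoding of those spaces — the section records only what convexity BUYS: the path
clause of (F-P) disappears into two inclusions, the second of which is the FIT of the lineage's second satellite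
(`T4BoundaryRateFrame.PathFits`, there proved equivalent to (F-P) on a non-affine model; its §13g (v1.1) proves (F-E) ⟺ `PathFits`
and (F-M) ⟺ the static fit BY NAME on that model, and its §13h shows the convexity binder below LOAD-BEARING by two toy frames on
the Cauchy carriers — disconnected domains with all five shapes and no path; an annulus with a curved path and no chord).  Elementary
convexity [folklore];
quotations CONTEXT only; nothing of Bałaban's asserted. -/

section Chord

variable {A : Type} {E : Type*} [NormedAddCommGroup E] [NormedSpace ℂ E]

/-- **MARGIN POINTS ARE CONVEX FOR CONVEX ENCODED DOMAINS** [folklore]: `marginPts F G gap X` is the intersection over the parents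
`Y` and the gap vectors `w` of the translates `dom Y − w`, each convex when `dom Y` is. -/
theorem convex_marginPts {F : CplxFrame C A E} {G : Generation C} {gap : C.Dom → C.Dom → ℕ → ℝ} {X : C.Dom}
    (hdom : ∀ Y ∈ G.parents X, Convex ℝ (F.dom Y)) : Convex ℝ (marginPts F G gap X) := by
  intro z₁ hz₁ z₂ hz₂ a b ha hb hab Y hY w hw
  have h := hdom Y hY (hz₁ Y hY w hw) (hz₂ Y hY w hw) ha hb hab
  have heq : a • z₁ + b • z₂ + w = a • (z₁ + w) + b • (z₂ + w) := by
    rw [smul_add, smul_add, add_add_add_comm, ← add_smul, hab, one_smul]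
  rw [heq]; exact h

/-- **(F-E) HYPOTHESIS SHAPE — THE DISPLACED POINT KEEPS THE MARGIN** (typed; asserted for nothing of Bałaban's): for every
core-encoded point `z` of the step creating `X` and every admissible amplitude `𝒜`, the displaced point `z + disp X z 𝒜` is a
margin point of the step — every parent's encoded domain still contains it together with the closed gap polydisc of the circles.
Print keeps the WHOLE path in the space by an assumed smallness, [I] p. 273 *"We assume also that ε₁ is so small that 𝐇_j(B(t))
satisfies (3.14) with 1/3α₂ on the right-hand side."* (all `t`; here its endpoint `t = 1`), the room being [III] p. 277's *"this
difference is still much greater than bounds on this function"* — never displayed in print as an inequality; on the exponential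
layered model of `T4BoundaryRateFrame` this shape is the FIT `PathFits`. [cite: Balaban1987RG1, (3.14) p.272, p.273;
Balaban1988Convergent, p.277] -/
def FrameEndMargin (F : CplxFrame C A E) (G : Generation C) (ch : FluctChart C A)
    (gap : C.Dom → C.Dom → ℕ → ℝ) : Prop :=
  ∀ (X : C.Dom) (z : E) (i : Fin 2), F.pt z i ∈ ch.core X → ∀ 𝒜 ∈ ch.supp X,
    z + F.disp X z 𝒜 ∈ marginPts F G gap X

/-- (F-P) CONTAINS (F-M) [folklore]: the start `γ 0 = z` of the interpolation path is a margin point (admissible amplitudes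
nonempty, e.g. `0 ∈ supp X`). -/
theorem frameMargin_of_framePath {F : CplxFrame C A E} {G : Generation C} {ch : FluctChart C A} {lg : LayerGauge C}
    {gap : C.Dom → C.Dom → ℕ → ℝ} (hne : ∀ X : C.Dom, (ch.supp X).Nonempty) (hP : FramePath F G ch lg gap) :
    FrameMargin F G ch gap := by
  rw [frameMargin_iff_marginPts]
  intro X z i hz
  obtain ⟨𝒜, h𝒜⟩ := hne X
  obtain ⟨γ, γ', h0, -, -, hm, -⟩ := hP X z i hz 𝒜 h𝒜
  simpa [h0] using hm 0 (by simp)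

/-- (F-P) CONTAINS (F-E) [folklore]: the end `γ 1 = z + disp X z 𝒜` of the interpolation path is a margin point. -/
theorem frameEndMargin_of_framePath {F : CplxFrame C A E} {G : Generation C} {ch : FluctChart C A} {lg : LayerGauge C}
    {gap : C.Dom → C.Dom → ℕ → ℝ} (hP : FramePath F G ch lg gap) : FrameEndMargin F G ch gap := by
  intro X z i hz 𝒜 h𝒜
  obtain ⟨γ, γ', -, h1, -, hm, -⟩ := hP X z i hz 𝒜 h𝒜
  simpa [h1] using hm 1 (by simp)

/-- **THE CHORD IS A PATH FRAME FOR CONVEX ENCODINGS** [folklore]: (F-G) for the chord's constant velocity `disp X z 𝒜`, convex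
parents' domains, (F-M) for the start point and (F-E) for the displaced point give (F-P) — the chord `z + t•disp X z 𝒜`,
`t ∈ [0,1]`, runs through margin points by `convex_marginPts`, and `framePath_of_segment` concludes.  The velocity constant is the
affine one of (F-G) (no curved-path loss; compare `T4BoundaryRateFrame.exp_framePath` (endpoint gauge ×4) with
`T4BoundaryRateFrame.exp_framePath_chord` (×1)). -/
theorem framePath_of_convex {F : CplxFrame C A E} {G : Generation C} {ch : FluctChart C A} {lg : LayerGauge C}
    {gap : C.Dom → C.Dom → ℕ → ℝ} (hG : FrameGauge F ch lg) (hdom : ∀ X : C.Dom, ∀ Y ∈ G.parents X, Convex ℝ (F.dom Y))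
    (hM : FrameMargin F G ch gap) (hE : FrameEndMargin F G ch gap) : FramePath F G ch lg gap := by
  refine framePath_of_segment hG fun X z i hz 𝒜 h𝒜 t ht => ?_
  have h0 : z ∈ marginPts F G gap X := (frameMargin_iff_marginPts F G ch gap).1 hM X z i hz
  have h1 : z + F.disp X z 𝒜 ∈ marginPts F G gap X := hE X z i hz 𝒜 h𝒜
  have h := convex_marginPts (hdom X) h0 h1 (sub_nonneg.2 ht.2) ht.1 (sub_add_cancel 1 t)
  have heq : z + (t : ℂ) • F.disp X z 𝒜 = (1 - t) • z + t • (z + F.disp X z 𝒜) := by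
    rw [Complex.coe_smul, smul_add, sub_smul, one_smul]; abel
  rw [heq]; exact h

/-- **FOR CONVEX ENCODINGS (F-P) ⟺ (F-M) ∧ (F-E)** [folklore]: with (F-G) and convex parents' domains (admissible amplitudes
nonempty), the path hypothesis of §12f is EXACTLY the two static inclusions — the interpolation device costs nothing beyond where
its two endpoints sit.  What an instantiation with a convex encoding owes for (F-P) is therefore (F-M) (the powers of 1/2, typed
§12e) and (F-E) (the fit: print's assumed ε₁-smallness, p. 273, to be NAMED as a coupling-side conditional).
[cite: Balaban1987RG1, (3.4) p.270, p.273; Balaban1988Convergent, p.277] -/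
theorem framePath_iff_margins_of_convex {F : CplxFrame C A E} {G : Generation C} {ch : FluctChart C A} {lg : LayerGauge C}
    {gap : C.Dom → C.Dom → ℕ → ℝ} (hG : FrameGauge F ch lg) (hdom : ∀ X : C.Dom, ∀ Y ∈ G.parents X, Convex ℝ (F.dom Y))
    (hne : ∀ X : C.Dom, (ch.supp X).Nonempty) :
    FramePath F G ch lg gap ↔ FrameMargin F G ch gap ∧ FrameEndMargin F G ch gap :=
  ⟨fun hP => ⟨frameMargin_of_framePath hne hP, frameEndMargin_of_framePath hP⟩,
    fun h => framePath_of_convex hG hdom h.1 h.2⟩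

/-- The §12c toy with encoded radius `ρ + s + r`: core points (`‖z‖ < ρ`) keep the margin `r` (`0 ≤ s`). [folklore] -/
theorem shift_frameMargin' (ρ r s : ℝ) (hr : 0 < r) (hs : 0 ≤ s) :
    FrameMargin (shiftFrame (ρ + s) r) (cauchyGeneration r hr) (shiftChart ρ s) (fun _ _ _ => r) := by
  rw [frameMargin_iff_marginPts]
  intro X z i hz
  have hz' : ‖z‖ < ρ := hz
  exact shift_marginPts hr (by linarith)

/-- … and displaced points (`‖z + 𝒜‖ < ρ + s`) keep the margin `r`: the toy's (F-E). [folklore] -/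
theorem shift_frameEndMargin (ρ r s : ℝ) (hr : 0 < r) :
    FrameEndMargin (shiftFrame (ρ + s) r) (cauchyGeneration r hr) (shiftChart ρ s) (fun _ _ _ => r) := by
  intro X z i hz 𝒜 h𝒜
  have hz' : ‖z‖ < ρ := hz
  have h𝒜' : ‖𝒜‖ ≤ s := by simpa [shiftChart] using h𝒜
  refine shift_marginPts hr ?_
  calc ‖z + (shiftFrame (ρ + s) r).disp X z 𝒜‖ = ‖z + 𝒜‖ := rfl
    _ ≤ ‖z‖ + ‖𝒜‖ := norm_add_le _ _
    _ < ρ + s := by linarith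

/-- CONSISTENCY [folklore]: the §12c toy (encoded domains = discs, convex) is a path frame by `framePath_of_convex` — the same
statement as §12f(ii)'s `shift_framePath` (there by the explicit segment estimate), here from the two endpoint inclusions. -/
theorem shift_framePath_convex (ρ r s : ℝ) (hr : 0 < r) (hs : 0 ≤ s) :
    FramePath (shiftFrame (ρ + s) r) (cauchyGeneration r hr) (shiftChart ρ s) shiftGauge (fun _ _ _ => r) :=
  framePath_of_convex (shift_frameGauge' (ρ + s) ρ r s) (fun _ _ _ => convex_ball _ _) (shift_frameMargin' ρ r s hr hs)
    (shift_frameEndMargin ρ r s hr)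

end Chord


end Literature.MathematicalPhysics.QuantumFieldTheory.Balaban1983to89.T4BoundaryRateCollar
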